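import Literature.AlgebraicGeometry.Motives.HodgeThetaSubalgebraUnitaryOrthogonalChainPos
import Literature.AlgebraicGeometry.Motives.HodgeThetaSubalgebraUnitaryFortyOneFortyThreeGoodRankCores
import Literature.AlgebraicGeometry.Motives.HodgeThetaSubalgebraUnitaryEighteenThirtyFiveCore
import Literature.AlgebraicGeometry.Motives.HodgeThetaSubalgebraUnitaryThirtyFiveFortyFourCorePart1
import Literature.AlgebraicGeometry.Motives.HodgeThetaSubalgebraUnitaryThirtyFiveThirtySixCorePart1
import Literature.AlgebraicGeometry.Motives.HodgeThetaSubalgebraUnitaryThirtyFiveThirtySixCorePart2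
import Literature.AlgebraicGeometry.Motives.HodgeThetaSubalgebraUnitaryTwentyEightThirtyThreeCorePart1
import Literature.AlgebraicGeometry.Motives.HodgeThetaSubalgebraUnitaryTwentyFiveThirtySixCorePart1
import Literature.AlgebraicGeometry.Motives.HodgeThetaSubalgebraUnitaryThirtyFiveFortyEightCorePart2
import Literature.AlgebraicGeometry.Motives.HodgeThetaSubalgebraUnitaryThirtyFiveThirtyEightCorePart1
import HarnessLib
import Literature.AlgebraicGeometry.Motives.HodgeThetaSubalgebraUnitaryConstantRankLeviThree
import Literature.AlgebraicGeometry.Motives.HodgeThetaSubalgebraUnitaryEightFifteenCore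
import Literature.AlgebraicGeometry.Motives.HodgeThetaSubalgebraUnitaryEightNineCore
import Literature.AlgebraicGeometry.Motives.HodgeThetaSubalgebraUnitaryEightTwentyOneCore
import Literature.AlgebraicGeometry.Motives.HodgeThetaSubalgebraUnitaryFifteenSixteenCore
import Literature.AlgebraicGeometry.Motives.HodgeThetaSubalgebraUnitaryFiveCoreAll
import Literature.AlgebraicGeometry.Motives.HodgeThetaSubalgebraUnitaryFourOddCore
import Literature.AlgebraicGeometry.Motives.HodgeThetaSubalgebraUnitaryFourteenFifteenCore
import Literature.AlgebraicGeometry.Motives.HodgeThetaSubalgebraUnitaryNineElevenCore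
import Literature.AlgebraicGeometry.Motives.HodgeThetaSubalgebraUnitaryNineFourteenCore
import Literature.AlgebraicGeometry.Motives.HodgeThetaSubalgebraUnitaryNineTenCore
import Literature.AlgebraicGeometry.Motives.HodgeThetaSubalgebraUnitaryNineTwentyCore
import Literature.AlgebraicGeometry.Motives.HodgeThetaSubalgebraUnitaryRankOneRaise
import Literature.AlgebraicGeometry.Motives.HodgeThetaSubalgebraUnitarySeventeenCore
import Literature.AlgebraicGeometry.Motives.HodgeThetaSubalgebraUnitarySixSevenCoreAll
import Literature.AlgebraicGeometry.Motives.HodgeThetaSubalgebraUnitaryTenNineteenCore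
import Literature.AlgebraicGeometry.Motives.HodgeThetaSubalgebraUnitaryTenTwentyOneCore
import Literature.AlgebraicGeometry.Motives.HodgeThetaSubalgebraUnitaryThreeCoprimeCore
import Literature.AlgebraicGeometry.Motives.HodgeThetaSubalgebraUnitaryTwelveNineteenCore
import Literature.AlgebraicGeometry.Motives.HodgeThetaSubalgebraUnitaryTwelveThirteenCore
import Literature.AlgebraicGeometry.Motives.HodgeThetaSubalgebraUnitaryTwoOddCore

/-!
# (Part 3 of 5 — lemmas) The `Θ`-subalgebra theorem for unitary multiplicities `(35, 48)` — a `p = 83` cell by minimal-rank base points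
# and sub-Levi recursion (Ribet 1983 Thm. 3, Lie step; abelian 83-folds of type `(35, 48)`)

Family `hodge`, layer `Literature/AlgebraicGeometry/Motives` (pure linear algebra over `ℂ`; no geometry). Research
context: cell `pub-hodge-ring2` (HONEST FRAMING: research route conditional on HC_CM; not a corollary; Q11.4-sentence-2
already refuted in dim ≥ 3), Literature lane gen 89. UNCONDITIONAL; theorems only, no definition, no named fact
(D-0026), no `sorry`.

THE PRINT. K. A. Ribet, Amer. J. Math. 105 (1983), Thm. 3 = Gordon's survey Thm. 6.3 (3) [held
`paper:arxiv-alg-geom_9709030` p. 18]. THE METHOD: `HodgeThetaSubalgebraUnitarySixteenTwentyOneCore` (a raising operator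
`B` of MINIMAL non-zero rank `m`, the profile dichotomy `i + j ≤ m` or `i, j ≥ m`, tree cores making a Levi algebra full
or killing a Levi rank, lifts `UnitaryRaisingSpace.exists_raise_finrank_range_eq` + `UnitaryLeviSetup.exists_lift`, two
pencils `UnitaryGenericRank.exists_finrank_le_and_finrank_le`, the non-vanishing lemma
`UnitaryLeviFull.exists_raise_commute_apply_ne_zero`, TOOL C `UnitaryConstantRank.exists_raise_rank_ne_two`, TOOL F
`UnitaryConstantRank.false_of_le_rank`), the full-rank chain `UnitaryConstantRank.dvd_of_rank_eq_finrank`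
(`HodgeThetaSubalgebraUnitaryNineTwentyEightCore`) and TOOL G `UnitaryOrthogonalChain.false_of_constProfile`.

THIS PART FILE holds minimal-rank lemmas of the cell (the gate caps a proposal at 200 kB); the core theorem `UnitaryThirtyFiveFortyEight.eq_top_of_smul` is assembled in `HodgeThetaSubalgebraUnitaryThirtyFiveFortyEightCore`.

THE CELL `(35 | 48)`. Good ranks 1, 5, 7, 11, 13, 35 (Levi types `(1|47)`, `(5|43)`, `(7|41)`, `(11|37)`, `(13|35)`, `(35|13)` are tree cores); a proper `𝔊` has
raising ranks in `{0, 2, 3, 4, 6, 8, 9, 10, 12, 14, 15, 16, 17, 18, 19, 20, 21, 22, 23, 24, 25, 26, 27, 28, 29, 30, 31, 32, 33, 34}`; `m` minimal non-zero, `B` of rank `m`; a commuting raising `X` has profile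
`(i, j)` (`i + j` a raising rank, `i + j ≤ m` or `i, j ≥ m`). SUB-LEVI RECURSION: when the non-zero profiles are constantly
`(i, j)`, the Levi algebra `L⁺` (resp. `L⁻`) is a `Θ`-algebra whose non-zero raising ranks are all `i` (resp. `j`), and the
same minimal-rank analysis applies to it (the `sub…` lemmas of §1).
* `m = 2` (`U⁺` of type `(33 | 2)`, `U⁻` of type `(2 | 46)`): `L⁺` of type `(33 | 2)` is full and a lift with `i = 1` has `j ∈ {1}`, killed in `L⁻` (type `(2 | 46)`).
* `m = 3` (`U⁺` of type `(32 | 3)`, `U⁻` of type `(3 | 45)`): `L⁺` of type `(32 | 3)` is full and a lift with `i = 1` has `j ∈ {2}`, killed in `L⁻` (type `(3 | 45)`).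
* `m = 4` (`U⁺` of type `(31 | 4)`, `U⁻` of type `(4 | 44)`): `L⁺` of type `(31 | 4)` is full and a lift with `i = 1` has `j ∈ {3}`, killed in `L⁻` (type `(4 | 44)`).
* `m = 6` (`U⁺` of type `(29 | 6)`, `U⁻` of type `(6 | 42)`): `L⁺` of type `(29 | 6)` is full and a lift with `i = 1` has `j ∈ {5}`, killed in `L⁻` (type `(6 | 42)`).
* `m = 8` (`U⁺` of type `(27 | 8)`, `U⁻` of type `(8 | 40)`): the non-zero profiles [(0, 8), (3, 5), (6, 2)] are pairwise exclusive, so constant; `(3, 5)`: `L⁺` (type `(27 | 8)`) has constant rank `3`; `(6, 2)`: TOOL C on `L⁻`.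
* `m = 9` (`U⁺` of type `(26 | 9)`, `U⁻` of type `(9 | 39)`): the non-zero profiles [(0, 9), (6, 3)] are pairwise exclusive, so constant; `(6, 3)`: `L⁺` (type `(26 | 9)`) has constant rank `6`.
* `m = 10` (`U⁺` of type `(25 | 10)`, `U⁻` of type `(10 | 38)`): after the Levi kills the profiles are [(0, 0), (0, 10), (10, 0), (10, 10)], so `L⁺` (type `(25 | 10)`) is a `Θ`-algebra with non-zero raising ranks in `{10}` — impossible by the sub-Levi lemmas.
* `m = 12` (`U⁺` of type `(23 | 12)`, `U⁻` of type `(12 | 36)`): after the Levi kills every profile has `i = 0` (profiles [(0, 0), (0, 12)]), against the non-vanishing lemma.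
* `m = 14` (`U⁺` of type `(21 | 14)`, `U⁻` of type `(14 | 34)`): after the Levi kills the profiles are [(0, 0), (0, 14), (6, 8), (12, 2), (14, 0), (14, 14)], so `L⁺` (type `(21 | 14)`) is a `Θ`-algebra with non-zero raising ranks in `{6, 12, 14}` — impossible by the sub-Levi lemmas.
* `m = 15` (`U⁺` of type `(20 | 15)`, `U⁻` of type `(15 | 33)`): after the Levi kills the profiles are [(0, 0), (0, 15), (4, 11), (5, 10), (6, 9), (12, 3), (15, 0), (15, 15)], so `L⁺` (type `(20 | 15)`) is a `Θ`-algebra with non-zero raising ranks in `{4, 5, 6, 12, 15}` — impossible by the sub-Levi lemmas.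
* `m = 16` (`U⁺` of type `(19 | 16)`, `U⁻` of type `(16 | 32)`): after the Levi kills every profile has `i = 0` (profiles [(0, 0), (0, 16)]), against the non-vanishing lemma.
* `m = 17` (`U⁺` of type `(18 | 17)`, `U⁻` of type `(17 | 31)`): after the Levi kills every profile has `i = 0` (profiles [(0, 0)]), against the non-vanishing lemma.
* `m = 18` (`U⁺` of type `(17 | 18)`, `U⁻` of type `(18 | 30)`): the non-zero profiles [(0, 18), (2, 16), (3, 15), (4, 14), (6, 12), (8, 10), (9, 9), (10, 8), (12, 6), (14, 4), (15, 3), (16, 2)] are pairwise exclusive, so constant; `(2, 16)`: TOOL C on `L⁺`; `(3, 15)`: `L⁺` (type `(17 | 18)`) has constant rank `3`; `(4, 14)`: `L⁺` (type `(17 | 18)`) has constant rank `4`; `(6, 12)`: `L⁺` (type `(17 | 18)`) has constant rank `6`; `(8, 10)`: `L⁺` (type `(17 | 18)`) has constant rank `8`; `(9, 9)`: `L⁺` (type `(17 | 18)`) has constant rank `9`; `(10, 8)`: `L⁺` (type `(17 | 18)`) has constant rank `10`; `(12, 6)`: TOOL G; `(14, 4)`: TOOL G; `(15, 3)`: TOOL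 G; `(16, 2)`: TOOL C on `L⁻`.
* `m = 19` (`U⁺` of type `(16 | 19)`, `U⁻` of type `(19 | 29)`): after the Levi kills every profile has `i = 0` (profiles [(0, 0)]), against the non-vanishing lemma.
* `m = 20` (`U⁺` of type `(15 | 20)`, `U⁻` of type `(20 | 28)`): the non-zero profiles [(0, 20), (2, 18), (4, 16), (6, 14), (8, 12), (10, 10), (12, 8), (14, 6)] are pairwise exclusive, so constant; `(2, 18)`: TOOL C on `L⁺`; `(4, 16)`: `L⁺` (type `(15 | 20)`) has constant rank `4`; `(6, 14)`: `L⁺` (type `(15 | 20)`) has constant rank `6`; `(8, 12)`: `L⁺` (type `(15 | 20)`) has constant rank `8`; `(10, 10)`: `L⁻` (type `(20 | 28)`) has constant rank `10`; `(12, 8)`: TOOL G; `(14, 6)`: TOOL G.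
* `m = 21` (`U⁺` of type `(14 | 21)`, `U⁻` of type `(21 | 27)`): the non-zero profiles [(0, 21), (3, 18), (6, 15), (9, 12), (12, 9)] are pairwise exclusive, so constant; `(3, 18)`: `L⁺` (type `(14 | 21)`) has constant rank `3`; `(6, 15)`: `L⁺` (type `(14 | 21)`) has constant rank `6`; `(9, 12)`: `L⁺` (type `(14 | 21)`) has constant rank `9`; `(12, 9)`: TOOL G.
* `m = 22` (`U⁺` of type `(13 | 22)`, `U⁻` of type `(22 | 26)`): `L⁺` of type `(13 | 22)` is full and a lift with `i = 1` has `j ∈ {21}`, killed in `L⁻` (type `(22 | 26)`).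
* `m = 23` (`U⁺` of type `(12 | 23)`, `U⁻` of type `(23 | 25)`): after the Levi kills every profile has `i = 0` (profiles [(0, 0)]), against the non-vanishing lemma.
* `m = 24` (`U⁺` of type `(11 | 24)`, `U⁻` of type `(24 | 24)`): `L⁺` of type `(11 | 24)` is full; two pencils (lifts with `i = 1`, `i = 2`).
* `m = 25` (`U⁺` of type `(10 | 25)`, `U⁻` of type `(25 | 23)`): the non-zero profiles [(5, 20), (9, 16), (10, 15)] are pairwise exclusive, so constant; `(5, 20)`: `L⁺` (type `(10 | 25)`) has constant rank `5`; `(9, 16)`: `L⁺` (type `(10 | 25)`) has constant rank `9`; `(10, 15)`: TOOL G.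
* `m = 26` (`U⁺` of type `(9 | 26)`, `U⁻` of type `(26 | 22)`): the non-zero profiles [(4, 22), (6, 20)] are pairwise exclusive, so constant; `(4, 22)`: `L⁺` (type `(9 | 26)`) has constant rank `4`; `(6, 20)`: `L⁺` (type `(9 | 26)`) has constant rank `6`.
* `m = 27` (`U⁺` of type `(8 | 27)`, `U⁻` of type `(27 | 21)`): after the Levi kills every profile has `i = 0` (profiles [(0, 0)]), against the non-vanishing lemma.
* `m = 28` (`U⁺` of type `(7 | 28)`, `U⁻` of type `(28 | 20)`): after the Levi kills every profile has `i = 0` (profiles [(0, 0)]), against the non-vanishing lemma.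
* `m = 29` (`U⁺` of type `(6 | 29)`, `U⁻` of type `(29 | 19)`): `L⁺` of type `(6 | 29)` is full and a lift with `i = 1` has no feasible `j`.
* `m = 30` (`U⁺` of type `(5 | 30)`, `U⁻` of type `(30 | 18)`): after the Levi kills every profile has `i = 0` (profiles [(0, 0)]), against the non-vanishing lemma.
* `m = 31` (`U⁺` of type `(4 | 31)`, `U⁻` of type `(31 | 17)`): `L⁺` of type `(4 | 31)` is full and a lift with `i = 1` has no feasible `j`.
* `m = 32` (`U⁺` of type `(3 | 32)`, `U⁻` of type `(32 | 16)`): `L⁺` of type `(3 | 32)` is full and a lift with `i = 1` has no feasible `j`.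
* `m = 33` (`U⁺` of type `(2 | 33)`, `U⁻` of type `(33 | 15)`): `L⁺` of type `(2 | 33)` is full and a lift with `i = 1` has no feasible `j`.
* `m = 34` (`U⁺` of type `(1 | 34)`, `U⁻` of type `(34 | 14)`): `L⁺` of type `(1 | 34)` is full and a lift with `i = 1` has no feasible `j`.

## References
* [Ribet1983] K. A. Ribet, *Hodge classes on certain types of abelian varieties*, Amer. J. Math. 105 (1983), Thm. 3.
* [Gordon1997] B. B. Gordon, *A survey of the Hodge conjecture for abelian varieties*, Thm. 6.3 (3), pp. 18–19.
* [Deligne1982HodgeCycles] P. Deligne, *Hodge cycles on abelian varieties*, LNM 900 (1982), I §3 Prop. 3.4, 3.6.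
* [GoodmanWallachGTM255] R. Goodman, N. R. Wallach, GTM 255 (2009), §2.3.1, §4.1.1.
* [HoffmanKunze1971LinearAlgebra] K. Hoffman, R. Kunze, *Linear Algebra* (1971), §3.1 Thm. 2, §6.7, §8.5.
-/

noncomputable section

open Module

namespace Literature.AlgebraicGeometry.Motives

namespace HodgeStructure

universe u

variable {W : Type u} [AddCommGroup W] [Module ℂ W]

/-! ### §2 The minimal-rank lemmas -/

/-- `(35 | 48)`, minimal rank `16`: after the Levi kills every profile has `i = 0` (profiles [(0, 0), (0, 16)]), against the non-vanishing lemma. [cite: Ribet1983, Thm. 3] [cite: Gordon1997, Thm. 6.3 (3)]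
[cite: Deligne1982HodgeCycles, I §3 Prop. 3.4, 3.6] [cite: GoodmanWallachGTM255, §4.1.1] -/
theorem UnitaryThirtyFiveFortyEight.no_minRank_16 [FiniteDimensional ℂ W] {𝔊 : Submodule ℂ (Module.End ℂ W)}
    (hbr : ∀ Y ∈ 𝔊, ∀ Z ∈ 𝔊, Y * Z - Z * Y ∈ 𝔊)
    (hirr : ∀ U : Submodule ℂ W, (∀ A ∈ 𝔊, ∀ u ∈ U, A u ∈ U) → U = ⊥ ∨ U = ⊤)
    {Θ : Module.End ℂ W} (hΘ : Θ ∈ 𝔊) (hΘΘ : Θ * Θ = 1)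
    {P Q : Submodule ℂ W} (hP : ∀ x, x ∈ P ↔ Θ x = x) (hQ : ∀ x, x ∈ Q ↔ Θ x = -x)
    (hP35 : Module.finrank ℂ P = 35) (hQ48 : Module.finrank ℂ Q = 48)
    {s : W → W → ℂ} (hadd : ∀ x y z, s (x + y) z = s x z + s y z)
    (hsmul : ∀ (c : ℂ) (x y : W), s (c • x) y = c * s x y) (hsymm : ∀ x y, s y x = starRingEnd ℂ (s x y))
    (hPQ : ∀ p ∈ P, ∀ q ∈ Q, s p q = 0) (hdefP : ∀ p ∈ P, s p p = 0 → p = 0) (hdefQ : ∀ q ∈ Q, s q q = 0 → q = 0)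
    (hadj : ∀ X ∈ 𝔊, ∃ Y ∈ 𝔊, ∀ x y, s (X x) y = s x (Y y))
    (hS : ∀ B' ∈ 𝔊, Θ * B' = B' → B' * Θ = -B' →
      Module.finrank ℂ (LinearMap.range B') = 0 ∨ Module.finrank ℂ (LinearMap.range B') = 16 ∨ Module.finrank ℂ (LinearMap.range B') = 17 ∨ Module.finrank ℂ (LinearMap.range B') = 18 ∨ Module.finrank ℂ (LinearMap.range B') = 19 ∨ Module.finrank ℂ (LinearMap.range B') = 20 ∨ Module.finrank ℂ (LinearMap.range B') = 21 ∨ Module.finrank ℂ (LinearMap.range B') = 22 ∨ Module.finrank ℂ (LinearMap.range B') = 23 ∨ Module.finrank ℂ (LinearMap.range B') = 24 ∨ Module.finrank ℂ (LinearMap.range B') = 25 ∨ Module.finrank ℂ (LinearMap.range B') = 26 ∨ Module.finrank ℂ (LinearMap.range B') = 27 ∨ Module.finrank ℂ (LinearMap.range B') = 28 ∨ Module.finrank ℂ (LinearMap.range B') = 29 ∨ Module.finrank ℂ (LinearMap.range B') = 30 ∨ Module.finrank ℂ (LinearMap.range B') = 31 ∨ Module.finrank ℂ (LinearMap.range B')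 = 32 ∨ Module.finrank ℂ (LinearMap.range B') = 33 ∨ Module.finrank ℂ (LinearMap.range B') = 34)
    {B : Module.End ℂ W} (hB : B ∈ 𝔊) (hΘB : Θ * B = B) (hBΘ : B * Θ = -B)
    (hr : Module.finrank ℂ (LinearMap.range B) = 16) : False := by
  classical
  have hsU : ∀ U : Submodule ℂ W, ∀ x y z : U, s ((x + y : U) : W) z = s (x : W) z + s (y : W) z :=
    fun U x y z => by simp only [Submodule.coe_add, hadd]
  have hsmU : ∀ U : Submodule ℂ W, ∀ (c : ℂ) (x y : U), s ((c • x : U) : W) y = c * s (x : W) y :=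
    fun U c x y => by simp only [Submodule.coe_smul, hsmul]
  have hno1 : ∀ B' ∈ 𝔊, Θ * B' = B' → B' * Θ = -B' → Module.finrank ℂ (LinearMap.range B') ≠ 1 := by
    intro B' hB' hΘB' hB'Θ h1
    rcases hS B' hB' hΘB' hB'Θ with h | h | h | h | h | h | h | h | h | h | h | h | h | h | h | h | h | h | h | h <;> omega
  have hmin : ∀ Y ∈ 𝔊, Θ * Y = Y → Y * Θ = -Y → Y ≠ 0 → 16 ≤ Module.finrank ℂ (LinearMap.range Y) := by
    intro Y hY hΘY hYΘ hY0
    have h0 : Module.finrank ℂ (LinearMap.range Y) ≠ 0 := fun h =>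
      hY0 (LinearMap.range_eq_bot.1 (Submodule.finrank_eq_zero.1 h))
    rcases hS Y hY hΘY hYΘ with h | h | h | h | h | h | h | h | h | h | h | h | h | h | h | h | h | h | h | h <;> omega
  have hmin' : ∀ Z ∈ 𝔊, Θ * Z = Z → Z * Θ = -Z → Z ≠ 0 → Module.finrank ℂ (LinearMap.range B) ≤ Module.finrank ℂ (LinearMap.range Z) := by
    rw [hr]; exact hmin
  obtain ⟨ι, Um, Up, PU, QU, Lm, ιm, Pm, Qm, Lp, ιp, Pp, Qp, hιmem, hιι, hιΘ, hιs, hUm, hUp, hfinUm, hfinUp,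
    hPM, hQM, hPU, hQU, hrangeP, hPUP, hQUQ, hfinQM, hfinPU, hfinQU, hLm, hLp,
    hιmapply, hPmmem, hQmmem, hbrLm, hirrLm, hιmmem, hιmιm, hPm, hQm, hfinPm, hfinQm, hPmQm, hdefPm, hdefQm, hadjLm,
    hιpapply, hPpmem, hQpmem, hbrLp, hirrLp, hιpmem, hιpιp, hPp, hQp, hfinPp, hfinQp, hPpQp, hdefPp, hdefQp, hadjLp,
    hsplit⟩ :=
    UnitaryLeviSetup.exists_levi_pair hbr hirr hΘ hΘΘ hP hQ hadd hsymm hPQ hdefP hdefQ hadj hB hΘB hBΘ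
  have hdich : ∀ X ∈ 𝔊, Θ * X = X → X * Θ = -X → X * ι = ι * X →
      Module.finrank ℂ (Up.map X) + Module.finrank ℂ (Um.map X) ≤ Module.finrank ℂ (LinearMap.range B) ∨
        (16 ≤ Module.finrank ℂ (Up.map X) ∧ 16 ≤ Module.finrank ℂ (Um.map X)) := fun X hX hΘX hXΘ hXc =>
    UnitaryLeviSetup.profile_dichotomy hbr hΘΘ hP hQ hadd hsymm hPQ hdefP hdefQ hadj hmin hB hΘB hBΘ hιι hιΘ hιs hUm hUp
      hPM hQM hQU hfinQU hrangeP hX hΘX hXΘ hXc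
  have hfinQU' := hfinQU
  rw [hr] at hfinQM hfinPU hfinQU hfinPm hfinQm hfinPp hfinQp hsplit hdich
  rw [hQ48] at hfinQM hfinQm hfinUm
  rw [hP35] at hfinPU hfinPp hfinUp
  have hcm : ∀ Z : Module.End ℂ W, Z * ι = ι * Z → ∀ x ∈ Um, Z x ∈ Um := fun Z hZ x hx =>
    (hUm _).2 (by rw [← Module.End.mul_apply, ← hZ, Module.End.mul_apply, (hUm x).1 hx, map_neg])
  have hcp : ∀ Z : Module.End ℂ W, Z * ι = ι * Z → ∀ x ∈ Up, Z x ∈ Up := fun Z hZ x hx =>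
    (hUp _).2 (by rw [← Module.End.mul_apply, ← hZ, Module.End.mul_apply, (hUp x).1 hx])
  have hfullm_of : Lm = ⊤ → False := fun h =>
    UnitaryLeviSetup.false_of_full_larger hbr hΘΘ hno1 hιι hιΘ hUm hUp (by omega) (by omega) hPM hQM (by omega)
      (by omega) hLm h
  have hkillm1 : ∀ X ∈ 𝔊, Θ * X = X → X * Θ = -X → X * ι = ι * X → Module.finrank ℂ (Um.map X) ≠ 1 := by
    intro X hX hΘX hXΘ hXc h1
    obtain ⟨hxmem, hιmx, hxιm, hxrk⟩ := UnitaryLeviSetup.restrict_mem hcm hLm hιmapply X hX hΘX hXΘ hXc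
    rw [h1] at hxrk
    exact hfullm_of (UnitaryRankOneRaise.eq_top_of_rankOne_raise hbrLm hirrLm hιmmem hιmιm hPm hQm
      (s := fun v w : Um => s (v : W) w) (hsU Um) (fun v w => hsymm v w) hPmQm hdefPm hdefQm hadjLm hxmem hιmx hxιm
      hxrk (by omega) (by omega) (by omega))
  have hkillm3 : ∀ X ∈ 𝔊, Θ * X = X → X * Θ = -X → X * ι = ι * X → Module.finrank ℂ (Um.map X) ≠ 3 := by
    intro X hX hΘX hXΘ hXc h3
    obtain ⟨hxmem, hιmx, hxιm, hxrk⟩ := UnitaryLeviSetup.restrict_mem hcm hLm hιmapply X hX hΘX hXΘ hXc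
    rw [h3] at hxrk
    refine hfullm_of (UnitaryDoubleLevi.eq_top_of_raise_of_core hbrLm hirrLm hιmmem hιmιm hPm hQm
      (s := fun v w : Um => s (v : W) w) (hsU Um) (fun v w => hsymm v w) hPmQm hdefPm hdefQm hadjLm hxmem hιmx hxιm
      (by rw [hxrk]; omega) (by omega) (by omega)
      fun U' 𝔩' ι' P' Q' hbr𝔩' hirr𝔩' hι' hι'ι' hP' hQ' hfinP' hfinQ' hP'Q' hdefP' hdefQ' hadj𝔩' => ?_)
    rw [hxrk] at hfinP' hfinQ'
    exact UnitaryThreeCoprime.eq_top hbr𝔩' hirr𝔩' hι' hι'ι' hP' hQ' hfinP' (by omega) (s := fun x y : U' => s ((x : Um) : W) y) (fun x y z => by simp only [Submodule.coe_add, hadd]) (fun x y => hsymm _ _) hP'Q' hdefP' hdefQ' hadj𝔩'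
  have hkillm5 : ∀ X ∈ 𝔊, Θ * X = X → X * Θ = -X → X * ι = ι * X → Module.finrank ℂ (Um.map X) ≠ 5 := by
    intro X hX hΘX hXΘ hXc h5
    obtain ⟨hxmem, hιmx, hxιm, hxrk⟩ := UnitaryLeviSetup.restrict_mem hcm hLm hιmapply X hX hΘX hXΘ hXc
    rw [h5] at hxrk
    refine hfullm_of (UnitaryDoubleLevi.eq_top_of_raise_of_core hbrLm hirrLm hιmmem hιmιm hPm hQm
      (s := fun v w : Um => s (v : W) w) (hsU Um) (fun v w => hsymm v w) hPmQm hdefPm hdefQm hadjLm hxmem hιmx hxιm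
      (by rw [hxrk]; omega) (by omega) (by omega)
      fun U' 𝔩' ι' P' Q' hbr𝔩' hirr𝔩' hι' hι'ι' hP' hQ' hfinP' hfinQ' hP'Q' hdefP' hdefQ' hadj𝔩' => ?_)
    rw [hxrk] at hfinP' hfinQ'
    exact UnitaryFive.eq_top_of_smul hbr𝔩' hirr𝔩' hι' hι'ι' hP' hQ' hfinP' (by omega) (s := fun x y : U' => s ((x : Um) : W) y) (fun x y z => by simp only [Submodule.coe_add, hadd]) (fun c x y => by simp only [Submodule.coe_smul, hsmul]) (fun x y => hsymm _ _) hP'Q' hdefP' hdefQ' hadj𝔩'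
  have hkillm7 : ∀ X ∈ 𝔊, Θ * X = X → X * Θ = -X → X * ι = ι * X → Module.finrank ℂ (Um.map X) ≠ 7 := by
    intro X hX hΘX hXΘ hXc h7
    obtain ⟨hxmem, hιmx, hxιm, hxrk⟩ := UnitaryLeviSetup.restrict_mem hcm hLm hιmapply X hX hΘX hXΘ hXc
    rw [h7] at hxrk
    refine hfullm_of (UnitaryDoubleLevi.eq_top_of_raise_of_core hbrLm hirrLm hιmmem hιmιm hPm hQm
      (s := fun v w : Um => s (v : W) w) (hsU Um) (fun v w => hsymm v w) hPmQm hdefPm hdefQm hadjLm hxmem hιmx hxιm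
      (by rw [hxrk]; omega) (by omega) (by omega)
      fun U' 𝔩' ι' P' Q' hbr𝔩' hirr𝔩' hι' hι'ι' hP' hQ' hfinP' hfinQ' hP'Q' hdefP' hdefQ' hadj𝔩' => ?_)
    rw [hxrk] at hfinP' hfinQ'
    exact UnitarySeven.eq_top_of_smul hbr𝔩' hirr𝔩' hι' hι'ι' hP' hQ' hfinP' (by omega) (s := fun x y : U' => s ((x : Um) : W) y) (fun x y z => by simp only [Submodule.coe_add, hadd]) (fun c x y => by simp only [Submodule.coe_smul, hsmul]) (fun x y => hsymm _ _) hP'Q' hdefP' hdefQ' hadj𝔩'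
  have hkillm11 : ∀ X ∈ 𝔊, Θ * X = X → X * Θ = -X → X * ι = ι * X → Module.finrank ℂ (Um.map X) ≠ 11 := by
    intro X hX hΘX hXΘ hXc h11
    obtain ⟨hxmem, hιmx, hxιm, hxrk⟩ := UnitaryLeviSetup.restrict_mem hcm hLm hιmapply X hX hΘX hXΘ hXc
    rw [h11] at hxrk
    refine hfullm_of (UnitaryDoubleLevi.eq_top_of_raise_of_core hbrLm hirrLm hιmmem hιmιm hPm hQm
      (s := fun v w : Um => s (v : W) w) (hsU Um) (fun v w => hsymm v w) hPmQm hdefPm hdefQm hadjLm hxmem hιmx hxιm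
      (by rw [hxrk]; omega) (by omega) (by omega)
      fun U' 𝔩' ι' P' Q' hbr𝔩' hirr𝔩' hι' hι'ι' hP' hQ' hfinP' hfinQ' hP'Q' hdefP' hdefQ' hadj𝔩' => ?_)
    rw [hxrk] at hfinP' hfinQ'
    exact UnitaryEleven.eq_top_of_smul hbr𝔩' hirr𝔩' hι' hι'ι' hP' hQ' hfinP' (by omega) (s := fun x y : U' => s ((x : Um) : W) y) (fun x y z => by simp only [Submodule.coe_add, hadd]) (fun c x y => by simp only [Submodule.coe_smul, hsmul]) (fun x y => hsymm _ _) hP'Q' hdefP' hdefQ' hadj𝔩'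
  have hkillm13 : ∀ X ∈ 𝔊, Θ * X = X → X * Θ = -X → X * ι = ι * X → Module.finrank ℂ (Um.map X) ≠ 13 := by
    intro X hX hΘX hXΘ hXc h13
    obtain ⟨hxmem, hιmx, hxιm, hxrk⟩ := UnitaryLeviSetup.restrict_mem hcm hLm hιmapply X hX hΘX hXΘ hXc
    rw [h13] at hxrk
    refine hfullm_of (UnitaryDoubleLevi.eq_top_of_raise_of_core hbrLm hirrLm hιmmem hιmιm hPm hQm
      (s := fun v w : Um => s (v : W) w) (hsU Um) (fun v w => hsymm v w) hPmQm hdefPm hdefQm hadjLm hxmem hιmx hxιm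
      (by rw [hxrk]; omega) (by omega) (by omega)
      fun U' 𝔩' ι' P' Q' hbr𝔩' hirr𝔩' hι' hι'ι' hP' hQ' hfinP' hfinQ' hP'Q' hdefP' hdefQ' hadj𝔩' => ?_)
    rw [hxrk] at hfinP' hfinQ'
    exact UnitaryThirteen.eq_top_of_smul hbr𝔩' hirr𝔩' hι' hι'ι' hP' hQ' hfinP' (by omega) (s := fun x y : U' => s ((x : Um) : W) y) (fun x y z => by simp only [Submodule.coe_add, hadd]) (fun c x y => by simp only [Submodule.coe_smul, hsmul]) (fun x y => hsymm _ _) hP'Q' hdefP' hdefQ' hadj𝔩'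
  have hkillm15 : ∀ X ∈ 𝔊, Θ * X = X → X * Θ = -X → X * ι = ι * X → Module.finrank ℂ (Um.map X) ≠ 15 := by
    intro X hX hΘX hXΘ hXc h15
    obtain ⟨hxmem, hιmx, hxιm, hxrk⟩ := UnitaryLeviSetup.restrict_mem hcm hLm hιmapply X hX hΘX hXΘ hXc
    rw [h15] at hxrk
    refine hfullm_of (UnitaryDoubleLevi.eq_top_of_raise_of_core hbrLm hirrLm hιmmem hιmιm hPm hQm
      (s := fun v w : Um => s (v : W) w) (hsU Um) (fun v w => hsymm v w) hPmQm hdefPm hdefQm hadjLm hxmem hιmx hxιm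
      (by rw [hxrk]; omega) (by omega) (by omega)
      fun U' 𝔩' ι' P' Q' hbr𝔩' hirr𝔩' hι' hι'ι' hP' hQ' hfinP' hfinQ' hP'Q' hdefP' hdefQ' hadj𝔩' => ?_)
    rw [hxrk] at hfinP' hfinQ'
    exact UnitarySeventeen.eq_top_of_smul hbr𝔩' hirr𝔩' hι' hι'ι' hP' hQ' (by omega) (by omega) (by omega) (s := fun x y : U' => s ((x : Um) : W) y) (fun x y z => by simp only [Submodule.coe_add, hadd]) (fun c x y => by simp only [Submodule.coe_smul, hsmul]) (fun x y => hsymm _ _) hP'Q' hdefP' hdefQ' hadj𝔩'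
  have hfullp_of : Lp = ⊤ → False := by
    intro hLptop
    obtain ⟨T1, hιT1, hT1ι, hT1r⟩ := UnitaryRaisingSpace.exists_raise_finrank_range_eq hιpιp hPp hQp (k := 1)
      (by omega) (by omega)
    obtain ⟨X1, hX1, hΘX1, hX1Θ, hX1c, hX1Up⟩ := UnitaryLeviSetup.exists_lift hbr hΘ hΘΘ hcp hιΘ hLp hιpapply T1
      (by rw [hLptop]; exact Submodule.mem_top) hιT1 hT1ι
    rw [hT1r] at hX1Up
    obtain ⟨hs1, hi1, hi1', hj1, hj1'⟩ := hsplit X1 hΘX1 hX1Θ hX1c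
    have hrk1 := hS X1 hX1 hΘX1 hX1Θ
    have hd1 := hdich X1 hX1 hΘX1 hX1Θ hX1c
    rw [hs1] at hrk1
    rw [hX1Up] at hrk1 hd1
    have hk_hkillm15 := hkillm15 X1 hX1 hΘX1 hX1Θ hX1c
    omega
  have hkillp2 : ∀ X ∈ 𝔊, Θ * X = X → X * Θ = -X → X * ι = ι * X → Module.finrank ℂ (Up.map X) ≠ 2 := by
    intro X hX hΘX hXΘ hXc h2
    obtain ⟨hymem, hιpy, hyιp, hyrk⟩ := UnitaryLeviSetup.restrict_mem hcp hLp hιpapply X hX hΘX hXΘ hXc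
    rw [h2] at hyrk
    refine hfullp_of (UnitaryDoubleLevi.eq_top_of_raise_of_core' hbrLp hirrLp hιpmem hιpιp hPp hQp
      (s := fun v w : Up => s (v : W) w) (hsU Up) (fun v w => hsymm v w) hPpQp hdefPp hdefQp hadjLp hymem hιpy hyιp
      (by rw [hyrk]; omega) (by omega) (by omega)
      fun U' 𝔩' ι' P' Q' hbr𝔩' hirr𝔩' hι' hι'ι' hP' hQ' hfinP' hfinQ' hP'Q' hdefP' hdefQ' hadj𝔩' => ?_)
    rw [hyrk] at hfinP' hfinQ'
    exact UnitaryTwoOdd.eq_top hbr𝔩' hirr𝔩' hι' hι'ι' hP' hQ' hfinP' ⟨8, by omega⟩ (s := fun x y : U' => s ((x : Up) : W) y) (fun x y z => by simp only [Submodule.coe_add, hadd]) (fun x y => hsymm _ _) hP'Q' hdefP' hdefQ' hadj𝔩'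
  have hkillp4 : ∀ X ∈ 𝔊, Θ * X = X → X * Θ = -X → X * ι = ι * X → Module.finrank ℂ (Up.map X) ≠ 4 := by
    intro X hX hΘX hXΘ hXc h4
    obtain ⟨hymem, hιpy, hyιp, hyrk⟩ := UnitaryLeviSetup.restrict_mem hcp hLp hιpapply X hX hΘX hXΘ hXc
    rw [h4] at hyrk
    refine hfullp_of (UnitaryDoubleLevi.eq_top_of_raise_of_core' hbrLp hirrLp hιpmem hιpιp hPp hQp
      (s := fun v w : Up => s (v : W) w) (hsU Up) (fun v w => hsymm v w) hPpQp hdefPp hdefQp hadjLp hymem hιpy hyιp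
      (by rw [hyrk]; omega) (by omega) (by omega)
      fun U' 𝔩' ι' P' Q' hbr𝔩' hirr𝔩' hι' hι'ι' hP' hQ' hfinP' hfinQ' hP'Q' hdefP' hdefQ' hadj𝔩' => ?_)
    rw [hyrk] at hfinP' hfinQ'
    exact UnitaryFourOdd.eq_top hbr𝔩' hirr𝔩' hι' hι'ι' hP' hQ' hfinP' ⟨7, by omega⟩ (s := fun x y : U' => s ((x : Up) : W) y) (fun x y z => by simp only [Submodule.coe_add, hadd]) (fun x y => hsymm _ _) hP'Q' hdefP' hdefQ' hadj𝔩'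
  have hkillp6 : ∀ X ∈ 𝔊, Θ * X = X → X * Θ = -X → X * ι = ι * X → Module.finrank ℂ (Up.map X) ≠ 6 := by
    intro X hX hΘX hXΘ hXc h6
    obtain ⟨hymem, hιpy, hyιp, hyrk⟩ := UnitaryLeviSetup.restrict_mem hcp hLp hιpapply X hX hΘX hXΘ hXc
    rw [h6] at hyrk
    refine hfullp_of (UnitaryDoubleLevi.eq_top_of_raise_of_core' hbrLp hirrLp hιpmem hιpιp hPp hQp
      (s := fun v w : Up => s (v : W) w) (hsU Up) (fun v w => hsymm v w) hPpQp hdefPp hdefQp hadjLp hymem hιpy hyιp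
      (by rw [hyrk]; omega) (by omega) (by omega)
      fun U' 𝔩' ι' P' Q' hbr𝔩' hirr𝔩' hι' hι'ι' hP' hQ' hfinP' hfinQ' hP'Q' hdefP' hdefQ' hadj𝔩' => ?_)
    rw [hyrk] at hfinP' hfinQ'
    exact UnitarySix.eq_top_of_smul hbr𝔩' hirr𝔩' hι' hι'ι' hP' hQ' hfinP' ⟨6, by omega⟩ (by omega) (s := fun x y : U' => s ((x : Up) : W) y) (fun x y z => by simp only [Submodule.coe_add, hadd]) (fun c x y => by simp only [Submodule.coe_smul, hsmul]) (fun x y => hsymm _ _) hP'Q' hdefP' hdefQ' hadj𝔩'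
  have hkillp7 : ∀ X ∈ 𝔊, Θ * X = X → X * Θ = -X → X * ι = ι * X → Module.finrank ℂ (Up.map X) ≠ 7 := by
    intro X hX hΘX hXΘ hXc h7
    obtain ⟨hymem, hιpy, hyιp, hyrk⟩ := UnitaryLeviSetup.restrict_mem hcp hLp hιpapply X hX hΘX hXΘ hXc
    rw [h7] at hyrk
    refine hfullp_of (UnitaryDoubleLevi.eq_top_of_raise_of_core' hbrLp hirrLp hιpmem hιpιp hPp hQp
      (s := fun v w : Up => s (v : W) w) (hsU Up) (fun v w => hsymm v w) hPpQp hdefPp hdefQp hadjLp hymem hιpy hyιp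
      (by rw [hyrk]; omega) (by omega) (by omega)
      fun U' 𝔩' ι' P' Q' hbr𝔩' hirr𝔩' hι' hι'ι' hP' hQ' hfinP' hfinQ' hP'Q' hdefP' hdefQ' hadj𝔩' => ?_)
    rw [hyrk] at hfinP' hfinQ'
    exact UnitarySeven.eq_top_of_smul hbr𝔩' hirr𝔩' hι' hι'ι' hP' hQ' hfinP' (by omega) (s := fun x y : U' => s ((x : Up) : W) y) (fun x y z => by simp only [Submodule.coe_add, hadd]) (fun c x y => by simp only [Submodule.coe_smul, hsmul]) (fun x y => hsymm _ _) hP'Q' hdefP' hdefQ' hadj𝔩'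
  have hkillp8 : ∀ X ∈ 𝔊, Θ * X = X → X * Θ = -X → X * ι = ι * X → Module.finrank ℂ (Up.map X) ≠ 8 := by
    intro X hX hΘX hXΘ hXc h8
    obtain ⟨hymem, hιpy, hyιp, hyrk⟩ := UnitaryLeviSetup.restrict_mem hcp hLp hιpapply X hX hΘX hXΘ hXc
    rw [h8] at hyrk
    refine hfullp_of (UnitaryDoubleLevi.eq_top_of_raise_of_core' hbrLp hirrLp hιpmem hιpιp hPp hQp
      (s := fun v w : Up => s (v : W) w) (hsU Up) (fun v w => hsymm v w) hPpQp hdefPp hdefQp hadjLp hymem hιpy hyιp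
      (by rw [hyrk]; omega) (by omega) (by omega)
      fun U' 𝔩' ι' P' Q' hbr𝔩' hirr𝔩' hι' hι'ι' hP' hQ' hfinP' hfinQ' hP'Q' hdefP' hdefQ' hadj𝔩' => ?_)
    rw [hyrk] at hfinP' hfinQ'
    exact UnitaryEleven.eq_top_of_smul' hbr𝔩' hirr𝔩' hι' hι'ι' hP' hQ' (by omega) (by omega) (s := fun x y : U' => s ((x : Up) : W) y) (fun x y z => by simp only [Submodule.coe_add, hadd]) (fun c x y => by simp only [Submodule.coe_smul, hsmul]) (fun x y => hsymm _ _) hP'Q' hdefP' hdefQ' hadj𝔩'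
  have hkillp10 : ∀ X ∈ 𝔊, Θ * X = X → X * Θ = -X → X * ι = ι * X → Module.finrank ℂ (Up.map X) ≠ 10 := by
    intro X hX hΘX hXΘ hXc h10
    obtain ⟨hymem, hιpy, hyιp, hyrk⟩ := UnitaryLeviSetup.restrict_mem hcp hLp hιpapply X hX hΘX hXΘ hXc
    rw [h10] at hyrk
    refine hfullp_of (UnitaryDoubleLevi.eq_top_of_raise_of_core' hbrLp hirrLp hιpmem hιpιp hPp hQp
      (s := fun v w : Up => s (v : W) w) (hsU Up) (fun v w => hsymm v w) hPpQp hdefPp hdefQp hadjLp hymem hιpy hyιp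
      (by rw [hyrk]; omega) (by omega) (by omega)
      fun U' 𝔩' ι' P' Q' hbr𝔩' hirr𝔩' hι' hι'ι' hP' hQ' hfinP' hfinQ' hP'Q' hdefP' hdefQ' hadj𝔩' => ?_)
    rw [hyrk] at hfinP' hfinQ'
    exact UnitaryNineTen.eq_top_of_smul' hbr𝔩' hirr𝔩' hι' hι'ι' hP' hQ' hfinP' (by omega) (s := fun x y : U' => s ((x : Up) : W) y) (fun x y z => by simp only [Submodule.coe_add, hadd]) (fun c x y => by simp only [Submodule.coe_smul, hsmul]) (fun x y => hsymm _ _) hP'Q' hdefP' hdefQ' hadj𝔩'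
  have hkillp12 : ∀ X ∈ 𝔊, Θ * X = X → X * Θ = -X → X * ι = ι * X → Module.finrank ℂ (Up.map X) ≠ 12 := by
    intro X hX hΘX hXΘ hXc h12
    obtain ⟨hymem, hιpy, hyιp, hyrk⟩ := UnitaryLeviSetup.restrict_mem hcp hLp hιpapply X hX hΘX hXΘ hXc
    rw [h12] at hyrk
    refine hfullp_of (UnitaryDoubleLevi.eq_top_of_raise_of_core' hbrLp hirrLp hιpmem hιpιp hPp hQp
      (s := fun v w : Up => s (v : W) w) (hsU Up) (fun v w => hsymm v w) hPpQp hdefPp hdefQp hadjLp hymem hιpy hyιp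
      (by rw [hyrk]; omega) (by omega) (by omega)
      fun U' 𝔩' ι' P' Q' hbr𝔩' hirr𝔩' hι' hι'ι' hP' hQ' hfinP' hfinQ' hP'Q' hdefP' hdefQ' hadj𝔩' => ?_)
    rw [hyrk] at hfinP' hfinQ'
    exact UnitarySeven.eq_top_of_smul' hbr𝔩' hirr𝔩' hι' hι'ι' hP' hQ' (by omega) (by omega) (s := fun x y : U' => s ((x : Up) : W) y) (fun x y z => by simp only [Submodule.coe_add, hadd]) (fun c x y => by simp only [Submodule.coe_smul, hsmul]) (fun x y => hsymm _ _) hP'Q' hdefP' hdefQ' hadj𝔩'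
  have hkillp14 : ∀ X ∈ 𝔊, Θ * X = X → X * Θ = -X → X * ι = ι * X → Module.finrank ℂ (Up.map X) ≠ 14 := by
    intro X hX hΘX hXΘ hXc h14
    obtain ⟨hymem, hιpy, hyιp, hyrk⟩ := UnitaryLeviSetup.restrict_mem hcp hLp hιpapply X hX hΘX hXΘ hXc
    rw [h14] at hyrk
    refine hfullp_of (UnitaryDoubleLevi.eq_top_of_raise_of_core' hbrLp hirrLp hιpmem hιpιp hPp hQp
      (s := fun v w : Up => s (v : W) w) (hsU Up) (fun v w => hsymm v w) hPpQp hdefPp hdefQp hadjLp hymem hιpy hyιp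
      (by rw [hyrk]; omega) (by omega) (by omega)
      fun U' 𝔩' ι' P' Q' hbr𝔩' hirr𝔩' hι' hι'ι' hP' hQ' hfinP' hfinQ' hP'Q' hdefP' hdefQ' hadj𝔩' => ?_)
    rw [hyrk] at hfinP' hfinQ'
    exact UnitaryFive.eq_top_of_smul' hbr𝔩' hirr𝔩' hι' hι'ι' hP' hQ' (by omega) (by omega) (s := fun x y : U' => s ((x : Up) : W) y) (fun x y z => by simp only [Submodule.coe_add, hadd]) (fun c x y => by simp only [Submodule.coe_smul, hsmul]) (fun x y => hsymm _ _) hP'Q' hdefP' hdefQ' hadj𝔩'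
  have hkillp16 : ∀ X ∈ 𝔊, Θ * X = X → X * Θ = -X → X * ι = ι * X → Module.finrank ℂ (Up.map X) ≠ 16 := by
    intro X hX hΘX hXΘ hXc h16
    obtain ⟨hymem, hιpy, hyιp, hyrk⟩ := UnitaryLeviSetup.restrict_mem hcp hLp hιpapply X hX hΘX hXΘ hXc
    rw [h16] at hyrk
    refine hfullp_of (UnitaryDoubleLevi.eq_top_of_raise_of_core' hbrLp hirrLp hιpmem hιpιp hPp hQp
      (s := fun v w : Up => s (v : W) w) (hsU Up) (fun v w => hsymm v w) hPpQp hdefPp hdefQp hadjLp hymem hιpy hyιp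
      (by rw [hyrk]; omega) (by omega) (by omega)
      fun U' 𝔩' ι' P' Q' hbr𝔩' hirr𝔩' hι' hι'ι' hP' hQ' hfinP' hfinQ' hP'Q' hdefP' hdefQ' hadj𝔩' => ?_)
    rw [hyrk] at hfinP' hfinQ'
    exact UnitaryThreeCoprime.eq_top' hbr𝔩' hirr𝔩' hι' hι'ι' hP' hQ' (by omega) (by omega) (s := fun x y : U' => s ((x : Up) : W) y) (fun x y z => by simp only [Submodule.coe_add, hadd]) (fun x y => hsymm _ _) hP'Q' hdefP' hdefQ' hadj𝔩'
  have hprof : ∀ X ∈ 𝔊, Θ * X = X → X * Θ = -X → X * ι = ι * X →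
      (Module.finrank ℂ (Up.map X) = 0 ∧ Module.finrank ℂ (Um.map X) = 0) ∨
        (Module.finrank ℂ (Up.map X) = 0 ∧ Module.finrank ℂ (Um.map X) = 16) := by
    intro X hX hΘX hXΘ hXc
    obtain ⟨hs, hi, hi', hj, hj'⟩ := hsplit X hΘX hXΘ hXc
    have hkillm1' := hkillm1 X hX hΘX hXΘ hXc
    have hkillm3' := hkillm3 X hX hΘX hXΘ hXc
    have hkillm5' := hkillm5 X hX hΘX hXΘ hXc
    have hkillm7' := hkillm7 X hX hΘX hXΘ hXc
    have hkillm11' := hkillm11 X hX hΘX hXΘ hXc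
    have hkillm13' := hkillm13 X hX hΘX hXΘ hXc
    have hkillm15' := hkillm15 X hX hΘX hXΘ hXc
    have hkillp2' := hkillp2 X hX hΘX hXΘ hXc
    have hkillp4' := hkillp4 X hX hΘX hXΘ hXc
    have hkillp6' := hkillp6 X hX hΘX hXΘ hXc
    have hkillp7' := hkillp7 X hX hΘX hXΘ hXc
    have hkillp8' := hkillp8 X hX hΘX hXΘ hXc
    have hkillp10' := hkillp10 X hX hΘX hXΘ hXc
    have hkillp12' := hkillp12 X hX hΘX hXΘ hXc
    have hkillp14' := hkillp14 X hX hΘX hXΘ hXc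
    have hkillp16' := hkillp16 X hX hΘX hXΘ hXc
    have hrk := hS X hX hΘX hXΘ
    have hd := hdich X hX hΘX hXΘ hXc
    rw [hs] at hrk
    generalize Module.finrank ℂ ↥(Submodule.map X Um) = jj at *
    have hjle : jj ≤ 16 := by omega
    interval_cases jj
    · exact Or.inl ⟨by omega, rfl⟩
    · exact (hkillm1' rfl).elim
    · exfalso; omega
    · exact (hkillm3' rfl).elim
    · exfalso; omega
    · exact (hkillm5' rfl).elim
    · exfalso; omega
    · exact (hkillm7' rfl).elim
    · exfalso; omega
    · exfalso; omega
    · exfalso; omega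
    · exact (hkillm11' rfl).elim
    · exfalso; omega
    · exact (hkillm13' rfl).elim
    · exfalso; omega
    · exact (hkillm15' rfl).elim
    · exact Or.inr (⟨by omega, rfl⟩)
  obtain ⟨⟨p, hp⟩, hp0⟩ := Module.finrank_pos_iff_exists_ne_zero.1 (show 0 < Module.finrank ℂ PU by omega)
  obtain ⟨⟨q, hq⟩, hq0⟩ := Module.finrank_pos_iff_exists_ne_zero.1 (show 0 < Module.finrank ℂ QU by omega)
  obtain ⟨X₀, hX₀, hΘX₀, hX₀Θ, hX₀c, c₀, hιc₀, -, hX₀c0⟩ :=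
    UnitaryLeviFull.exists_raise_commute_apply_ne_zero hbr hirr hΘ hΘΘ hQ hιmem hιι hιΘ hUm hUp
      ⟨p, fun h => hp0 (Subtype.ext h), ((hPU p).1 hp).1, ((hPU p).1 hp).2⟩
      ⟨q, fun h => hq0 (Subtype.ext h), ((hQU q).1 hq).1, ((hQU q).1 hq).2⟩
  have hX₀i : Module.finrank ℂ (Up.map X₀) ≠ 0 := fun h0 => by
    have hmem : X₀ c₀ ∈ Up.map X₀ := Submodule.mem_map_of_mem ((hUp c₀).2 hιc₀)
    rw [Submodule.finrank_eq_zero.1 h0, Submodule.mem_bot] at hmem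
    exact hX₀c0 hmem
  have hp0 := hprof X₀ hX₀ hΘX₀ hX₀Θ hX₀c
  omega

/-- `(35 | 48)`, minimal rank `17`: after the Levi kills every profile has `i = 0` (profiles [(0, 0)]), against the non-vanishing lemma. [cite: Ribet1983, Thm. 3] [cite: Gordon1997, Thm. 6.3 (3)]
[cite: Deligne1982HodgeCycles, I §3 Prop. 3.4, 3.6] [cite: GoodmanWallachGTM255, §4.1.1] -/
theorem UnitaryThirtyFiveFortyEight.no_minRank_17 [FiniteDimensional ℂ W] {𝔊 : Submodule ℂ (Module.End ℂ W)}
    (hbr : ∀ Y ∈ 𝔊, ∀ Z ∈ 𝔊, Y * Z - Z * Y ∈ 𝔊)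
    (hirr : ∀ U : Submodule ℂ W, (∀ A ∈ 𝔊, ∀ u ∈ U, A u ∈ U) → U = ⊥ ∨ U = ⊤)
    {Θ : Module.End ℂ W} (hΘ : Θ ∈ 𝔊) (hΘΘ : Θ * Θ = 1)
    {P Q : Submodule ℂ W} (hP : ∀ x, x ∈ P ↔ Θ x = x) (hQ : ∀ x, x ∈ Q ↔ Θ x = -x)
    (hP35 : Module.finrank ℂ P = 35) (hQ48 : Module.finrank ℂ Q = 48)
    {s : W → W → ℂ} (hadd : ∀ x y z, s (x + y) z = s x z + s y z)
    (hsmul : ∀ (c : ℂ) (x y : W), s (c • x) y = c * s x y) (hsymm : ∀ x y, s y x = starRingEnd ℂ (s x y))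
    (hPQ : ∀ p ∈ P, ∀ q ∈ Q, s p q = 0) (hdefP : ∀ p ∈ P, s p p = 0 → p = 0) (hdefQ : ∀ q ∈ Q, s q q = 0 → q = 0)
    (hadj : ∀ X ∈ 𝔊, ∃ Y ∈ 𝔊, ∀ x y, s (X x) y = s x (Y y))
    (hS : ∀ B' ∈ 𝔊, Θ * B' = B' → B' * Θ = -B' →
      Module.finrank ℂ (LinearMap.range B') = 0 ∨ Module.finrank ℂ (LinearMap.range B') = 17 ∨ Module.finrank ℂ (LinearMap.range B') = 18 ∨ Module.finrank ℂ (LinearMap.range B') = 19 ∨ Module.finrank ℂ (LinearMap.range B') = 20 ∨ Module.finrank ℂ (LinearMap.range B') = 21 ∨ Module.finrank ℂ (LinearMap.range B') = 22 ∨ Module.finrank ℂ (LinearMap.range B') = 23 ∨ Module.finrank ℂ (LinearMap.range B') = 24 ∨ Module.finrank ℂ (LinearMap.range B') = 25 ∨ Module.finrank ℂ (LinearMap.range B') = 26 ∨ Module.finrank ℂ (LinearMap.range B') = 27 ∨ Module.finrank ℂ (LinearMap.range B') = 28 ∨ Module.finrank ℂ (LinearMap.range B') = 29 ∨ Module.finrank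 ℂ (LinearMap.range B') = 30 ∨ Module.finrank ℂ (LinearMap.range B') = 31 ∨ Module.finrank ℂ (LinearMap.range B') = 32 ∨ Module.finrank ℂ (LinearMap.range B') = 33 ∨ Module.finrank ℂ (LinearMap.range B') = 34)
    {B : Module.End ℂ W} (hB : B ∈ 𝔊) (hΘB : Θ * B = B) (hBΘ : B * Θ = -B)
    (hr : Module.finrank ℂ (LinearMap.range B) = 17) : False := by
  classical
  have hsU : ∀ U : Submodule ℂ W, ∀ x y z : U, s ((x + y : U) : W) z = s (x : W) z + s (y : W) z :=
    fun U x y z => by simp only [Submodule.coe_add, hadd]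
  have hsmU : ∀ U : Submodule ℂ W, ∀ (c : ℂ) (x y : U), s ((c • x : U) : W) y = c * s (x : W) y :=
    fun U c x y => by simp only [Submodule.coe_smul, hsmul]
  have hno1 : ∀ B' ∈ 𝔊, Θ * B' = B' → B' * Θ = -B' → Module.finrank ℂ (LinearMap.range B') ≠ 1 := by
    intro B' hB' hΘB' hB'Θ h1
    rcases hS B' hB' hΘB' hB'Θ with h | h | h | h | h | h | h | h | h | h | h | h | h | h | h | h | h | h | h <;> omega
  have hmin : ∀ Y ∈ 𝔊, Θ * Y = Y → Y * Θ = -Y → Y ≠ 0 → 17 ≤ Module.finrank ℂ (LinearMap.range Y) := by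
    intro Y hY hΘY hYΘ hY0
    have h0 : Module.finrank ℂ (LinearMap.range Y) ≠ 0 := fun h =>
      hY0 (LinearMap.range_eq_bot.1 (Submodule.finrank_eq_zero.1 h))
    rcases hS Y hY hΘY hYΘ with h | h | h | h | h | h | h | h | h | h | h | h | h | h | h | h | h | h | h <;> omega
  have hmin' : ∀ Z ∈ 𝔊, Θ * Z = Z → Z * Θ = -Z → Z ≠ 0 → Module.finrank ℂ (LinearMap.range B) ≤ Module.finrank ℂ (LinearMap.range Z) := by
    rw [hr]; exact hmin
  obtain ⟨ι, Um, Up, PU, QU, Lm, ιm, Pm, Qm, Lp, ιp, Pp, Qp, hιmem, hιι, hιΘ, hιs, hUm, hUp, hfinUm, hfinUp,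
    hPM, hQM, hPU, hQU, hrangeP, hPUP, hQUQ, hfinQM, hfinPU, hfinQU, hLm, hLp,
    hιmapply, hPmmem, hQmmem, hbrLm, hirrLm, hιmmem, hιmιm, hPm, hQm, hfinPm, hfinQm, hPmQm, hdefPm, hdefQm, hadjLm,
    hιpapply, hPpmem, hQpmem, hbrLp, hirrLp, hιpmem, hιpιp, hPp, hQp, hfinPp, hfinQp, hPpQp, hdefPp, hdefQp, hadjLp,
    hsplit⟩ :=
    UnitaryLeviSetup.exists_levi_pair hbr hirr hΘ hΘΘ hP hQ hadd hsymm hPQ hdefP hdefQ hadj hB hΘB hBΘ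
  have hdich : ∀ X ∈ 𝔊, Θ * X = X → X * Θ = -X → X * ι = ι * X →
      Module.finrank ℂ (Up.map X) + Module.finrank ℂ (Um.map X) ≤ Module.finrank ℂ (LinearMap.range B) ∨
        (17 ≤ Module.finrank ℂ (Up.map X) ∧ 17 ≤ Module.finrank ℂ (Um.map X)) := fun X hX hΘX hXΘ hXc =>
    UnitaryLeviSetup.profile_dichotomy hbr hΘΘ hP hQ hadd hsymm hPQ hdefP hdefQ hadj hmin hB hΘB hBΘ hιι hιΘ hιs hUm hUp
      hPM hQM hQU hfinQU hrangeP hX hΘX hXΘ hXc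
  have hfinQU' := hfinQU
  rw [hr] at hfinQM hfinPU hfinQU hfinPm hfinQm hfinPp hfinQp hsplit hdich
  rw [hQ48] at hfinQM hfinQm hfinUm
  rw [hP35] at hfinPU hfinPp hfinUp
  have hcm : ∀ Z : Module.End ℂ W, Z * ι = ι * Z → ∀ x ∈ Um, Z x ∈ Um := fun Z hZ x hx =>
    (hUm _).2 (by rw [← Module.End.mul_apply, ← hZ, Module.End.mul_apply, (hUm x).1 hx, map_neg])
  have hcp : ∀ Z : Module.End ℂ W, Z * ι = ι * Z → ∀ x ∈ Up, Z x ∈ Up := fun Z hZ x hx =>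
    (hUp _).2 (by rw [← Module.End.mul_apply, ← hZ, Module.End.mul_apply, (hUp x).1 hx])
  have hfullm_of : Lm = ⊤ → False := fun h =>
    UnitaryLeviSetup.false_of_full_larger hbr hΘΘ hno1 hιι hιΘ hUm hUp (by omega) (by omega) hPM hQM (by omega)
      (by omega) hLm h
  have hkillm1 : ∀ X ∈ 𝔊, Θ * X = X → X * Θ = -X → X * ι = ι * X → Module.finrank ℂ (Um.map X) ≠ 1 := by
    intro X hX hΘX hXΘ hXc h1
    obtain ⟨hxmem, hιmx, hxιm, hxrk⟩ := UnitaryLeviSetup.restrict_mem hcm hLm hιmapply X hX hΘX hXΘ hXc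
    rw [h1] at hxrk
    exact hfullm_of (UnitaryRankOneRaise.eq_top_of_rankOne_raise hbrLm hirrLm hιmmem hιmιm hPm hQm
      (s := fun v w : Um => s (v : W) w) (hsU Um) (fun v w => hsymm v w) hPmQm hdefPm hdefQm hadjLm hxmem hιmx hxιm
      hxrk (by omega) (by omega) (by omega))
  have hkillm2 : ∀ X ∈ 𝔊, Θ * X = X → X * Θ = -X → X * ι = ι * X → Module.finrank ℂ (Um.map X) ≠ 2 := by
    intro X hX hΘX hXΘ hXc h2
    obtain ⟨hxmem, hιmx, hxιm, hxrk⟩ := UnitaryLeviSetup.restrict_mem hcm hLm hιmapply X hX hΘX hXΘ hXc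
    rw [h2] at hxrk
    refine hfullm_of (UnitaryDoubleLevi.eq_top_of_raise_of_core hbrLm hirrLm hιmmem hιmιm hPm hQm
      (s := fun v w : Um => s (v : W) w) (hsU Um) (fun v w => hsymm v w) hPmQm hdefPm hdefQm hadjLm hxmem hιmx hxιm
      (by rw [hxrk]; omega) (by omega) (by omega)
      fun U' 𝔩' ι' P' Q' hbr𝔩' hirr𝔩' hι' hι'ι' hP' hQ' hfinP' hfinQ' hP'Q' hdefP' hdefQ' hadj𝔩' => ?_)
    rw [hxrk] at hfinP' hfinQ'
    exact UnitaryTwoOdd.eq_top hbr𝔩' hirr𝔩' hι' hι'ι' hP' hQ' hfinP' ⟨14, by omega⟩ (s := fun x y : U' => s ((x : Um) : W) y) (fun x y z => by simp only [Submodule.coe_add, hadd]) (fun x y => hsymm _ _) hP'Q' hdefP' hdefQ' hadj𝔩'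
  have hkillm3 : ∀ X ∈ 𝔊, Θ * X = X → X * Θ = -X → X * ι = ι * X → Module.finrank ℂ (Um.map X) ≠ 3 := by
    intro X hX hΘX hXΘ hXc h3
    obtain ⟨hxmem, hιmx, hxιm, hxrk⟩ := UnitaryLeviSetup.restrict_mem hcm hLm hιmapply X hX hΘX hXΘ hXc
    rw [h3] at hxrk
    refine hfullm_of (UnitaryDoubleLevi.eq_top_of_raise_of_core hbrLm hirrLm hιmmem hιmιm hPm hQm
      (s := fun v w : Um => s (v : W) w) (hsU Um) (fun v w => hsymm v w) hPmQm hdefPm hdefQm hadjLm hxmem hιmx hxιm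
      (by rw [hxrk]; omega) (by omega) (by omega)
      fun U' 𝔩' ι' P' Q' hbr𝔩' hirr𝔩' hι' hι'ι' hP' hQ' hfinP' hfinQ' hP'Q' hdefP' hdefQ' hadj𝔩' => ?_)
    rw [hxrk] at hfinP' hfinQ'
    exact UnitaryThreeCoprime.eq_top hbr𝔩' hirr𝔩' hι' hι'ι' hP' hQ' hfinP' (by omega) (s := fun x y : U' => s ((x : Um) : W) y) (fun x y z => by simp only [Submodule.coe_add, hadd]) (fun x y => hsymm _ _) hP'Q' hdefP' hdefQ' hadj𝔩'
  have hkillm4 : ∀ X ∈ 𝔊, Θ * X = X → X * Θ = -X → X * ι = ι * X → Module.finrank ℂ (Um.map X) ≠ 4 := by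
    intro X hX hΘX hXΘ hXc h4
    obtain ⟨hxmem, hιmx, hxιm, hxrk⟩ := UnitaryLeviSetup.restrict_mem hcm hLm hιmapply X hX hΘX hXΘ hXc
    rw [h4] at hxrk
    refine hfullm_of (UnitaryDoubleLevi.eq_top_of_raise_of_core hbrLm hirrLm hιmmem hιmιm hPm hQm
      (s := fun v w : Um => s (v : W) w) (hsU Um) (fun v w => hsymm v w) hPmQm hdefPm hdefQm hadjLm hxmem hιmx hxιm
      (by rw [hxrk]; omega) (by omega) (by omega)
      fun U' 𝔩' ι' P' Q' hbr𝔩' hirr𝔩' hι' hι'ι' hP' hQ' hfinP' hfinQ' hP'Q' hdefP' hdefQ' hadj𝔩' => ?_)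
    rw [hxrk] at hfinP' hfinQ'
    exact UnitaryFourOdd.eq_top hbr𝔩' hirr𝔩' hι' hι'ι' hP' hQ' hfinP' ⟨13, by omega⟩ (s := fun x y : U' => s ((x : Um) : W) y) (fun x y z => by simp only [Submodule.coe_add, hadd]) (fun x y => hsymm _ _) hP'Q' hdefP' hdefQ' hadj𝔩'
  have hkillm5 : ∀ X ∈ 𝔊, Θ * X = X → X * Θ = -X → X * ι = ι * X → Module.finrank ℂ (Um.map X) ≠ 5 := by
    intro X hX hΘX hXΘ hXc h5
    obtain ⟨hxmem, hιmx, hxιm, hxrk⟩ := UnitaryLeviSetup.restrict_mem hcm hLm hιmapply X hX hΘX hXΘ hXc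
    rw [h5] at hxrk
    refine hfullm_of (UnitaryDoubleLevi.eq_top_of_raise_of_core hbrLm hirrLm hιmmem hιmιm hPm hQm
      (s := fun v w : Um => s (v : W) w) (hsU Um) (fun v w => hsymm v w) hPmQm hdefPm hdefQm hadjLm hxmem hιmx hxιm
      (by rw [hxrk]; omega) (by omega) (by omega)
      fun U' 𝔩' ι' P' Q' hbr𝔩' hirr𝔩' hι' hι'ι' hP' hQ' hfinP' hfinQ' hP'Q' hdefP' hdefQ' hadj𝔩' => ?_)
    rw [hxrk] at hfinP' hfinQ'
    exact UnitaryFive.eq_top_of_smul hbr𝔩' hirr𝔩' hι' hι'ι' hP' hQ' hfinP' (by omega) (s := fun x y : U' => s ((x : Um) : W) y) (fun x y z => by simp only [Submodule.coe_add, hadd]) (fun c x y => by simp only [Submodule.coe_smul, hsmul]) (fun x y => hsymm _ _) hP'Q' hdefP' hdefQ' hadj𝔩'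
  have hkillm6 : ∀ X ∈ 𝔊, Θ * X = X → X * Θ = -X → X * ι = ι * X → Module.finrank ℂ (Um.map X) ≠ 6 := by
    intro X hX hΘX hXΘ hXc h6
    obtain ⟨hxmem, hιmx, hxιm, hxrk⟩ := UnitaryLeviSetup.restrict_mem hcm hLm hιmapply X hX hΘX hXΘ hXc
    rw [h6] at hxrk
    refine hfullm_of (UnitaryDoubleLevi.eq_top_of_raise_of_core hbrLm hirrLm hιmmem hιmιm hPm hQm
      (s := fun v w : Um => s (v : W) w) (hsU Um) (fun v w => hsymm v w) hPmQm hdefPm hdefQm hadjLm hxmem hιmx hxιm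
      (by rw [hxrk]; omega) (by omega) (by omega)
      fun U' 𝔩' ι' P' Q' hbr𝔩' hirr𝔩' hι' hι'ι' hP' hQ' hfinP' hfinQ' hP'Q' hdefP' hdefQ' hadj𝔩' => ?_)
    rw [hxrk] at hfinP' hfinQ'
    exact UnitarySix.eq_top_of_smul hbr𝔩' hirr𝔩' hι' hι'ι' hP' hQ' hfinP' ⟨12, by omega⟩ (by omega) (s := fun x y : U' => s ((x : Um) : W) y) (fun x y z => by simp only [Submodule.coe_add, hadd]) (fun c x y => by simp only [Submodule.coe_smul, hsmul]) (fun x y => hsymm _ _) hP'Q' hdefP' hdefQ' hadj𝔩'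
  have hkillm7 : ∀ X ∈ 𝔊, Θ * X = X → X * Θ = -X → X * ι = ι * X → Module.finrank ℂ (Um.map X) ≠ 7 := by
    intro X hX hΘX hXΘ hXc h7
    obtain ⟨hxmem, hιmx, hxιm, hxrk⟩ := UnitaryLeviSetup.restrict_mem hcm hLm hιmapply X hX hΘX hXΘ hXc
    rw [h7] at hxrk
    refine hfullm_of (UnitaryDoubleLevi.eq_top_of_raise_of_core hbrLm hirrLm hιmmem hιmιm hPm hQm
      (s := fun v w : Um => s (v : W) w) (hsU Um) (fun v w => hsymm v w) hPmQm hdefPm hdefQm hadjLm hxmem hιmx hxιm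
      (by rw [hxrk]; omega) (by omega) (by omega)
      fun U' 𝔩' ι' P' Q' hbr𝔩' hirr𝔩' hι' hι'ι' hP' hQ' hfinP' hfinQ' hP'Q' hdefP' hdefQ' hadj𝔩' => ?_)
    rw [hxrk] at hfinP' hfinQ'
    exact UnitarySeven.eq_top_of_smul hbr𝔩' hirr𝔩' hι' hι'ι' hP' hQ' hfinP' (by omega) (s := fun x y : U' => s ((x : Um) : W) y) (fun x y z => by simp only [Submodule.coe_add, hadd]) (fun c x y => by simp only [Submodule.coe_smul, hsmul]) (fun x y => hsymm _ _) hP'Q' hdefP' hdefQ' hadj𝔩'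
  have hkillm8 : ∀ X ∈ 𝔊, Θ * X = X → X * Θ = -X → X * ι = ι * X → Module.finrank ℂ (Um.map X) ≠ 8 := by
    intro X hX hΘX hXΘ hXc h8
    obtain ⟨hxmem, hιmx, hxιm, hxrk⟩ := UnitaryLeviSetup.restrict_mem hcm hLm hιmapply X hX hΘX hXΘ hXc
    rw [h8] at hxrk
    refine hfullm_of (UnitaryDoubleLevi.eq_top_of_raise_of_core hbrLm hirrLm hιmmem hιmιm hPm hQm
      (s := fun v w : Um => s (v : W) w) (hsU Um) (fun v w => hsymm v w) hPmQm hdefPm hdefQm hadjLm hxmem hιmx hxιm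
      (by rw [hxrk]; omega) (by omega) (by omega)
      fun U' 𝔩' ι' P' Q' hbr𝔩' hirr𝔩' hι' hι'ι' hP' hQ' hfinP' hfinQ' hP'Q' hdefP' hdefQ' hadj𝔩' => ?_)
    rw [hxrk] at hfinP' hfinQ'
    exact UnitaryEight.eq_top_of_smul_twentythree hbr𝔩' hirr𝔩' hι' hι'ι' hP' hQ' hfinP' (by omega) (s := fun x y : U' => s ((x : Um) : W) y) (fun x y z => by simp only [Submodule.coe_add, hadd]) (fun c x y => by simp only [Submodule.coe_smul, hsmul]) (fun x y => hsymm _ _) hP'Q' hdefP' hdefQ' hadj𝔩'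
  have hkillm9 : ∀ X ∈ 𝔊, Θ * X = X → X * Θ = -X → X * ι = ι * X → Module.finrank ℂ (Um.map X) ≠ 9 := by
    intro X hX hΘX hXΘ hXc h9
    obtain ⟨hxmem, hιmx, hxιm, hxrk⟩ := UnitaryLeviSetup.restrict_mem hcm hLm hιmapply X hX hΘX hXΘ hXc
    rw [h9] at hxrk
    refine hfullm_of (UnitaryDoubleLevi.eq_top_of_raise_of_core hbrLm hirrLm hιmmem hιmιm hPm hQm
      (s := fun v w : Um => s (v : W) w) (hsU Um) (fun v w => hsymm v w) hPmQm hdefPm hdefQm hadjLm hxmem hιmx hxιm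
      (by rw [hxrk]; omega) (by omega) (by omega)
      fun U' 𝔩' ι' P' Q' hbr𝔩' hirr𝔩' hι' hι'ι' hP' hQ' hfinP' hfinQ' hP'Q' hdefP' hdefQ' hadj𝔩' => ?_)
    rw [hxrk] at hfinP' hfinQ'
    exact UnitaryNineTwentyTwo.eq_top_of_smul hbr𝔩' hirr𝔩' hι' hι'ι' hP' hQ' hfinP' (by omega) (s := fun x y : U' => s ((x : Um) : W) y) (fun x y z => by simp only [Submodule.coe_add, hadd]) (fun c x y => by simp only [Submodule.coe_smul, hsmul]) (fun x y => hsymm _ _) hP'Q' hdefP' hdefQ' hadj𝔩'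
  have hkillm10 : ∀ X ∈ 𝔊, Θ * X = X → X * Θ = -X → X * ι = ι * X → Module.finrank ℂ (Um.map X) ≠ 10 := by
    intro X hX hΘX hXΘ hXc h10
    obtain ⟨hxmem, hιmx, hxιm, hxrk⟩ := UnitaryLeviSetup.restrict_mem hcm hLm hιmapply X hX hΘX hXΘ hXc
    rw [h10] at hxrk
    refine hfullm_of (UnitaryDoubleLevi.eq_top_of_raise_of_core hbrLm hirrLm hιmmem hιmιm hPm hQm
      (s := fun v w : Um => s (v : W) w) (hsU Um) (fun v w => hsymm v w) hPmQm hdefPm hdefQm hadjLm hxmem hιmx hxιm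
      (by rw [hxrk]; omega) (by omega) (by omega)
      fun U' 𝔩' ι' P' Q' hbr𝔩' hirr𝔩' hι' hι'ι' hP' hQ' hfinP' hfinQ' hP'Q' hdefP' hdefQ' hadj𝔩' => ?_)
    rw [hxrk] at hfinP' hfinQ'
    exact UnitaryTenTwentyOne.eq_top_of_smul hbr𝔩' hirr𝔩' hι' hι'ι' hP' hQ' hfinP' (by omega) (s := fun x y : U' => s ((x : Um) : W) y) (fun x y z => by simp only [Submodule.coe_add, hadd]) (fun c x y => by simp only [Submodule.coe_smul, hsmul]) (fun x y => hsymm _ _) hP'Q' hdefP' hdefQ' hadj𝔩'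
  have hkillm11 : ∀ X ∈ 𝔊, Θ * X = X → X * Θ = -X → X * ι = ι * X → Module.finrank ℂ (Um.map X) ≠ 11 := by
    intro X hX hΘX hXΘ hXc h11
    obtain ⟨hxmem, hιmx, hxιm, hxrk⟩ := UnitaryLeviSetup.restrict_mem hcm hLm hιmapply X hX hΘX hXΘ hXc
    rw [h11] at hxrk
    refine hfullm_of (UnitaryDoubleLevi.eq_top_of_raise_of_core hbrLm hirrLm hιmmem hιmιm hPm hQm
      (s := fun v w : Um => s (v : W) w) (hsU Um) (fun v w => hsymm v w) hPmQm hdefPm hdefQm hadjLm hxmem hιmx hxιm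
      (by rw [hxrk]; omega) (by omega) (by omega)
      fun U' 𝔩' ι' P' Q' hbr𝔩' hirr𝔩' hι' hι'ι' hP' hQ' hfinP' hfinQ' hP'Q' hdefP' hdefQ' hadj𝔩' => ?_)
    rw [hxrk] at hfinP' hfinQ'
    exact UnitaryEleven.eq_top_of_smul hbr𝔩' hirr𝔩' hι' hι'ι' hP' hQ' hfinP' (by omega) (s := fun x y : U' => s ((x : Um) : W) y) (fun x y z => by simp only [Submodule.coe_add, hadd]) (fun c x y => by simp only [Submodule.coe_smul, hsmul]) (fun x y => hsymm _ _) hP'Q' hdefP' hdefQ' hadj𝔩'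
  have hkillm12 : ∀ X ∈ 𝔊, Θ * X = X → X * Θ = -X → X * ι = ι * X → Module.finrank ℂ (Um.map X) ≠ 12 := by
    intro X hX hΘX hXΘ hXc h12
    obtain ⟨hxmem, hιmx, hxιm, hxrk⟩ := UnitaryLeviSetup.restrict_mem hcm hLm hιmapply X hX hΘX hXΘ hXc
    rw [h12] at hxrk
    refine hfullm_of (UnitaryDoubleLevi.eq_top_of_raise_of_core hbrLm hirrLm hιmmem hιmιm hPm hQm
      (s := fun v w : Um => s (v : W) w) (hsU Um) (fun v w => hsymm v w) hPmQm hdefPm hdefQm hadjLm hxmem hιmx hxιm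
      (by rw [hxrk]; omega) (by omega) (by omega)
      fun U' 𝔩' ι' P' Q' hbr𝔩' hirr𝔩' hι' hι'ι' hP' hQ' hfinP' hfinQ' hP'Q' hdefP' hdefQ' hadj𝔩' => ?_)
    rw [hxrk] at hfinP' hfinQ'
    exact UnitaryTwelveNineteen.eq_top_of_smul hbr𝔩' hirr𝔩' hι' hι'ι' hP' hQ' hfinP' (by omega) (s := fun x y : U' => s ((x : Um) : W) y) (fun x y z => by simp only [Submodule.coe_add, hadd]) (fun c x y => by simp only [Submodule.coe_smul, hsmul]) (fun x y => hsymm _ _) hP'Q' hdefP' hdefQ' hadj𝔩'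
  have hkillm13 : ∀ X ∈ 𝔊, Θ * X = X → X * Θ = -X → X * ι = ι * X → Module.finrank ℂ (Um.map X) ≠ 13 := by
    intro X hX hΘX hXΘ hXc h13
    obtain ⟨hxmem, hιmx, hxιm, hxrk⟩ := UnitaryLeviSetup.restrict_mem hcm hLm hιmapply X hX hΘX hXΘ hXc
    rw [h13] at hxrk
    refine hfullm_of (UnitaryDoubleLevi.eq_top_of_raise_of_core hbrLm hirrLm hιmmem hιmιm hPm hQm
      (s := fun v w : Um => s (v : W) w) (hsU Um) (fun v w => hsymm v w) hPmQm hdefPm hdefQm hadjLm hxmem hιmx hxιm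
      (by rw [hxrk]; omega) (by omega) (by omega)
      fun U' 𝔩' ι' P' Q' hbr𝔩' hirr𝔩' hι' hι'ι' hP' hQ' hfinP' hfinQ' hP'Q' hdefP' hdefQ' hadj𝔩' => ?_)
    rw [hxrk] at hfinP' hfinQ'
    exact UnitaryThirteen.eq_top_of_smul hbr𝔩' hirr𝔩' hι' hι'ι' hP' hQ' hfinP' (by omega) (s := fun x y : U' => s ((x : Um) : W) y) (fun x y z => by simp only [Submodule.coe_add, hadd]) (fun c x y => by simp only [Submodule.coe_smul, hsmul]) (fun x y => hsymm _ _) hP'Q' hdefP' hdefQ' hadj𝔩'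
  have hkillm14 : ∀ X ∈ 𝔊, Θ * X = X → X * Θ = -X → X * ι = ι * X → Module.finrank ℂ (Um.map X) ≠ 14 := by
    intro X hX hΘX hXΘ hXc h14
    obtain ⟨hxmem, hιmx, hxιm, hxrk⟩ := UnitaryLeviSetup.restrict_mem hcm hLm hιmapply X hX hΘX hXΘ hXc
    rw [h14] at hxrk
    refine hfullm_of (UnitaryDoubleLevi.eq_top_of_raise_of_core hbrLm hirrLm hιmmem hιmιm hPm hQm
      (s := fun v w : Um => s (v : W) w) (hsU Um) (fun v w => hsymm v w) hPmQm hdefPm hdefQm hadjLm hxmem hιmx hxιm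
      (by rw [hxrk]; omega) (by omega) (by omega)
      fun U' 𝔩' ι' P' Q' hbr𝔩' hirr𝔩' hι' hι'ι' hP' hQ' hfinP' hfinQ' hP'Q' hdefP' hdefQ' hadj𝔩' => ?_)
    rw [hxrk] at hfinP' hfinQ'
    exact UnitarySeventeen.eq_top_of_smul hbr𝔩' hirr𝔩' hι' hι'ι' hP' hQ' (by omega) (by omega) (by omega) (s := fun x y : U' => s ((x : Um) : W) y) (fun x y z => by simp only [Submodule.coe_add, hadd]) (fun c x y => by simp only [Submodule.coe_smul, hsmul]) (fun x y => hsymm _ _) hP'Q' hdefP' hdefQ' hadj𝔩'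
  have hkillm15 : ∀ X ∈ 𝔊, Θ * X = X → X * Θ = -X → X * ι = ι * X → Module.finrank ℂ (Um.map X) ≠ 15 := by
    intro X hX hΘX hXΘ hXc h15
    obtain ⟨hxmem, hιmx, hxιm, hxrk⟩ := UnitaryLeviSetup.restrict_mem hcm hLm hιmapply X hX hΘX hXΘ hXc
    rw [h15] at hxrk
    refine hfullm_of (UnitaryDoubleLevi.eq_top_of_raise_of_core hbrLm hirrLm hιmmem hιmιm hPm hQm
      (s := fun v w : Um => s (v : W) w) (hsU Um) (fun v w => hsymm v w) hPmQm hdefPm hdefQm hadjLm hxmem hιmx hxιm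
      (by rw [hxrk]; omega) (by omega) (by omega)
      fun U' 𝔩' ι' P' Q' hbr𝔩' hirr𝔩' hι' hι'ι' hP' hQ' hfinP' hfinQ' hP'Q' hdefP' hdefQ' hadj𝔩' => ?_)
    rw [hxrk] at hfinP' hfinQ'
    exact UnitaryFifteenSixteen.eq_top_of_smul hbr𝔩' hirr𝔩' hι' hι'ι' hP' hQ' hfinP' (by omega) (s := fun x y : U' => s ((x : Um) : W) y) (fun x y z => by simp only [Submodule.coe_add, hadd]) (fun c x y => by simp only [Submodule.coe_smul, hsmul]) (fun x y => hsymm _ _) hP'Q' hdefP' hdefQ' hadj𝔩'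
  have hkillm16 : ∀ X ∈ 𝔊, Θ * X = X → X * Θ = -X → X * ι = ι * X → Module.finrank ℂ (Um.map X) ≠ 16 := by
    intro X hX hΘX hXΘ hXc h16
    obtain ⟨hxmem, hιmx, hxιm, hxrk⟩ := UnitaryLeviSetup.restrict_mem hcm hLm hιmapply X hX hΘX hXΘ hXc
    rw [h16] at hxrk
    refine hfullm_of (UnitaryDoubleLevi.eq_top_of_raise_of_core hbrLm hirrLm hιmmem hιmιm hPm hQm
      (s := fun v w : Um => s (v : W) w) (hsU Um) (fun v w => hsymm v w) hPmQm hdefPm hdefQm hadjLm hxmem hιmx hxιm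
      (by rw [hxrk]; omega) (by omega) (by omega)
      fun U' 𝔩' ι' P' Q' hbr𝔩' hirr𝔩' hι' hι'ι' hP' hQ' hfinP' hfinQ' hP'Q' hdefP' hdefQ' hadj𝔩' => ?_)
    rw [hxrk] at hfinP' hfinQ'
    exact UnitaryFifteenSixteen.eq_top_of_smul' hbr𝔩' hirr𝔩' hι' hι'ι' hP' hQ' hfinP' (by omega) (s := fun x y : U' => s ((x : Um) : W) y) (fun x y z => by simp only [Submodule.coe_add, hadd]) (fun c x y => by simp only [Submodule.coe_smul, hsmul]) (fun x y => hsymm _ _) hP'Q' hdefP' hdefQ' hadj𝔩'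
  have hkillm17 : ∀ X ∈ 𝔊, Θ * X = X → X * Θ = -X → X * ι = ι * X → Module.finrank ℂ (Um.map X) ≠ 17 := by
    intro X hX hΘX hXΘ hXc h17
    obtain ⟨hxmem, hιmx, hxιm, hxrk⟩ := UnitaryLeviSetup.restrict_mem hcm hLm hιmapply X hX hΘX hXΘ hXc
    rw [h17] at hxrk
    refine hfullm_of (UnitaryDoubleLevi.eq_top_of_raise_of_core hbrLm hirrLm hιmmem hιmιm hPm hQm
      (s := fun v w : Um => s (v : W) w) (hsU Um) (fun v w => hsymm v w) hPmQm hdefPm hdefQm hadjLm hxmem hιmx hxιm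
      (by rw [hxrk]; omega) (by omega) (by omega)
      fun U' 𝔩' ι' P' Q' hbr𝔩' hirr𝔩' hι' hι'ι' hP' hQ' hfinP' hfinQ' hP'Q' hdefP' hdefQ' hadj𝔩' => ?_)
    rw [hxrk] at hfinP' hfinQ'
    exact UnitarySeventeen.eq_top_of_smul' hbr𝔩' hirr𝔩' hι' hι'ι' hP' hQ' hfinP' (by omega) (by omega) (s := fun x y : U' => s ((x : Um) : W) y) (fun x y z => by simp only [Submodule.coe_add, hadd]) (fun c x y => by simp only [Submodule.coe_smul, hsmul]) (fun x y => hsymm _ _) hP'Q' hdefP' hdefQ' hadj𝔩'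
  have hfullp_of : Lp = ⊤ → False := by
    intro hLptop
    obtain ⟨T1, hιT1, hT1ι, hT1r⟩ := UnitaryRaisingSpace.exists_raise_finrank_range_eq hιpιp hPp hQp (k := 1)
      (by omega) (by omega)
    obtain ⟨X1, hX1, hΘX1, hX1Θ, hX1c, hX1Up⟩ := UnitaryLeviSetup.exists_lift hbr hΘ hΘΘ hcp hιΘ hLp hιpapply T1
      (by rw [hLptop]; exact Submodule.mem_top) hιT1 hT1ι
    rw [hT1r] at hX1Up
    obtain ⟨hs1, hi1, hi1', hj1, hj1'⟩ := hsplit X1 hΘX1 hX1Θ hX1c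
    have hrk1 := hS X1 hX1 hΘX1 hX1Θ
    have hd1 := hdich X1 hX1 hΘX1 hX1Θ hX1c
    rw [hs1] at hrk1
    rw [hX1Up] at hrk1 hd1
    have hk_hkillm16 := hkillm16 X1 hX1 hΘX1 hX1Θ hX1c
    omega
  have hkillp17 : ∀ X ∈ 𝔊, Θ * X = X → X * Θ = -X → X * ι = ι * X → Module.finrank ℂ (Up.map X) ≠ 17 := by
    intro X hX hΘX hXΘ hXc h17
    obtain ⟨hymem, hιpy, hyιp, hyrk⟩ := UnitaryLeviSetup.restrict_mem hcp hLp hιpapply X hX hΘX hXΘ hXc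
    rw [h17] at hyrk
    refine hfullp_of (UnitaryDoubleLevi.eq_top_of_raise_of_core' hbrLp hirrLp hιpmem hιpιp hPp hQp
      (s := fun v w : Up => s (v : W) w) (hsU Up) (fun v w => hsymm v w) hPpQp hdefPp hdefQp hadjLp hymem hιpy hyιp
      (by rw [hyrk]; omega) (by omega) (by omega)
      fun U' 𝔩' ι' P' Q' hbr𝔩' hirr𝔩' hι' hι'ι' hP' hQ' hfinP' hfinQ' hP'Q' hdefP' hdefQ' hadj𝔩' => ?_)
    rw [hyrk] at hfinP' hfinQ'
    exact UnitaryThreeCoprime.eq_top_of_finrank_eq_one hbr𝔩' hirr𝔩' hι' hι'ι' hP' hQ' (by omega) (by omega)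
  have hprof : ∀ X ∈ 𝔊, Θ * X = X → X * Θ = -X → X * ι = ι * X →
      (Module.finrank ℂ (Up.map X) = 0 ∧ Module.finrank ℂ (Um.map X) = 0) := by
    intro X hX hΘX hXΘ hXc
    obtain ⟨hs, hi, hi', hj, hj'⟩ := hsplit X hΘX hXΘ hXc
    have hkillm1' := hkillm1 X hX hΘX hXΘ hXc
    have hkillm2' := hkillm2 X hX hΘX hXΘ hXc
    have hkillm3' := hkillm3 X hX hΘX hXΘ hXc
    have hkillm4' := hkillm4 X hX hΘX hXΘ hXc
    have hkillm5' := hkillm5 X hX hΘX hXΘ hXc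
    have hkillm6' := hkillm6 X hX hΘX hXΘ hXc
    have hkillm7' := hkillm7 X hX hΘX hXΘ hXc
    have hkillm8' := hkillm8 X hX hΘX hXΘ hXc
    have hkillm9' := hkillm9 X hX hΘX hXΘ hXc
    have hkillm10' := hkillm10 X hX hΘX hXΘ hXc
    have hkillm11' := hkillm11 X hX hΘX hXΘ hXc
    have hkillm12' := hkillm12 X hX hΘX hXΘ hXc
    have hkillm13' := hkillm13 X hX hΘX hXΘ hXc
    have hkillm14' := hkillm14 X hX hΘX hXΘ hXc
    have hkillm15' := hkillm15 X hX hΘX hXΘ hXc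
    have hkillm16' := hkillm16 X hX hΘX hXΘ hXc
    have hkillm17' := hkillm17 X hX hΘX hXΘ hXc
    have hkillp17' := hkillp17 X hX hΘX hXΘ hXc
    have hrk := hS X hX hΘX hXΘ
    have hd := hdich X hX hΘX hXΘ hXc
    rw [hs] at hrk
    generalize Module.finrank ℂ ↥(Submodule.map X Um) = jj at *
    have hjle : jj ≤ 17 := by omega
    interval_cases jj
    · exact ⟨by omega, rfl⟩
    · exact (hkillm1' rfl).elim
    · exact (hkillm2' rfl).elim
    · exact (hkillm3' rfl).elim
    · exact (hkillm4' rfl).elim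
    · exact (hkillm5' rfl).elim
    · exact (hkillm6' rfl).elim
    · exact (hkillm7' rfl).elim
    · exact (hkillm8' rfl).elim
    · exact (hkillm9' rfl).elim
    · exact (hkillm10' rfl).elim
    · exact (hkillm11' rfl).elim
    · exact (hkillm12' rfl).elim
    · exact (hkillm13' rfl).elim
    · exact (hkillm14' rfl).elim
    · exact (hkillm15' rfl).elim
    · exact (hkillm16' rfl).elim
    · exact (hkillm17' rfl).elim
  obtain ⟨⟨p, hp⟩, hp0⟩ := Module.finrank_pos_iff_exists_ne_zero.1 (show 0 < Module.finrank ℂ PU by omega)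
  obtain ⟨⟨q, hq⟩, hq0⟩ := Module.finrank_pos_iff_exists_ne_zero.1 (show 0 < Module.finrank ℂ QU by omega)
  obtain ⟨X₀, hX₀, hΘX₀, hX₀Θ, hX₀c, c₀, hιc₀, -, hX₀c0⟩ :=
    UnitaryLeviFull.exists_raise_commute_apply_ne_zero hbr hirr hΘ hΘΘ hQ hιmem hιι hιΘ hUm hUp
      ⟨p, fun h => hp0 (Subtype.ext h), ((hPU p).1 hp).1, ((hPU p).1 hp).2⟩
      ⟨q, fun h => hq0 (Subtype.ext h), ((hQU q).1 hq).1, ((hQU q).1 hq).2⟩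
  have hX₀i : Module.finrank ℂ (Up.map X₀) ≠ 0 := fun h0 => by
    have hmem : X₀ c₀ ∈ Up.map X₀ := Submodule.mem_map_of_mem ((hUp c₀).2 hιc₀)
    rw [Submodule.finrank_eq_zero.1 h0, Submodule.mem_bot] at hmem
    exact hX₀c0 hmem
  have hp0 := hprof X₀ hX₀ hΘX₀ hX₀Θ hX₀c
  omega

set_option maxHeartbeats 400000 in
/-- `(35 | 48)`, minimal rank `18`: the non-zero profiles [(0, 18), (2, 16), (3, 15), (4, 14), (6, 12), (8, 10), (9, 9), (10, 8), (12, 6), (14, 4), (15, 3), (16, 2)] are pairwise exclusive, so constant; `(2, 16)`: TOOL C on `L⁺`; `(3, 15)`: `L⁺` (type `(17 | 18)`) has constant rank `3`; `(4, 14)`: `L⁺` (type `(17 | 18)`) has constant rank `4`; `(6, 12)`: `L⁺` (type `(17 | 18)`) has constant rank `6`; `(8, 10)`: `L⁺` (type `(17 | 18)`) has constant rank `8`; `(9, 9)`: `L⁺` (type `(17 | 18)`) has constant rank `9`; `(10, 8)`: `L⁺` (type `(17 | 18)`) has constant rank `10`; `(12, 6)`: TOOL G; `(14, 4)`: TOOL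 G; `(15, 3)`: TOOL G; `(16, 2)`: TOOL C on `L⁻`. [cite: Ribet1983, Thm. 3] [cite: Gordon1997, Thm. 6.3 (3)]
[cite: Deligne1982HodgeCycles, I §3 Prop. 3.4, 3.6] [cite: GoodmanWallachGTM255, §4.1.1] -/
theorem UnitaryThirtyFiveFortyEight.no_minRank_18 [FiniteDimensional ℂ W] {𝔊 : Submodule ℂ (Module.End ℂ W)}
    (hbr : ∀ Y ∈ 𝔊, ∀ Z ∈ 𝔊, Y * Z - Z * Y ∈ 𝔊)
    (hirr : ∀ U : Submodule ℂ W, (∀ A ∈ 𝔊, ∀ u ∈ U, A u ∈ U) → U = ⊥ ∨ U = ⊤)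
    {Θ : Module.End ℂ W} (hΘ : Θ ∈ 𝔊) (hΘΘ : Θ * Θ = 1)
    {P Q : Submodule ℂ W} (hP : ∀ x, x ∈ P ↔ Θ x = x) (hQ : ∀ x, x ∈ Q ↔ Θ x = -x)
    (hP35 : Module.finrank ℂ P = 35) (hQ48 : Module.finrank ℂ Q = 48)
    {s : W → W → ℂ} (hadd : ∀ x y z, s (x + y) z = s x z + s y z)
    (hsmul : ∀ (c : ℂ) (x y : W), s (c • x) y = c * s x y) (hsymm : ∀ x y, s y x = starRingEnd ℂ (s x y))
    (hPQ : ∀ p ∈ P, ∀ q ∈ Q, s p q = 0) (hdefP : ∀ p ∈ P, s p p = 0 → p = 0) (hdefQ : ∀ q ∈ Q, s q q = 0 → q = 0)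
    (hadj : ∀ X ∈ 𝔊, ∃ Y ∈ 𝔊, ∀ x y, s (X x) y = s x (Y y))
    (hS : ∀ B' ∈ 𝔊, Θ * B' = B' → B' * Θ = -B' →
      Module.finrank ℂ (LinearMap.range B') = 0 ∨ Module.finrank ℂ (LinearMap.range B') = 18 ∨ Module.finrank ℂ (LinearMap.range B') = 19 ∨ Module.finrank ℂ (LinearMap.range B') = 20 ∨ Module.finrank ℂ (LinearMap.range B') = 21 ∨ Module.finrank ℂ (LinearMap.range B') = 22 ∨ Module.finrank ℂ (LinearMap.range B') = 23 ∨ Module.finrank ℂ (LinearMap.range B') = 24 ∨ Module.finrank ℂ (LinearMap.range B') = 25 ∨ Module.finrank ℂ (LinearMap.range B') = 26 ∨ Module.finrank ℂ (LinearMap.range B') = 27 ∨ Module.finrank ℂ (LinearMap.range B') = 28 ∨ Module.finrank ℂ (LinearMap.range B') = 29 ∨ Module.finrank ℂ (LinearMap.range B') = 30 ∨ Module.finrank ℂ (LinearMap.range B') = 31 ∨ Module.finrank ℂ (LinearMap.range B') = 32 ∨ Module.finrank ℂ (LinearMap.range B') = 33 ∨ Module.finrank ℂ (LinearMap.range B')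 = 34)
    {B : Module.End ℂ W} (hB : B ∈ 𝔊) (hΘB : Θ * B = B) (hBΘ : B * Θ = -B)
    (hr : Module.finrank ℂ (LinearMap.range B) = 18) : False := by
  classical
  have hsU : ∀ U : Submodule ℂ W, ∀ x y z : U, s ((x + y : U) : W) z = s (x : W) z + s (y : W) z :=
    fun U x y z => by simp only [Submodule.coe_add, hadd]
  have hsmU : ∀ U : Submodule ℂ W, ∀ (c : ℂ) (x y : U), s ((c • x : U) : W) y = c * s (x : W) y :=
    fun U c x y => by simp only [Submodule.coe_smul, hsmul]
  have hno1 : ∀ B' ∈ 𝔊, Θ * B' = B' → B' * Θ = -B' → Module.finrank ℂ (LinearMap.range B') ≠ 1 := by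
    intro B' hB' hΘB' hB'Θ h1
    rcases hS B' hB' hΘB' hB'Θ with h | h | h | h | h | h | h | h | h | h | h | h | h | h | h | h | h | h <;> omega
  have hmin : ∀ Y ∈ 𝔊, Θ * Y = Y → Y * Θ = -Y → Y ≠ 0 → 18 ≤ Module.finrank ℂ (LinearMap.range Y) := by
    intro Y hY hΘY hYΘ hY0
    have h0 : Module.finrank ℂ (LinearMap.range Y) ≠ 0 := fun h =>
      hY0 (LinearMap.range_eq_bot.1 (Submodule.finrank_eq_zero.1 h))
    rcases hS Y hY hΘY hYΘ with h | h | h | h | h | h | h | h | h | h | h | h | h | h | h | h | h | h <;> omega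
  have hmin' : ∀ Z ∈ 𝔊, Θ * Z = Z → Z * Θ = -Z → Z ≠ 0 → Module.finrank ℂ (LinearMap.range B) ≤ Module.finrank ℂ (LinearMap.range Z) := by
    rw [hr]; exact hmin
  obtain ⟨ι, Um, Up, PU, QU, Lm, ιm, Pm, Qm, Lp, ιp, Pp, Qp, hιmem, hιι, hιΘ, hιs, hUm, hUp, hfinUm, hfinUp,
    hPM, hQM, hPU, hQU, hrangeP, hPUP, hQUQ, hfinQM, hfinPU, hfinQU, hLm, hLp,
    hιmapply, hPmmem, hQmmem, hbrLm, hirrLm, hιmmem, hιmιm, hPm, hQm, hfinPm, hfinQm, hPmQm, hdefPm, hdefQm, hadjLm,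
    hιpapply, hPpmem, hQpmem, hbrLp, hirrLp, hιpmem, hιpιp, hPp, hQp, hfinPp, hfinQp, hPpQp, hdefPp, hdefQp, hadjLp,
    hsplit⟩ :=
    UnitaryLeviSetup.exists_levi_pair hbr hirr hΘ hΘΘ hP hQ hadd hsymm hPQ hdefP hdefQ hadj hB hΘB hBΘ
  have hdich : ∀ X ∈ 𝔊, Θ * X = X → X * Θ = -X → X * ι = ι * X →
      Module.finrank ℂ (Up.map X) + Module.finrank ℂ (Um.map X) ≤ Module.finrank ℂ (LinearMap.range B) ∨
        (18 ≤ Module.finrank ℂ (Up.map X) ∧ 18 ≤ Module.finrank ℂ (Um.map X)) := fun X hX hΘX hXΘ hXc =>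
    UnitaryLeviSetup.profile_dichotomy hbr hΘΘ hP hQ hadd hsymm hPQ hdefP hdefQ hadj hmin hB hΘB hBΘ hιι hιΘ hιs hUm hUp
      hPM hQM hQU hfinQU hrangeP hX hΘX hXΘ hXc
  have hfinQU' := hfinQU
  rw [hr] at hfinQM hfinPU hfinQU hfinPm hfinQm hfinPp hfinQp hsplit hdich
  rw [hQ48] at hfinQM hfinQm hfinUm
  rw [hP35] at hfinPU hfinPp hfinUp
  have hcm : ∀ Z : Module.End ℂ W, Z * ι = ι * Z → ∀ x ∈ Um, Z x ∈ Um := fun Z hZ x hx =>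
    (hUm _).2 (by rw [← Module.End.mul_apply, ← hZ, Module.End.mul_apply, (hUm x).1 hx, map_neg])
  have hcp : ∀ Z : Module.End ℂ W, Z * ι = ι * Z → ∀ x ∈ Up, Z x ∈ Up := fun Z hZ x hx =>
    (hUp _).2 (by rw [← Module.End.mul_apply, ← hZ, Module.End.mul_apply, (hUp x).1 hx])
  have hfullm_of : Lm = ⊤ → False := fun h =>
    UnitaryLeviSetup.false_of_full_larger hbr hΘΘ hno1 hιι hιΘ hUm hUp (by omega) (by omega) hPM hQM (by omega)
      (by omega) hLm h
  have hkillm1 : ∀ X ∈ 𝔊, Θ * X = X → X * Θ = -X → X * ι = ι * X → Module.finrank ℂ (Um.map X) ≠ 1 := by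
    intro X hX hΘX hXΘ hXc h1
    obtain ⟨hxmem, hιmx, hxιm, hxrk⟩ := UnitaryLeviSetup.restrict_mem hcm hLm hιmapply X hX hΘX hXΘ hXc
    rw [h1] at hxrk
    exact hfullm_of (UnitaryRankOneRaise.eq_top_of_rankOne_raise hbrLm hirrLm hιmmem hιmιm hPm hQm
      (s := fun v w : Um => s (v : W) w) (hsU Um) (fun v w => hsymm v w) hPmQm hdefPm hdefQm hadjLm hxmem hιmx hxιm
      hxrk (by omega) (by omega) (by omega))
  have hkillm7 : ∀ X ∈ 𝔊, Θ * X = X → X * Θ = -X → X * ι = ι * X → Module.finrank ℂ (Um.map X) ≠ 7 := by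
    intro X hX hΘX hXΘ hXc h7
    obtain ⟨hxmem, hιmx, hxιm, hxrk⟩ := UnitaryLeviSetup.restrict_mem hcm hLm hιmapply X hX hΘX hXΘ hXc
    rw [h7] at hxrk
    refine hfullm_of (UnitaryDoubleLevi.eq_top_of_raise_of_core hbrLm hirrLm hιmmem hιmιm hPm hQm
      (s := fun v w : Um => s (v : W) w) (hsU Um) (fun v w => hsymm v w) hPmQm hdefPm hdefQm hadjLm hxmem hιmx hxιm
      (by rw [hxrk]; omega) (by omega) (by omega)
      fun U' 𝔩' ι' P' Q' hbr𝔩' hirr𝔩' hι' hι'ι' hP' hQ' hfinP' hfinQ' hP'Q' hdefP' hdefQ' hadj𝔩' => ?_)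
    rw [hxrk] at hfinP' hfinQ'
    exact UnitarySeven.eq_top_of_smul hbr𝔩' hirr𝔩' hι' hι'ι' hP' hQ' hfinP' (by omega) (s := fun x y : U' => s ((x : Um) : W) y) (fun x y z => by simp only [Submodule.coe_add, hadd]) (fun c x y => by simp only [Submodule.coe_smul, hsmul]) (fun x y => hsymm _ _) hP'Q' hdefP' hdefQ' hadj𝔩'
  have hkillm11 : ∀ X ∈ 𝔊, Θ * X = X → X * Θ = -X → X * ι = ι * X → Module.finrank ℂ (Um.map X) ≠ 11 := by
    intro X hX hΘX hXΘ hXc h11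
    obtain ⟨hxmem, hιmx, hxιm, hxrk⟩ := UnitaryLeviSetup.restrict_mem hcm hLm hιmapply X hX hΘX hXΘ hXc
    rw [h11] at hxrk
    refine hfullm_of (UnitaryDoubleLevi.eq_top_of_raise_of_core hbrLm hirrLm hιmmem hιmιm hPm hQm
      (s := fun v w : Um => s (v : W) w) (hsU Um) (fun v w => hsymm v w) hPmQm hdefPm hdefQm hadjLm hxmem hιmx hxιm
      (by rw [hxrk]; omega) (by omega) (by omega)
      fun U' 𝔩' ι' P' Q' hbr𝔩' hirr𝔩' hι' hι'ι' hP' hQ' hfinP' hfinQ' hP'Q' hdefP' hdefQ' hadj𝔩' => ?_)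
    rw [hxrk] at hfinP' hfinQ'
    exact UnitaryEleven.eq_top_of_smul hbr𝔩' hirr𝔩' hι' hι'ι' hP' hQ' hfinP' (by omega) (s := fun x y : U' => s ((x : Um) : W) y) (fun x y z => by simp only [Submodule.coe_add, hadd]) (fun c x y => by simp only [Submodule.coe_smul, hsmul]) (fun x y => hsymm _ _) hP'Q' hdefP' hdefQ' hadj𝔩'
  have hkillm13 : ∀ X ∈ 𝔊, Θ * X = X → X * Θ = -X → X * ι = ι * X → Module.finrank ℂ (Um.map X) ≠ 13 := by
    intro X hX hΘX hXΘ hXc h13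
    obtain ⟨hxmem, hιmx, hxιm, hxrk⟩ := UnitaryLeviSetup.restrict_mem hcm hLm hιmapply X hX hΘX hXΘ hXc
    rw [h13] at hxrk
    refine hfullm_of (UnitaryDoubleLevi.eq_top_of_raise_of_core hbrLm hirrLm hιmmem hιmιm hPm hQm
      (s := fun v w : Um => s (v : W) w) (hsU Um) (fun v w => hsymm v w) hPmQm hdefPm hdefQm hadjLm hxmem hιmx hxιm
      (by rw [hxrk]; omega) (by omega) (by omega)
      fun U' 𝔩' ι' P' Q' hbr𝔩' hirr𝔩' hι' hι'ι' hP' hQ' hfinP' hfinQ' hP'Q' hdefP' hdefQ' hadj𝔩' => ?_)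
    rw [hxrk] at hfinP' hfinQ'
    exact UnitaryThirteen.eq_top_of_smul hbr𝔩' hirr𝔩' hι' hι'ι' hP' hQ' hfinP' (by omega) (s := fun x y : U' => s ((x : Um) : W) y) (fun x y z => by simp only [Submodule.coe_add, hadd]) (fun c x y => by simp only [Submodule.coe_smul, hsmul]) (fun x y => hsymm _ _) hP'Q' hdefP' hdefQ' hadj𝔩'
  have hkillm17 : ∀ X ∈ 𝔊, Θ * X = X → X * Θ = -X → X * ι = ι * X → Module.finrank ℂ (Um.map X) ≠ 17 := by
    intro X hX hΘX hXΘ hXc h17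
    obtain ⟨hxmem, hιmx, hxιm, hxrk⟩ := UnitaryLeviSetup.restrict_mem hcm hLm hιmapply X hX hΘX hXΘ hXc
    rw [h17] at hxrk
    refine hfullm_of (UnitaryDoubleLevi.eq_top_of_raise_of_core hbrLm hirrLm hιmmem hιmιm hPm hQm
      (s := fun v w : Um => s (v : W) w) (hsU Um) (fun v w => hsymm v w) hPmQm hdefPm hdefQm hadjLm hxmem hιmx hxιm
      (by rw [hxrk]; omega) (by omega) (by omega)
      fun U' 𝔩' ι' P' Q' hbr𝔩' hirr𝔩' hι' hι'ι' hP' hQ' hfinP' hfinQ' hP'Q' hdefP' hdefQ' hadj𝔩' => ?_)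
    rw [hxrk] at hfinP' hfinQ'
    exact UnitaryThirteen.eq_top_of_smul' hbr𝔩' hirr𝔩' hι' hι'ι' hP' hQ' (by omega) (by omega) (s := fun x y : U' => s ((x : Um) : W) y) (fun x y z => by simp only [Submodule.coe_add, hadd]) (fun c x y => by simp only [Submodule.coe_smul, hsmul]) (fun x y => hsymm _ _) hP'Q' hdefP' hdefQ' hadj𝔩'
  have hfullp_of : Lp = ⊤ → False := by
    intro hLptop
    obtain ⟨T1, hιT1, hT1ι, hT1r⟩ := UnitaryRaisingSpace.exists_raise_finrank_range_eq hιpιp hPp hQp (k := 1)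
      (by omega) (by omega)
    obtain ⟨X1, hX1, hΘX1, hX1Θ, hX1c, hX1Up⟩ := UnitaryLeviSetup.exists_lift hbr hΘ hΘΘ hcp hιΘ hLp hιpapply T1
      (by rw [hLptop]; exact Submodule.mem_top) hιT1 hT1ι
    rw [hT1r] at hX1Up
    obtain ⟨hs1, hi1, hi1', hj1, hj1'⟩ := hsplit X1 hΘX1 hX1Θ hX1c
    have hrk1 := hS X1 hX1 hΘX1 hX1Θ
    have hd1 := hdich X1 hX1 hΘX1 hX1Θ hX1c
    rw [hs1] at hrk1
    rw [hX1Up] at hrk1 hd1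
    have hk_hkillm17 := hkillm17 X1 hX1 hΘX1 hX1Θ hX1c
    omega
  have hkillp13 : ∀ X ∈ 𝔊, Θ * X = X → X * Θ = -X → X * ι = ι * X → Module.finrank ℂ (Up.map X) ≠ 13 := by
    intro X hX hΘX hXΘ hXc h13
    obtain ⟨hymem, hιpy, hyιp, hyrk⟩ := UnitaryLeviSetup.restrict_mem hcp hLp hιpapply X hX hΘX hXΘ hXc
    rw [h13] at hyrk
    refine hfullp_of (UnitaryDoubleLevi.eq_top_of_raise_of_core hbrLp hirrLp hιpmem hιpιp hPp hQp
      (s := fun v w : Up => s (v : W) w) (hsU Up) (fun v w => hsymm v w) hPpQp hdefPp hdefQp hadjLp hymem hιpy hyιp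
      (by rw [hyrk]; omega) (by omega) (by omega)
      fun U' 𝔩' ι' P' Q' hbr𝔩' hirr𝔩' hι' hι'ι' hP' hQ' hfinP' hfinQ' hP'Q' hdefP' hdefQ' hadj𝔩' => ?_)
    rw [hyrk] at hfinP' hfinQ'
    exact UnitaryFive.eq_top_of_smul' hbr𝔩' hirr𝔩' hι' hι'ι' hP' hQ' (by omega) (by omega) (s := fun x y : U' => s ((x : Up) : W) y) (fun x y z => by simp only [Submodule.coe_add, hadd]) (fun c x y => by simp only [Submodule.coe_smul, hsmul]) (fun x y => hsymm _ _) hP'Q' hdefP' hdefQ' hadj𝔩'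
  have hprof : ∀ X ∈ 𝔊, Θ * X = X → X * Θ = -X → X * ι = ι * X →
      (Module.finrank ℂ (Up.map X) = 0 ∧ Module.finrank ℂ (Um.map X) = 0) ∨
        (Module.finrank ℂ (Up.map X) = 0 ∧ Module.finrank ℂ (Um.map X) = 18) ∨
        (Module.finrank ℂ (Up.map X) = 2 ∧ Module.finrank ℂ (Um.map X) = 16) ∨
        (Module.finrank ℂ (Up.map X) = 3 ∧ Module.finrank ℂ (Um.map X) = 15) ∨
        (Module.finrank ℂ (Up.map X) = 4 ∧ Module.finrank ℂ (Um.map X) = 14) ∨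
        (Module.finrank ℂ (Up.map X) = 6 ∧ Module.finrank ℂ (Um.map X) = 12) ∨
        (Module.finrank ℂ (Up.map X) = 8 ∧ Module.finrank ℂ (Um.map X) = 10) ∨
        (Module.finrank ℂ (Up.map X) = 9 ∧ Module.finrank ℂ (Um.map X) = 9) ∨
        (Module.finrank ℂ (Up.map X) = 10 ∧ Module.finrank ℂ (Um.map X) = 8) ∨
        (Module.finrank ℂ (Up.map X) = 12 ∧ Module.finrank ℂ (Um.map X) = 6) ∨
        (Module.finrank ℂ (Up.map X) = 14 ∧ Module.finrank ℂ (Um.map X) = 4) ∨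
        (Module.finrank ℂ (Up.map X) = 15 ∧ Module.finrank ℂ (Um.map X) = 3) ∨
        (Module.finrank ℂ (Up.map X) = 16 ∧ Module.finrank ℂ (Um.map X) = 2) := by
    intro X hX hΘX hXΘ hXc
    obtain ⟨hs, hi, hi', hj, hj'⟩ := hsplit X hΘX hXΘ hXc
    have hkillm1' := hkillm1 X hX hΘX hXΘ hXc
    have hkillm7' := hkillm7 X hX hΘX hXΘ hXc
    have hkillm11' := hkillm11 X hX hΘX hXΘ hXc
    have hkillm13' := hkillm13 X hX hΘX hXΘ hXc
    have hkillm17' := hkillm17 X hX hΘX hXΘ hXc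
    have hkillp13' := hkillp13 X hX hΘX hXΘ hXc
    have hrk := hS X hX hΘX hXΘ
    have hd := hdich X hX hΘX hXΘ hXc
    rw [hs] at hrk
    generalize Module.finrank ℂ ↥(Submodule.map X Um) = jj at *
    have hjle : jj ≤ 18 := by omega
    interval_cases jj
    · exact Or.inl ⟨by omega, rfl⟩
    · exact (hkillm1' rfl).elim
    · exact Or.inr (Or.inr (Or.inr (Or.inr (Or.inr (Or.inr (Or.inr (Or.inr (Or.inr (Or.inr (Or.inr (Or.inr (⟨by omega, rfl⟩))))))))))))
    · exact Or.inr (Or.inr (Or.inr (Or.inr (Or.inr (Or.inr (Or.inr (Or.inr (Or.inr (Or.inr (Or.inr (Or.inl ⟨by omega, rfl⟩)))))))))))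
    · exact Or.inr (Or.inr (Or.inr (Or.inr (Or.inr (Or.inr (Or.inr (Or.inr (Or.inr (Or.inr (Or.inl ⟨by omega, rfl⟩))))))))))
    · exfalso; omega
    · exact Or.inr (Or.inr (Or.inr (Or.inr (Or.inr (Or.inr (Or.inr (Or.inr (Or.inr (Or.inl ⟨by omega, rfl⟩)))))))))
    · exact (hkillm7' rfl).elim
    · exact Or.inr (Or.inr (Or.inr (Or.inr (Or.inr (Or.inr (Or.inr (Or.inr (Or.inl ⟨by omega, rfl⟩))))))))
    · exact Or.inr (Or.inr (Or.inr (Or.inr (Or.inr (Or.inr (Or.inr (Or.inl ⟨by omega, rfl⟩)))))))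
    · exact Or.inr (Or.inr (Or.inr (Or.inr (Or.inr (Or.inr (Or.inl ⟨by omega, rfl⟩))))))
    · exact (hkillm11' rfl).elim
    · exact Or.inr (Or.inr (Or.inr (Or.inr (Or.inr (Or.inl ⟨by omega, rfl⟩)))))
    · exact (hkillm13' rfl).elim
    · exact Or.inr (Or.inr (Or.inr (Or.inr (Or.inl ⟨by omega, rfl⟩))))
    · exact Or.inr (Or.inr (Or.inr (Or.inl ⟨by omega, rfl⟩)))
    · exact Or.inr (Or.inr (Or.inl ⟨by omega, rfl⟩))
    · exact (hkillm17' rfl).elim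
    · exact Or.inr (Or.inl ⟨by omega, rfl⟩)
  obtain ⟨⟨p, hp⟩, hp0⟩ := Module.finrank_pos_iff_exists_ne_zero.1 (show 0 < Module.finrank ℂ PU by omega)
  obtain ⟨⟨q, hq⟩, hq0⟩ := Module.finrank_pos_iff_exists_ne_zero.1 (show 0 < Module.finrank ℂ QU by omega)
  obtain ⟨X₀, hX₀, hΘX₀, hX₀Θ, hX₀c, c₀, hιc₀, -, hX₀c0⟩ :=
    UnitaryLeviFull.exists_raise_commute_apply_ne_zero hbr hirr hΘ hΘΘ hQ hιmem hιι hιΘ hUm hUp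
      ⟨p, fun h => hp0 (Subtype.ext h), ((hPU p).1 hp).1, ((hPU p).1 hp).2⟩
      ⟨q, fun h => hq0 (Subtype.ext h), ((hQU q).1 hq).1, ((hQU q).1 hq).2⟩
  have hX₀i : Module.finrank ℂ (Up.map X₀) ≠ 0 := fun h0 => by
    have hmem : X₀ c₀ ∈ Up.map X₀ := Submodule.mem_map_of_mem ((hUp c₀).2 hιc₀)
    rw [Submodule.finrank_eq_zero.1 h0, Submodule.mem_bot] at hmem
    exact hX₀c0 hmem
  have hnotboth : ∀ X ∈ 𝔊, Θ * X = X → X * Θ = -X → X * ι = ι * X → ∀ X' ∈ 𝔊, Θ * X' = X' → X' * Θ = -X' →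
      X' * ι = ι * X' → 18 < Module.finrank ℂ (Up.map X') + Module.finrank ℂ (Um.map X) → False := by
    intro X hX hΘX hXΘ hXc X' hX' hΘX' hX'Θ hX'c hgt
    obtain ⟨c, hc1, hc2⟩ := UnitaryGenericRank.exists_finrank_le_and_finrank_le (X'.restrict (hcp X' hX'c))
      (X.restrict (hcp X hXc)) (X.restrict (hcm X hXc)) (X'.restrict (hcm X' hX'c))
    obtain ⟨hX₁, hΘX₁, hX₁Θ, hX₁c⟩ := UnitaryLeviSetup.add_smul_raise X hX hΘX hXΘ hXc X' hX' hΘX' hX'Θ hX'c c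
    have hi₁ := UnitaryLeviSetup.finrank_map_add_smul hcp X X' hXc hX'c c hX₁c
    have hj₁ := UnitaryLeviSetup.finrank_map_add_smul hcm X X' hXc hX'c c hX₁c
    rw [UnitaryLeviRank.finrank_range_restrict] at hc1 hc2
    have hp := hprof (X + c • X') hX₁ hΘX₁ hX₁Θ hX₁c
    rw [hi₁, hj₁] at hp
    omega
  have hzero : ∀ X ∈ 𝔊, Θ * X = X → X * Θ = -X → X * ι = ι * X → Module.finrank ℂ (Up.map X) = 0 → Module.finrank ℂ (Um.map X) = 0 → X = 0 := by
    intro X hX hΘX hXΘ hXc hi hj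
    obtain ⟨hs, -, -, -, -⟩ := hsplit X hΘX hXΘ hXc
    rw [hi, hj, add_zero] at hs
    exact LinearMap.range_eq_bot.1 (Submodule.finrank_eq_zero.1 hs)
  have hjoint : ∀ v ∈ Q ⊓ LinearMap.ker B,
      (∀ X ∈ 𝔊, Θ * X = X → X * Θ = -X → X * ι = ι * X → X v = 0) → v = 0 := by
    intro v hv hkill
    obtain ⟨hιv, -⟩ := (hQM v).1 hv
    have hvUm : v ∈ Um := (hUm v).2 hιv
    obtain ⟨⟨p₁, hp₁⟩, hp₁0⟩ := Module.finrank_pos_iff_exists_ne_zero.1 (show 0 < Module.finrank ℂ Pm by omega)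
    have hq : ιm ⟨v, hvUm⟩ = -⟨v, hvUm⟩ := (hQm _).1 ((hQmmem _).2 hv)
    have h0 := UnitaryThetaCore.eq_zero_of_forall_raise_apply_eq_zero hbrLm hirrLm hιmmem hιmιm
      ⟨p₁, fun h => hp₁0 (Subtype.ext h), (hPm p₁).1 hp₁⟩ hq fun T hT hιT hTι => ?_
    · exact congrArg Subtype.val h0
    obtain ⟨X, hX, hΘX, hXΘ, hXc, hXT⟩ := UnitaryLeviSetup.exists_lift_eq hbr hΘ hΘΘ hιΘ hLm hιmapply T hT hιT hTι
    exact Subtype.ext (by rw [← hXT]; exact hkill X hX hΘX hXΘ hXc)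
  rcases hprof X₀ hX₀ hΘX₀ hX₀Θ hX₀c with ⟨h0i, h0j⟩ | ⟨h0i, h0j⟩ | ⟨h0i, h0j⟩ | ⟨h0i, h0j⟩ | ⟨h0i, h0j⟩ | ⟨h0i, h0j⟩ | ⟨h0i, h0j⟩ | ⟨h0i, h0j⟩ | ⟨h0i, h0j⟩ | ⟨h0i, h0j⟩ | ⟨h0i, h0j⟩ | ⟨h0i, h0j⟩ | ⟨h0i, h0j⟩
  · exact hX₀i h0i
  · exact hX₀i h0i
  · -- constant profile `(2, 16)`
    have hprofc : ∀ X ∈ 𝔊, Θ * X = X → X * Θ = -X → X * ι = ι * X → X ≠ 0 →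
        Module.finrank ℂ (Up.map X) = 2 ∧ Module.finrank ℂ (Um.map X) = 16 := by
      intro X hX hΘX hXΘ hXc hX0
      rcases hprof X hX hΘX hXΘ hXc with ⟨hi, hj⟩ | ⟨hi, hj⟩ | ⟨hi, hj⟩ | ⟨hi, hj⟩ | ⟨hi, hj⟩ | ⟨hi, hj⟩ | ⟨hi, hj⟩ | ⟨hi, hj⟩ | ⟨hi, hj⟩ | ⟨hi, hj⟩ | ⟨hi, hj⟩ | ⟨hi, hj⟩ | ⟨hi, hj⟩
      · exact (hX0 (hzero X hX hΘX hXΘ hXc hi hj)).elim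
      · exact (hnotboth X hX hΘX hXΘ hXc X₀ hX₀ hΘX₀ hX₀Θ hX₀c (by omega)).elim
      · exact ⟨hi, hj⟩
      · exact (hnotboth X₀ hX₀ hΘX₀ hX₀Θ hX₀c X hX hΘX hXΘ hXc (by omega)).elim
      · exact (hnotboth X₀ hX₀ hΘX₀ hX₀Θ hX₀c X hX hΘX hXΘ hXc (by omega)).elim
      · exact (hnotboth X₀ hX₀ hΘX₀ hX₀Θ hX₀c X hX hΘX hXΘ hXc (by omega)).elim
      · exact (hnotboth X₀ hX₀ hΘX₀ hX₀Θ hX₀c X hX hΘX hXΘ hXc (by omega)).elim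
      · exact (hnotboth X₀ hX₀ hΘX₀ hX₀Θ hX₀c X hX hΘX hXΘ hXc (by omega)).elim
      · exact (hnotboth X₀ hX₀ hΘX₀ hX₀Θ hX₀c X hX hΘX hXΘ hXc (by omega)).elim
      · exact (hnotboth X₀ hX₀ hΘX₀ hX₀Θ hX₀c X hX hΘX hXΘ hXc (by omega)).elim
      · exact (hnotboth X₀ hX₀ hΘX₀ hX₀Θ hX₀c X hX hΘX hXΘ hXc (by omega)).elim
      · exact (hnotboth X₀ hX₀ hΘX₀ hX₀Θ hX₀c X hX hΘX hXΘ hXc (by omega)).elim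
      · exact (hnotboth X₀ hX₀ hΘX₀ hX₀Θ hX₀c X hX hΘX hXΘ hXc (by omega)).elim
    obtain ⟨A, hA, hιpA, hAιp, hAne, hA2⟩ :=
      UnitaryConstantRank.exists_raise_rank_ne_two hbrLp hirrLp hιpmem hιpιp hPp hQp (by omega) (by omega) (by omega)
        (s := fun v w : Up => s (v : W) w) (hsU Up) (fun v w => hsymm v w) hPpQp hdefPp hdefQp hadjLp
    obtain ⟨XA, hXA, hΘXA, hXAΘ, hXAc, hXAUp⟩ := UnitaryLeviSetup.exists_lift hbr hΘ hΘΘ hcp hιΘ hLp hιpapply A hA hιpA hAιp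
    have hA0 : Module.finrank ℂ (LinearMap.range A) ≠ 0 := fun h =>
      hAne (LinearMap.range_eq_bot.1 (Submodule.finrank_eq_zero.1 h))
    have hXA0 : XA ≠ 0 := fun h0 => hA0 (by rw [← hXAUp, h0, Submodule.map_zero, finrank_bot])
    have hpA := hprofc XA hXA hΘXA hXAΘ hXAc hXA0
    rw [← hXAUp] at hA2
    omega
  · -- constant profile `(3, 15)`
    have hprofc : ∀ X ∈ 𝔊, Θ * X = X → X * Θ = -X → X * ι = ι * X → X ≠ 0 →
        Module.finrank ℂ (Up.map X) = 3 ∧ Module.finrank ℂ (Um.map X) = 15 := by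
      intro X hX hΘX hXΘ hXc hX0
      rcases hprof X hX hΘX hXΘ hXc with ⟨hi, hj⟩ | ⟨hi, hj⟩ | ⟨hi, hj⟩ | ⟨hi, hj⟩ | ⟨hi, hj⟩ | ⟨hi, hj⟩ | ⟨hi, hj⟩ | ⟨hi, hj⟩ | ⟨hi, hj⟩ | ⟨hi, hj⟩ | ⟨hi, hj⟩ | ⟨hi, hj⟩ | ⟨hi, hj⟩
      · exact (hX0 (hzero X hX hΘX hXΘ hXc hi hj)).elim
      · exact (hnotboth X hX hΘX hXΘ hXc X₀ hX₀ hΘX₀ hX₀Θ hX₀c (by omega)).elim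
      · exact (hnotboth X hX hΘX hXΘ hXc X₀ hX₀ hΘX₀ hX₀Θ hX₀c (by omega)).elim
      · exact ⟨hi, hj⟩
      · exact (hnotboth X₀ hX₀ hΘX₀ hX₀Θ hX₀c X hX hΘX hXΘ hXc (by omega)).elim
      · exact (hnotboth X₀ hX₀ hΘX₀ hX₀Θ hX₀c X hX hΘX hXΘ hXc (by omega)).elim
      · exact (hnotboth X₀ hX₀ hΘX₀ hX₀Θ hX₀c X hX hΘX hXΘ hXc (by omega)).elim
      · exact (hnotboth X₀ hX₀ hΘX₀ hX₀Θ hX₀c X hX hΘX hXΘ hXc (by omega)).elim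
      · exact (hnotboth X₀ hX₀ hΘX₀ hX₀Θ hX₀c X hX hΘX hXΘ hXc (by omega)).elim
      · exact (hnotboth X₀ hX₀ hΘX₀ hX₀Θ hX₀c X hX hΘX hXΘ hXc (by omega)).elim
      · exact (hnotboth X₀ hX₀ hΘX₀ hX₀Θ hX₀c X hX hΘX hXΘ hXc (by omega)).elim
      · exact (hnotboth X₀ hX₀ hΘX₀ hX₀Θ hX₀c X hX hΘX hXΘ hXc (by omega)).elim
      · exact (hnotboth X₀ hX₀ hΘX₀ hX₀Θ hX₀c X hX hΘX hXΘ hXc (by omega)).elim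
    obtain ⟨hymem, hιpy, hyιp, hyrk⟩ := UnitaryLeviSetup.restrict_mem hcp hLp hιpapply X₀ hX₀ hΘX₀ hX₀Θ hX₀c
    have hSp : ∀ A ∈ Lp, ιp * A = A → A * ιp = -A →
        Module.finrank ℂ (LinearMap.range A) = 0 ∨ Module.finrank ℂ (LinearMap.range A) = 3 := by
      intro A hA hιA hAι
      by_cases hA0 : A = 0
      · left; rw [hA0, LinearMap.range_zero, finrank_bot]
      · obtain ⟨XA, hXA, hΘXA, hXAΘ, hXAc, hXAUp⟩ :=
          UnitaryLeviSetup.exists_lift hbr hΘ hΘΘ hcp hιΘ hLp hιpapply A hA hιA hAι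
        have hXA0 : XA ≠ 0 := fun h0 => hA0 (LinearMap.range_eq_bot.1 (Submodule.finrank_eq_zero.1
          (by rw [← hXAUp, h0, Submodule.map_zero, finrank_bot])))
        right; rw [← hXAUp]; exact (hprofc XA hXA hΘXA hXAΘ hXAc hXA0).1
    exact UnitaryThirtyFiveThirtyEight.subSeventeenEighteen_rank3 hbrLp hirrLp hιpmem hιpιp hPp hQp (by omega) (by omega)
      (s := fun v w : Up => s (v : W) w) (hsU Up) (hsmU Up) (fun v w => hsymm v w) hPpQp hdefPp hdefQp hadjLp hSp
      hymem hιpy hyιp (by rw [hyrk, h0i])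
  · -- constant profile `(4, 14)`
    have hprofc : ∀ X ∈ 𝔊, Θ * X = X → X * Θ = -X → X * ι = ι * X → X ≠ 0 →
        Module.finrank ℂ (Up.map X) = 4 ∧ Module.finrank ℂ (Um.map X) = 14 := by
      intro X hX hΘX hXΘ hXc hX0
      rcases hprof X hX hΘX hXΘ hXc with ⟨hi, hj⟩ | ⟨hi, hj⟩ | ⟨hi, hj⟩ | ⟨hi, hj⟩ | ⟨hi, hj⟩ | ⟨hi, hj⟩ | ⟨hi, hj⟩ | ⟨hi, hj⟩ | ⟨hi, hj⟩ | ⟨hi, hj⟩ | ⟨hi, hj⟩ | ⟨hi, hj⟩ | ⟨hi, hj⟩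
      · exact (hX0 (hzero X hX hΘX hXΘ hXc hi hj)).elim
      · exact (hnotboth X hX hΘX hXΘ hXc X₀ hX₀ hΘX₀ hX₀Θ hX₀c (by omega)).elim
      · exact (hnotboth X hX hΘX hXΘ hXc X₀ hX₀ hΘX₀ hX₀Θ hX₀c (by omega)).elim
      · exact (hnotboth X hX hΘX hXΘ hXc X₀ hX₀ hΘX₀ hX₀Θ hX₀c (by omega)).elim
      · exact ⟨hi, hj⟩
      · exact (hnotboth X₀ hX₀ hΘX₀ hX₀Θ hX₀c X hX hΘX hXΘ hXc (by omega)).elim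
      · exact (hnotboth X₀ hX₀ hΘX₀ hX₀Θ hX₀c X hX hΘX hXΘ hXc (by omega)).elim
      · exact (hnotboth X₀ hX₀ hΘX₀ hX₀Θ hX₀c X hX hΘX hXΘ hXc (by omega)).elim
      · exact (hnotboth X₀ hX₀ hΘX₀ hX₀Θ hX₀c X hX hΘX hXΘ hXc (by omega)).elim
      · exact (hnotboth X₀ hX₀ hΘX₀ hX₀Θ hX₀c X hX hΘX hXΘ hXc (by omega)).elim
      · exact (hnotboth X₀ hX₀ hΘX₀ hX₀Θ hX₀c X hX hΘX hXΘ hXc (by omega)).elim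
      · exact (hnotboth X₀ hX₀ hΘX₀ hX₀Θ hX₀c X hX hΘX hXΘ hXc (by omega)).elim
      · exact (hnotboth X₀ hX₀ hΘX₀ hX₀Θ hX₀c X hX hΘX hXΘ hXc (by omega)).elim
    obtain ⟨hymem, hιpy, hyιp, hyrk⟩ := UnitaryLeviSetup.restrict_mem hcp hLp hιpapply X₀ hX₀ hΘX₀ hX₀Θ hX₀c
    have hSp : ∀ A ∈ Lp, ιp * A = A → A * ιp = -A →
        Module.finrank ℂ (LinearMap.range A) = 0 ∨ Module.finrank ℂ (LinearMap.range A) = 4 := by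
      intro A hA hιA hAι
      by_cases hA0 : A = 0
      · left; rw [hA0, LinearMap.range_zero, finrank_bot]
      · obtain ⟨XA, hXA, hΘXA, hXAΘ, hXAc, hXAUp⟩ :=
          UnitaryLeviSetup.exists_lift hbr hΘ hΘΘ hcp hιΘ hLp hιpapply A hA hιA hAι
        have hXA0 : XA ≠ 0 := fun h0 => hA0 (LinearMap.range_eq_bot.1 (Submodule.finrank_eq_zero.1
          (by rw [← hXAUp, h0, Submodule.map_zero, finrank_bot])))
        right; rw [← hXAUp]; exact (hprofc XA hXA hΘXA hXAΘ hXAc hXA0).1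
    exact UnitaryThirtyFiveThirtyEight.subSeventeenEighteen_rank4 hbrLp hirrLp hιpmem hιpιp hPp hQp (by omega) (by omega)
      (s := fun v w : Up => s (v : W) w) (hsU Up) (hsmU Up) (fun v w => hsymm v w) hPpQp hdefPp hdefQp hadjLp hSp
      hymem hιpy hyιp (by rw [hyrk, h0i])
  · -- constant profile `(6, 12)`
    have hprofc : ∀ X ∈ 𝔊, Θ * X = X → X * Θ = -X → X * ι = ι * X → X ≠ 0 →
        Module.finrank ℂ (Up.map X) = 6 ∧ Module.finrank ℂ (Um.map X) = 12 := by
      intro X hX hΘX hXΘ hXc hX0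
      rcases hprof X hX hΘX hXΘ hXc with ⟨hi, hj⟩ | ⟨hi, hj⟩ | ⟨hi, hj⟩ | ⟨hi, hj⟩ | ⟨hi, hj⟩ | ⟨hi, hj⟩ | ⟨hi, hj⟩ | ⟨hi, hj⟩ | ⟨hi, hj⟩ | ⟨hi, hj⟩ | ⟨hi, hj⟩ | ⟨hi, hj⟩ | ⟨hi, hj⟩
      · exact (hX0 (hzero X hX hΘX hXΘ hXc hi hj)).elim
      · exact (hnotboth X hX hΘX hXΘ hXc X₀ hX₀ hΘX₀ hX₀Θ hX₀c (by omega)).elim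
      · exact (hnotboth X hX hΘX hXΘ hXc X₀ hX₀ hΘX₀ hX₀Θ hX₀c (by omega)).elim
      · exact (hnotboth X hX hΘX hXΘ hXc X₀ hX₀ hΘX₀ hX₀Θ hX₀c (by omega)).elim
      · exact (hnotboth X hX hΘX hXΘ hXc X₀ hX₀ hΘX₀ hX₀Θ hX₀c (by omega)).elim
      · exact ⟨hi, hj⟩
      · exact (hnotboth X₀ hX₀ hΘX₀ hX₀Θ hX₀c X hX hΘX hXΘ hXc (by omega)).elim
      · exact (hnotboth X₀ hX₀ hΘX₀ hX₀Θ hX₀c X hX hΘX hXΘ hXc (by omega)).elim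
      · exact (hnotboth X₀ hX₀ hΘX₀ hX₀Θ hX₀c X hX hΘX hXΘ hXc (by omega)).elim
      · exact (hnotboth X₀ hX₀ hΘX₀ hX₀Θ hX₀c X hX hΘX hXΘ hXc (by omega)).elim
      · exact (hnotboth X₀ hX₀ hΘX₀ hX₀Θ hX₀c X hX hΘX hXΘ hXc (by omega)).elim
      · exact (hnotboth X₀ hX₀ hΘX₀ hX₀Θ hX₀c X hX hΘX hXΘ hXc (by omega)).elim
      · exact (hnotboth X₀ hX₀ hΘX₀ hX₀Θ hX₀c X hX hΘX hXΘ hXc (by omega)).elim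
    obtain ⟨hymem, hιpy, hyιp, hyrk⟩ := UnitaryLeviSetup.restrict_mem hcp hLp hιpapply X₀ hX₀ hΘX₀ hX₀Θ hX₀c
    have hSp : ∀ A ∈ Lp, ιp * A = A → A * ιp = -A →
        Module.finrank ℂ (LinearMap.range A) = 0 ∨ Module.finrank ℂ (LinearMap.range A) = 6 := by
      intro A hA hιA hAι
      by_cases hA0 : A = 0
      · left; rw [hA0, LinearMap.range_zero, finrank_bot]
      · obtain ⟨XA, hXA, hΘXA, hXAΘ, hXAc, hXAUp⟩ :=
          UnitaryLeviSetup.exists_lift hbr hΘ hΘΘ hcp hιΘ hLp hιpapply A hA hιA hAι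
        have hXA0 : XA ≠ 0 := fun h0 => hA0 (LinearMap.range_eq_bot.1 (Submodule.finrank_eq_zero.1
          (by rw [← hXAUp, h0, Submodule.map_zero, finrank_bot])))
        right; rw [← hXAUp]; exact (hprofc XA hXA hΘXA hXAΘ hXAc hXA0).1
    exact UnitaryThirtyFiveThirtyEight.subSeventeenEighteen_rank6 hbrLp hirrLp hιpmem hιpιp hPp hQp (by omega) (by omega)
      (s := fun v w : Up => s (v : W) w) (hsU Up) (hsmU Up) (fun v w => hsymm v w) hPpQp hdefPp hdefQp hadjLp hSp
      hymem hιpy hyιp (by rw [hyrk, h0i])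
  · -- constant profile `(8, 10)`
    have hprofc : ∀ X ∈ 𝔊, Θ * X = X → X * Θ = -X → X * ι = ι * X → X ≠ 0 →
        Module.finrank ℂ (Up.map X) = 8 ∧ Module.finrank ℂ (Um.map X) = 10 := by
      intro X hX hΘX hXΘ hXc hX0
      rcases hprof X hX hΘX hXΘ hXc with ⟨hi, hj⟩ | ⟨hi, hj⟩ | ⟨hi, hj⟩ | ⟨hi, hj⟩ | ⟨hi, hj⟩ | ⟨hi, hj⟩ | ⟨hi, hj⟩ | ⟨hi, hj⟩ | ⟨hi, hj⟩ | ⟨hi, hj⟩ | ⟨hi, hj⟩ | ⟨hi, hj⟩ | ⟨hi, hj⟩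
      · exact (hX0 (hzero X hX hΘX hXΘ hXc hi hj)).elim
      · exact (hnotboth X hX hΘX hXΘ hXc X₀ hX₀ hΘX₀ hX₀Θ hX₀c (by omega)).elim
      · exact (hnotboth X hX hΘX hXΘ hXc X₀ hX₀ hΘX₀ hX₀Θ hX₀c (by omega)).elim
      · exact (hnotboth X hX hΘX hXΘ hXc X₀ hX₀ hΘX₀ hX₀Θ hX₀c (by omega)).elim
      · exact (hnotboth X hX hΘX hXΘ hXc X₀ hX₀ hΘX₀ hX₀Θ hX₀c (by omega)).elim
      · exact (hnotboth X hX hΘX hXΘ hXc X₀ hX₀ hΘX₀ hX₀Θ hX₀c (by omega)).elim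
      · exact ⟨hi, hj⟩
      · exact (hnotboth X₀ hX₀ hΘX₀ hX₀Θ hX₀c X hX hΘX hXΘ hXc (by omega)).elim
      · exact (hnotboth X₀ hX₀ hΘX₀ hX₀Θ hX₀c X hX hΘX hXΘ hXc (by omega)).elim
      · exact (hnotboth X₀ hX₀ hΘX₀ hX₀Θ hX₀c X hX hΘX hXΘ hXc (by omega)).elim
      · exact (hnotboth X₀ hX₀ hΘX₀ hX₀Θ hX₀c X hX hΘX hXΘ hXc (by omega)).elim
      · exact (hnotboth X₀ hX₀ hΘX₀ hX₀Θ hX₀c X hX hΘX hXΘ hXc (by omega)).elim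
      · exact (hnotboth X₀ hX₀ hΘX₀ hX₀Θ hX₀c X hX hΘX hXΘ hXc (by omega)).elim
    obtain ⟨hymem, hιpy, hyιp, hyrk⟩ := UnitaryLeviSetup.restrict_mem hcp hLp hιpapply X₀ hX₀ hΘX₀ hX₀Θ hX₀c
    have hSp : ∀ A ∈ Lp, ιp * A = A → A * ιp = -A →
        Module.finrank ℂ (LinearMap.range A) = 0 ∨ Module.finrank ℂ (LinearMap.range A) = 8 := by
      intro A hA hιA hAι
      by_cases hA0 : A = 0
      · left; rw [hA0, LinearMap.range_zero, finrank_bot]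
      · obtain ⟨XA, hXA, hΘXA, hXAΘ, hXAc, hXAUp⟩ :=
          UnitaryLeviSetup.exists_lift hbr hΘ hΘΘ hcp hιΘ hLp hιpapply A hA hιA hAι
        have hXA0 : XA ≠ 0 := fun h0 => hA0 (LinearMap.range_eq_bot.1 (Submodule.finrank_eq_zero.1
          (by rw [← hXAUp, h0, Submodule.map_zero, finrank_bot])))
        right; rw [← hXAUp]; exact (hprofc XA hXA hΘXA hXAΘ hXAc hXA0).1
    exact UnitaryThirtyFiveThirtyEight.subSeventeenEighteen_rank8 hbrLp hirrLp hιpmem hιpιp hPp hQp (by omega) (by omega)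
      (s := fun v w : Up => s (v : W) w) (hsU Up) (hsmU Up) (fun v w => hsymm v w) hPpQp hdefPp hdefQp hadjLp hSp
      hymem hιpy hyιp (by rw [hyrk, h0i])
  · -- constant profile `(9, 9)`
    have hprofc : ∀ X ∈ 𝔊, Θ * X = X → X * Θ = -X → X * ι = ι * X → X ≠ 0 →
        Module.finrank ℂ (Up.map X) = 9 ∧ Module.finrank ℂ (Um.map X) = 9 := by
      intro X hX hΘX hXΘ hXc hX0
      rcases hprof X hX hΘX hXΘ hXc with ⟨hi, hj⟩ | ⟨hi, hj⟩ | ⟨hi, hj⟩ | ⟨hi, hj⟩ | ⟨hi, hj⟩ | ⟨hi, hj⟩ | ⟨hi, hj⟩ | ⟨hi, hj⟩ | ⟨hi, hj⟩ | ⟨hi, hj⟩ | ⟨hi, hj⟩ | ⟨hi, hj⟩ | ⟨hi, hj⟩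
      · exact (hX0 (hzero X hX hΘX hXΘ hXc hi hj)).elim
      · exact (hnotboth X hX hΘX hXΘ hXc X₀ hX₀ hΘX₀ hX₀Θ hX₀c (by omega)).elim
      · exact (hnotboth X hX hΘX hXΘ hXc X₀ hX₀ hΘX₀ hX₀Θ hX₀c (by omega)).elim
      · exact (hnotboth X hX hΘX hXΘ hXc X₀ hX₀ hΘX₀ hX₀Θ hX₀c (by omega)).elim
      · exact (hnotboth X hX hΘX hXΘ hXc X₀ hX₀ hΘX₀ hX₀Θ hX₀c (by omega)).elim
      · exact (hnotboth X hX hΘX hXΘ hXc X₀ hX₀ hΘX₀ hX₀Θ hX₀c (by omega)).elim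
      · exact (hnotboth X hX hΘX hXΘ hXc X₀ hX₀ hΘX₀ hX₀Θ hX₀c (by omega)).elim
      · exact ⟨hi, hj⟩
      · exact (hnotboth X₀ hX₀ hΘX₀ hX₀Θ hX₀c X hX hΘX hXΘ hXc (by omega)).elim
      · exact (hnotboth X₀ hX₀ hΘX₀ hX₀Θ hX₀c X hX hΘX hXΘ hXc (by omega)).elim
      · exact (hnotboth X₀ hX₀ hΘX₀ hX₀Θ hX₀c X hX hΘX hXΘ hXc (by omega)).elim
      · exact (hnotboth X₀ hX₀ hΘX₀ hX₀Θ hX₀c X hX hΘX hXΘ hXc (by omega)).elim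
      · exact (hnotboth X₀ hX₀ hΘX₀ hX₀Θ hX₀c X hX hΘX hXΘ hXc (by omega)).elim
    obtain ⟨hymem, hιpy, hyιp, hyrk⟩ := UnitaryLeviSetup.restrict_mem hcp hLp hιpapply X₀ hX₀ hΘX₀ hX₀Θ hX₀c
    have hSp : ∀ A ∈ Lp, ιp * A = A → A * ιp = -A →
        Module.finrank ℂ (LinearMap.range A) = 0 ∨ Module.finrank ℂ (LinearMap.range A) = 9 := by
      intro A hA hιA hAι
      by_cases hA0 : A = 0
      · left; rw [hA0, LinearMap.range_zero, finrank_bot]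
      · obtain ⟨XA, hXA, hΘXA, hXAΘ, hXAc, hXAUp⟩ :=
          UnitaryLeviSetup.exists_lift hbr hΘ hΘΘ hcp hιΘ hLp hιpapply A hA hιA hAι
        have hXA0 : XA ≠ 0 := fun h0 => hA0 (LinearMap.range_eq_bot.1 (Submodule.finrank_eq_zero.1
          (by rw [← hXAUp, h0, Submodule.map_zero, finrank_bot])))
        right; rw [← hXAUp]; exact (hprofc XA hXA hΘXA hXAΘ hXAc hXA0).1
    exact UnitaryThirtyFiveThirtySix.subSeventeenEighteen_rank9 hbrLp hirrLp hιpmem hιpιp hPp hQp (by omega) (by omega)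
      (s := fun v w : Up => s (v : W) w) (hsU Up) (hsmU Up) (fun v w => hsymm v w) hPpQp hdefPp hdefQp hadjLp hSp
      hymem hιpy hyιp (by rw [hyrk, h0i])
  · -- constant profile `(10, 8)`
    have hprofc : ∀ X ∈ 𝔊, Θ * X = X → X * Θ = -X → X * ι = ι * X → X ≠ 0 →
        Module.finrank ℂ (Up.map X) = 10 ∧ Module.finrank ℂ (Um.map X) = 8 := by
      intro X hX hΘX hXΘ hXc hX0
      rcases hprof X hX hΘX hXΘ hXc with ⟨hi, hj⟩ | ⟨hi, hj⟩ | ⟨hi, hj⟩ | ⟨hi, hj⟩ | ⟨hi, hj⟩ | ⟨hi, hj⟩ | ⟨hi, hj⟩ | ⟨hi, hj⟩ | ⟨hi, hj⟩ | ⟨hi, hj⟩ | ⟨hi, hj⟩ | ⟨hi, hj⟩ | ⟨hi, hj⟩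
      · exact (hX0 (hzero X hX hΘX hXΘ hXc hi hj)).elim
      · exact (hnotboth X hX hΘX hXΘ hXc X₀ hX₀ hΘX₀ hX₀Θ hX₀c (by omega)).elim
      · exact (hnotboth X hX hΘX hXΘ hXc X₀ hX₀ hΘX₀ hX₀Θ hX₀c (by omega)).elim
      · exact (hnotboth X hX hΘX hXΘ hXc X₀ hX₀ hΘX₀ hX₀Θ hX₀c (by omega)).elim
      · exact (hnotboth X hX hΘX hXΘ hXc X₀ hX₀ hΘX₀ hX₀Θ hX₀c (by omega)).elim
      · exact (hnotboth X hX hΘX hXΘ hXc X₀ hX₀ hΘX₀ hX₀Θ hX₀c (by omega)).elim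
      · exact (hnotboth X hX hΘX hXΘ hXc X₀ hX₀ hΘX₀ hX₀Θ hX₀c (by omega)).elim
      · exact (hnotboth X hX hΘX hXΘ hXc X₀ hX₀ hΘX₀ hX₀Θ hX₀c (by omega)).elim
      · exact ⟨hi, hj⟩
      · exact (hnotboth X₀ hX₀ hΘX₀ hX₀Θ hX₀c X hX hΘX hXΘ hXc (by omega)).elim
      · exact (hnotboth X₀ hX₀ hΘX₀ hX₀Θ hX₀c X hX hΘX hXΘ hXc (by omega)).elim
      · exact (hnotboth X₀ hX₀ hΘX₀ hX₀Θ hX₀c X hX hΘX hXΘ hXc (by omega)).elim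
      · exact (hnotboth X₀ hX₀ hΘX₀ hX₀Θ hX₀c X hX hΘX hXΘ hXc (by omega)).elim
    obtain ⟨hymem, hιpy, hyιp, hyrk⟩ := UnitaryLeviSetup.restrict_mem hcp hLp hιpapply X₀ hX₀ hΘX₀ hX₀Θ hX₀c
    have hSp : ∀ A ∈ Lp, ιp * A = A → A * ιp = -A →
        Module.finrank ℂ (LinearMap.range A) = 0 ∨ Module.finrank ℂ (LinearMap.range A) = 10 := by
      intro A hA hιA hAι
      by_cases hA0 : A = 0
      · left; rw [hA0, LinearMap.range_zero, finrank_bot]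
      · obtain ⟨XA, hXA, hΘXA, hXAΘ, hXAc, hXAUp⟩ :=
          UnitaryLeviSetup.exists_lift hbr hΘ hΘΘ hcp hιΘ hLp hιpapply A hA hιA hAι
        have hXA0 : XA ≠ 0 := fun h0 => hA0 (LinearMap.range_eq_bot.1 (Submodule.finrank_eq_zero.1
          (by rw [← hXAUp, h0, Submodule.map_zero, finrank_bot])))
        right; rw [← hXAUp]; exact (hprofc XA hXA hΘXA hXAΘ hXAc hXA0).1
    exact UnitaryThirtyFiveThirtyEight.subSeventeenEighteen_rank10 hbrLp hirrLp hιpmem hιpιp hPp hQp (by omega) (by omega)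
      (s := fun v w : Up => s (v : W) w) (hsU Up) (hsmU Up) (fun v w => hsymm v w) hPpQp hdefPp hdefQp hadjLp hSp
      hymem hιpy hyιp (by rw [hyrk, h0i])
  · -- constant profile `(12, 6)`
    have hprofc : ∀ X ∈ 𝔊, Θ * X = X → X * Θ = -X → X * ι = ι * X → X ≠ 0 →
        Module.finrank ℂ (Up.map X) = 12 ∧ Module.finrank ℂ (Um.map X) = 6 := by
      intro X hX hΘX hXΘ hXc hX0
      rcases hprof X hX hΘX hXΘ hXc with ⟨hi, hj⟩ | ⟨hi, hj⟩ | ⟨hi, hj⟩ | ⟨hi, hj⟩ | ⟨hi, hj⟩ | ⟨hi, hj⟩ | ⟨hi, hj⟩ | ⟨hi, hj⟩ | ⟨hi, hj⟩ | ⟨hi, hj⟩ | ⟨hi, hj⟩ | ⟨hi, hj⟩ | ⟨hi, hj⟩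
      · exact (hX0 (hzero X hX hΘX hXΘ hXc hi hj)).elim
      · exact (hnotboth X hX hΘX hXΘ hXc X₀ hX₀ hΘX₀ hX₀Θ hX₀c (by omega)).elim
      · exact (hnotboth X hX hΘX hXΘ hXc X₀ hX₀ hΘX₀ hX₀Θ hX₀c (by omega)).elim
      · exact (hnotboth X hX hΘX hXΘ hXc X₀ hX₀ hΘX₀ hX₀Θ hX₀c (by omega)).elim
      · exact (hnotboth X hX hΘX hXΘ hXc X₀ hX₀ hΘX₀ hX₀Θ hX₀c (by omega)).elim
      · exact (hnotboth X hX hΘX hXΘ hXc X₀ hX₀ hΘX₀ hX₀Θ hX₀c (by omega)).elim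
      · exact (hnotboth X hX hΘX hXΘ hXc X₀ hX₀ hΘX₀ hX₀Θ hX₀c (by omega)).elim
      · exact (hnotboth X hX hΘX hXΘ hXc X₀ hX₀ hΘX₀ hX₀Θ hX₀c (by omega)).elim
      · exact (hnotboth X hX hΘX hXΘ hXc X₀ hX₀ hΘX₀ hX₀Θ hX₀c (by omega)).elim
      · exact ⟨hi, hj⟩
      · exact (hnotboth X₀ hX₀ hΘX₀ hX₀Θ hX₀c X hX hΘX hXΘ hXc (by omega)).elim
      · exact (hnotboth X₀ hX₀ hΘX₀ hX₀Θ hX₀c X hX hΘX hXΘ hXc (by omega)).elim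
      · exact (hnotboth X₀ hX₀ hΘX₀ hX₀Θ hX₀c X hX hΘX hXΘ hXc (by omega)).elim
    have hnum0 : Module.finrank ℂ QU ≤ (fun t : ℕ => (max (18 - 12 * t) (12 - 6 * t))) 0 := by beta_reduce; omega
    have hnum1 : (fun t : ℕ => (min (6 * t) 6)) 0 = 0 := by beta_reduce; omega
    have hnum2 : ∀ t : ℕ, (fun t : ℕ => (max (18 - 12 * t) (12 - 6 * t))) t ≤ (fun t : ℕ => (max (18 - 12 * t) (12 - 6 * t))) (t + 1) + (Module.finrank ℂ PU - (t + 1) * 5) := by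
      intro t; beta_reduce; omega
    have hnum3 : ∀ t : ℕ, (fun t : ℕ => (min (6 * t) 6)) t + (fun t : ℕ => (max (18 - 12 * t) (12 - 6 * t))) (t + 1) ≤ (fun t : ℕ => (min (6 * t) 6)) (t + 1) := by
      intro t; beta_reduce; omega
    have hnum4 : ∀ t : ℕ, (fun t : ℕ => (min (6 * t) 6)) t < Module.finrank ℂ ↥(Q ⊓ LinearMap.ker B) := by
      intro t; beta_reduce; omega
    exact UnitaryOrthogonalChain.false_of_constProfile_pos hbr hΘΘ hP hQ hadd hsmul hsymm hPQ hdefP hdefQ hadj hB hΘB hBΘ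
      hmin' hιι hιΘ hιs hUm hUp hPM hQM hPU hQU hfinQU' (i := 12) (j := 6) (c := 5) hprofc (by omega) (by omega)
      (by omega) (fun t : ℕ => (max (18 - 12 * t) (12 - 6 * t))) (fun t : ℕ => (min (6 * t) 6)) hnum0 hnum1 hnum2 hnum3 hnum4 hjoint
  · -- constant profile `(14, 4)`
    have hprofc : ∀ X ∈ 𝔊, Θ * X = X → X * Θ = -X → X * ι = ι * X → X ≠ 0 →
        Module.finrank ℂ (Up.map X) = 14 ∧ Module.finrank ℂ (Um.map X) = 4 := by
      intro X hX hΘX hXΘ hXc hX0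
      rcases hprof X hX hΘX hXΘ hXc with ⟨hi, hj⟩ | ⟨hi, hj⟩ | ⟨hi, hj⟩ | ⟨hi, hj⟩ | ⟨hi, hj⟩ | ⟨hi, hj⟩ | ⟨hi, hj⟩ | ⟨hi, hj⟩ | ⟨hi, hj⟩ | ⟨hi, hj⟩ | ⟨hi, hj⟩ | ⟨hi, hj⟩ | ⟨hi, hj⟩
      · exact (hX0 (hzero X hX hΘX hXΘ hXc hi hj)).elim
      · exact (hnotboth X hX hΘX hXΘ hXc X₀ hX₀ hΘX₀ hX₀Θ hX₀c (by omega)).elim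
      · exact (hnotboth X hX hΘX hXΘ hXc X₀ hX₀ hΘX₀ hX₀Θ hX₀c (by omega)).elim
      · exact (hnotboth X hX hΘX hXΘ hXc X₀ hX₀ hΘX₀ hX₀Θ hX₀c (by omega)).elim
      · exact (hnotboth X hX hΘX hXΘ hXc X₀ hX₀ hΘX₀ hX₀Θ hX₀c (by omega)).elim
      · exact (hnotboth X hX hΘX hXΘ hXc X₀ hX₀ hΘX₀ hX₀Θ hX₀c (by omega)).elim
      · exact (hnotboth X hX hΘX hXΘ hXc X₀ hX₀ hΘX₀ hX₀Θ hX₀c (by omega)).elim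
      · exact (hnotboth X hX hΘX hXΘ hXc X₀ hX₀ hΘX₀ hX₀Θ hX₀c (by omega)).elim
      · exact (hnotboth X hX hΘX hXΘ hXc X₀ hX₀ hΘX₀ hX₀Θ hX₀c (by omega)).elim
      · exact (hnotboth X hX hΘX hXΘ hXc X₀ hX₀ hΘX₀ hX₀Θ hX₀c (by omega)).elim
      · exact ⟨hi, hj⟩
      · exact (hnotboth X₀ hX₀ hΘX₀ hX₀Θ hX₀c X hX hΘX hXΘ hXc (by omega)).elim
      · exact (hnotboth X₀ hX₀ hΘX₀ hX₀Θ hX₀c X hX hΘX hXΘ hXc (by omega)).elim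
    have hnum0 : Module.finrank ℂ QU ≤ (fun t : ℕ => (max (18 - 14 * t) (8 - 4 * t))) 0 := by beta_reduce; omega
    have hnum1 : (fun t : ℕ => (min (4 * t) 4)) 0 = 0 := by beta_reduce; omega
    have hnum2 : ∀ t : ℕ, (fun t : ℕ => (max (18 - 14 * t) (8 - 4 * t))) t ≤ (fun t : ℕ => (max (18 - 14 * t) (8 - 4 * t))) (t + 1) + (Module.finrank ℂ PU - (t + 1) * 3) := by
      intro t; beta_reduce; omega
    have hnum3 : ∀ t : ℕ, (fun t : ℕ => (min (4 * t) 4)) t + (fun t : ℕ => (max (18 - 14 * t) (8 - 4 * t))) (t + 1) ≤ (fun t : ℕ => (min (4 * t) 4)) (t + 1) := by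
      intro t; beta_reduce; omega
    have hnum4 : ∀ t : ℕ, (fun t : ℕ => (min (4 * t) 4)) t < Module.finrank ℂ ↥(Q ⊓ LinearMap.ker B) := by
      intro t; beta_reduce; omega
    exact UnitaryOrthogonalChain.false_of_constProfile_pos hbr hΘΘ hP hQ hadd hsmul hsymm hPQ hdefP hdefQ hadj hB hΘB hBΘ
      hmin' hιι hιΘ hιs hUm hUp hPM hQM hPU hQU hfinQU' (i := 14) (j := 4) (c := 3) hprofc (by omega) (by omega)
      (by omega) (fun t : ℕ => (max (18 - 14 * t) (8 - 4 * t))) (fun t : ℕ => (min (4 * t) 4)) hnum0 hnum1 hnum2 hnum3 hnum4 hjoint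
  · -- constant profile `(15, 3)`
    have hprofc : ∀ X ∈ 𝔊, Θ * X = X → X * Θ = -X → X * ι = ι * X → X ≠ 0 →
        Module.finrank ℂ (Up.map X) = 15 ∧ Module.finrank ℂ (Um.map X) = 3 := by
      intro X hX hΘX hXΘ hXc hX0
      rcases hprof X hX hΘX hXΘ hXc with ⟨hi, hj⟩ | ⟨hi, hj⟩ | ⟨hi, hj⟩ | ⟨hi, hj⟩ | ⟨hi, hj⟩ | ⟨hi, hj⟩ | ⟨hi, hj⟩ | ⟨hi, hj⟩ | ⟨hi, hj⟩ | ⟨hi, hj⟩ | ⟨hi, hj⟩ | ⟨hi, hj⟩ | ⟨hi, hj⟩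
      · exact (hX0 (hzero X hX hΘX hXΘ hXc hi hj)).elim
      · exact (hnotboth X hX hΘX hXΘ hXc X₀ hX₀ hΘX₀ hX₀Θ hX₀c (by omega)).elim
      · exact (hnotboth X hX hΘX hXΘ hXc X₀ hX₀ hΘX₀ hX₀Θ hX₀c (by omega)).elim
      · exact (hnotboth X hX hΘX hXΘ hXc X₀ hX₀ hΘX₀ hX₀Θ hX₀c (by omega)).elim
      · exact (hnotboth X hX hΘX hXΘ hXc X₀ hX₀ hΘX₀ hX₀Θ hX₀c (by omega)).elim
      · exact (hnotboth X hX hΘX hXΘ hXc X₀ hX₀ hΘX₀ hX₀Θ hX₀c (by omega)).elim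
      · exact (hnotboth X hX hΘX hXΘ hXc X₀ hX₀ hΘX₀ hX₀Θ hX₀c (by omega)).elim
      · exact (hnotboth X hX hΘX hXΘ hXc X₀ hX₀ hΘX₀ hX₀Θ hX₀c (by omega)).elim
      · exact (hnotboth X hX hΘX hXΘ hXc X₀ hX₀ hΘX₀ hX₀Θ hX₀c (by omega)).elim
      · exact (hnotboth X hX hΘX hXΘ hXc X₀ hX₀ hΘX₀ hX₀Θ hX₀c (by omega)).elim
      · exact (hnotboth X hX hΘX hXΘ hXc X₀ hX₀ hΘX₀ hX₀Θ hX₀c (by omega)).elim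
      · exact ⟨hi, hj⟩
      · exact (hnotboth X₀ hX₀ hΘX₀ hX₀Θ hX₀c X hX hΘX hXΘ hXc (by omega)).elim
    have hnum0 : Module.finrank ℂ QU ≤ (fun t : ℕ => (max (18 - 15 * t) (6 - 3 * t))) 0 := by beta_reduce; omega
    have hnum1 : (fun t : ℕ => (min (3 * t) 3)) 0 = 0 := by beta_reduce; omega
    have hnum2 : ∀ t : ℕ, (fun t : ℕ => (max (18 - 15 * t) (6 - 3 * t))) t ≤ (fun t : ℕ => (max (18 - 15 * t) (6 - 3 * t))) (t + 1) + (Module.finrank ℂ PU - (t + 1) * 2) := by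
      intro t; beta_reduce; omega
    have hnum3 : ∀ t : ℕ, (fun t : ℕ => (min (3 * t) 3)) t + (fun t : ℕ => (max (18 - 15 * t) (6 - 3 * t))) (t + 1) ≤ (fun t : ℕ => (min (3 * t) 3)) (t + 1) := by
      intro t; beta_reduce; omega
    have hnum4 : ∀ t : ℕ, (fun t : ℕ => (min (3 * t) 3)) t < Module.finrank ℂ ↥(Q ⊓ LinearMap.ker B) := by
      intro t; beta_reduce; omega
    exact UnitaryOrthogonalChain.false_of_constProfile_pos hbr hΘΘ hP hQ hadd hsmul hsymm hPQ hdefP hdefQ hadj hB hΘB hBΘ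
      hmin' hιι hιΘ hιs hUm hUp hPM hQM hPU hQU hfinQU' (i := 15) (j := 3) (c := 2) hprofc (by omega) (by omega)
      (by omega) (fun t : ℕ => (max (18 - 15 * t) (6 - 3 * t))) (fun t : ℕ => (min (3 * t) 3)) hnum0 hnum1 hnum2 hnum3 hnum4 hjoint
  · -- constant profile `(16, 2)`
    have hprofc : ∀ X ∈ 𝔊, Θ * X = X → X * Θ = -X → X * ι = ι * X → X ≠ 0 →
        Module.finrank ℂ (Up.map X) = 16 ∧ Module.finrank ℂ (Um.map X) = 2 := by
      intro X hX hΘX hXΘ hXc hX0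
      rcases hprof X hX hΘX hXΘ hXc with ⟨hi, hj⟩ | ⟨hi, hj⟩ | ⟨hi, hj⟩ | ⟨hi, hj⟩ | ⟨hi, hj⟩ | ⟨hi, hj⟩ | ⟨hi, hj⟩ | ⟨hi, hj⟩ | ⟨hi, hj⟩ | ⟨hi, hj⟩ | ⟨hi, hj⟩ | ⟨hi, hj⟩ | ⟨hi, hj⟩
      · exact (hX0 (hzero X hX hΘX hXΘ hXc hi hj)).elim
      · exact (hnotboth X hX hΘX hXΘ hXc X₀ hX₀ hΘX₀ hX₀Θ hX₀c (by omega)).elim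
      · exact (hnotboth X hX hΘX hXΘ hXc X₀ hX₀ hΘX₀ hX₀Θ hX₀c (by omega)).elim
      · exact (hnotboth X hX hΘX hXΘ hXc X₀ hX₀ hΘX₀ hX₀Θ hX₀c (by omega)).elim
      · exact (hnotboth X hX hΘX hXΘ hXc X₀ hX₀ hΘX₀ hX₀Θ hX₀c (by omega)).elim
      · exact (hnotboth X hX hΘX hXΘ hXc X₀ hX₀ hΘX₀ hX₀Θ hX₀c (by omega)).elim
      · exact (hnotboth X hX hΘX hXΘ hXc X₀ hX₀ hΘX₀ hX₀Θ hX₀c (by omega)).elim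
      · exact (hnotboth X hX hΘX hXΘ hXc X₀ hX₀ hΘX₀ hX₀Θ hX₀c (by omega)).elim
      · exact (hnotboth X hX hΘX hXΘ hXc X₀ hX₀ hΘX₀ hX₀Θ hX₀c (by omega)).elim
      · exact (hnotboth X hX hΘX hXΘ hXc X₀ hX₀ hΘX₀ hX₀Θ hX₀c (by omega)).elim
      · exact (hnotboth X hX hΘX hXΘ hXc X₀ hX₀ hΘX₀ hX₀Θ hX₀c (by omega)).elim
      · exact (hnotboth X hX hΘX hXΘ hXc X₀ hX₀ hΘX₀ hX₀Θ hX₀c (by omega)).elim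
      · exact ⟨hi, hj⟩
    obtain ⟨A, hA, hιmA, hAιm, hAne, hA2⟩ :=
      UnitaryConstantRank.exists_raise_rank_ne_two hbrLm hirrLm hιmmem hιmιm hPm hQm (by omega) (by omega) (by omega)
        (s := fun v w : Um => s (v : W) w) (hsU Um) (fun v w => hsymm v w) hPmQm hdefPm hdefQm hadjLm
    obtain ⟨XA, hXA, hΘXA, hXAΘ, hXAc, hXAUm⟩ := UnitaryLeviSetup.exists_lift hbr hΘ hΘΘ hcm hιΘ hLm hιmapply A hA hιmA hAιm
    have hA0 : Module.finrank ℂ (LinearMap.range A) ≠ 0 := fun h =>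
      hAne (LinearMap.range_eq_bot.1 (Submodule.finrank_eq_zero.1 h))
    have hXA0 : XA ≠ 0 := fun h0 => hA0 (by rw [← hXAUm, h0, Submodule.map_zero, finrank_bot])
    have hpA := hprofc XA hXA hΘXA hXAΘ hXAc hXA0
    rw [← hXAUm] at hA2
    omega

/-- `(35 | 48)`, minimal rank `19`: after the Levi kills every profile has `i = 0` (profiles [(0, 0)]), against the non-vanishing lemma. [cite: Ribet1983, Thm. 3] [cite: Gordon1997, Thm. 6.3 (3)]
[cite: Deligne1982HodgeCycles, I §3 Prop. 3.4, 3.6] [cite: GoodmanWallachGTM255, §4.1.1] -/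
theorem UnitaryThirtyFiveFortyEight.no_minRank_19 [FiniteDimensional ℂ W] {𝔊 : Submodule ℂ (Module.End ℂ W)}
    (hbr : ∀ Y ∈ 𝔊, ∀ Z ∈ 𝔊, Y * Z - Z * Y ∈ 𝔊)
    (hirr : ∀ U : Submodule ℂ W, (∀ A ∈ 𝔊, ∀ u ∈ U, A u ∈ U) → U = ⊥ ∨ U = ⊤)
    {Θ : Module.End ℂ W} (hΘ : Θ ∈ 𝔊) (hΘΘ : Θ * Θ = 1)
    {P Q : Submodule ℂ W} (hP : ∀ x, x ∈ P ↔ Θ x = x) (hQ : ∀ x, x ∈ Q ↔ Θ x = -x)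
    (hP35 : Module.finrank ℂ P = 35) (hQ48 : Module.finrank ℂ Q = 48)
    {s : W → W → ℂ} (hadd : ∀ x y z, s (x + y) z = s x z + s y z)
    (hsmul : ∀ (c : ℂ) (x y : W), s (c • x) y = c * s x y) (hsymm : ∀ x y, s y x = starRingEnd ℂ (s x y))
    (hPQ : ∀ p ∈ P, ∀ q ∈ Q, s p q = 0) (hdefP : ∀ p ∈ P, s p p = 0 → p = 0) (hdefQ : ∀ q ∈ Q, s q q = 0 → q = 0)
    (hadj : ∀ X ∈ 𝔊, ∃ Y ∈ 𝔊, ∀ x y, s (X x) y = s x (Y y))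
    (hS : ∀ B' ∈ 𝔊, Θ * B' = B' → B' * Θ = -B' →
      Module.finrank ℂ (LinearMap.range B') = 0 ∨ Module.finrank ℂ (LinearMap.range B') = 19 ∨ Module.finrank ℂ (LinearMap.range B') = 20 ∨ Module.finrank ℂ (LinearMap.range B') = 21 ∨ Module.finrank ℂ (LinearMap.range B') = 22 ∨ Module.finrank ℂ (LinearMap.range B') = 23 ∨ Module.finrank ℂ (LinearMap.range B') = 24 ∨ Module.finrank ℂ (LinearMap.range B') = 25 ∨ Module.finrank ℂ (LinearMap.range B') = 26 ∨ Module.finrank ℂ (LinearMap.range B') = 27 ∨ Module.finrank ℂ (LinearMap.range B') = 28 ∨ Module.finrank ℂ (LinearMap.range B') = 29 ∨ Module.finrank ℂ (LinearMap.range B') = 30 ∨ Module.finrank ℂ (LinearMap.range B') = 31 ∨ Module.finrank ℂ (LinearMap.range B') = 32 ∨ Module.finrank ℂ (LinearMap.range B') = 33 ∨ Module.finrank ℂ (LinearMap.range B') = 34)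
    {B : Module.End ℂ W} (hB : B ∈ 𝔊) (hΘB : Θ * B = B) (hBΘ : B * Θ = -B)
    (hr : Module.finrank ℂ (LinearMap.range B) = 19) : False := by
  classical
  have hsU : ∀ U : Submodule ℂ W, ∀ x y z : U, s ((x + y : U) : W) z = s (x : W) z + s (y : W) z :=
    fun U x y z => by simp only [Submodule.coe_add, hadd]
  have hsmU : ∀ U : Submodule ℂ W, ∀ (c : ℂ) (x y : U), s ((c • x : U) : W) y = c * s (x : W) y :=
    fun U c x y => by simp only [Submodule.coe_smul, hsmul]
  have hno1 : ∀ B' ∈ 𝔊, Θ * B' = B' → B' * Θ = -B' → Module.finrank ℂ (LinearMap.range B') ≠ 1 := by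
    intro B' hB' hΘB' hB'Θ h1
    rcases hS B' hB' hΘB' hB'Θ with h | h | h | h | h | h | h | h | h | h | h | h | h | h | h | h | h <;> omega
  have hmin : ∀ Y ∈ 𝔊, Θ * Y = Y → Y * Θ = -Y → Y ≠ 0 → 19 ≤ Module.finrank ℂ (LinearMap.range Y) := by
    intro Y hY hΘY hYΘ hY0
    have h0 : Module.finrank ℂ (LinearMap.range Y) ≠ 0 := fun h =>
      hY0 (LinearMap.range_eq_bot.1 (Submodule.finrank_eq_zero.1 h))
    rcases hS Y hY hΘY hYΘ with h | h | h | h | h | h | h | h | h | h | h | h | h | h | h | h | h <;> omega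
  have hmin' : ∀ Z ∈ 𝔊, Θ * Z = Z → Z * Θ = -Z → Z ≠ 0 → Module.finrank ℂ (LinearMap.range B) ≤ Module.finrank ℂ (LinearMap.range Z) := by
    rw [hr]; exact hmin
  obtain ⟨ι, Um, Up, PU, QU, Lm, ιm, Pm, Qm, Lp, ιp, Pp, Qp, hιmem, hιι, hιΘ, hιs, hUm, hUp, hfinUm, hfinUp,
    hPM, hQM, hPU, hQU, hrangeP, hPUP, hQUQ, hfinQM, hfinPU, hfinQU, hLm, hLp,
    hιmapply, hPmmem, hQmmem, hbrLm, hirrLm, hιmmem, hιmιm, hPm, hQm, hfinPm, hfinQm, hPmQm, hdefPm, hdefQm, hadjLm,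
    hιpapply, hPpmem, hQpmem, hbrLp, hirrLp, hιpmem, hιpιp, hPp, hQp, hfinPp, hfinQp, hPpQp, hdefPp, hdefQp, hadjLp,
    hsplit⟩ :=
    UnitaryLeviSetup.exists_levi_pair hbr hirr hΘ hΘΘ hP hQ hadd hsymm hPQ hdefP hdefQ hadj hB hΘB hBΘ
  have hdich : ∀ X ∈ 𝔊, Θ * X = X → X * Θ = -X → X * ι = ι * X →
      Module.finrank ℂ (Up.map X) + Module.finrank ℂ (Um.map X) ≤ Module.finrank ℂ (LinearMap.range B) ∨
        (19 ≤ Module.finrank ℂ (Up.map X) ∧ 19 ≤ Module.finrank ℂ (Um.map X)) := fun X hX hΘX hXΘ hXc =>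
    UnitaryLeviSetup.profile_dichotomy hbr hΘΘ hP hQ hadd hsymm hPQ hdefP hdefQ hadj hmin hB hΘB hBΘ hιι hιΘ hιs hUm hUp
      hPM hQM hQU hfinQU hrangeP hX hΘX hXΘ hXc
  have hfinQU' := hfinQU
  rw [hr] at hfinQM hfinPU hfinQU hfinPm hfinQm hfinPp hfinQp hsplit hdich
  rw [hQ48] at hfinQM hfinQm hfinUm
  rw [hP35] at hfinPU hfinPp hfinUp
  have hcm : ∀ Z : Module.End ℂ W, Z * ι = ι * Z → ∀ x ∈ Um, Z x ∈ Um := fun Z hZ x hx =>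
    (hUm _).2 (by rw [← Module.End.mul_apply, ← hZ, Module.End.mul_apply, (hUm x).1 hx, map_neg])
  have hcp : ∀ Z : Module.End ℂ W, Z * ι = ι * Z → ∀ x ∈ Up, Z x ∈ Up := fun Z hZ x hx =>
    (hUp _).2 (by rw [← Module.End.mul_apply, ← hZ, Module.End.mul_apply, (hUp x).1 hx])
  have hfullm_of : Lm = ⊤ → False := fun h =>
    UnitaryLeviSetup.false_of_full_larger hbr hΘΘ hno1 hιι hιΘ hUm hUp (by omega) (by omega) hPM hQM (by omega)
      (by omega) hLm h
  have hkillm3 : ∀ X ∈ 𝔊, Θ * X = X → X * Θ = -X → X * ι = ι * X → Module.finrank ℂ (Um.map X) ≠ 3 := by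
    intro X hX hΘX hXΘ hXc h3
    obtain ⟨hxmem, hιmx, hxιm, hxrk⟩ := UnitaryLeviSetup.restrict_mem hcm hLm hιmapply X hX hΘX hXΘ hXc
    rw [h3] at hxrk
    refine hfullm_of (UnitaryDoubleLevi.eq_top_of_raise_of_core hbrLm hirrLm hιmmem hιmιm hPm hQm
      (s := fun v w : Um => s (v : W) w) (hsU Um) (fun v w => hsymm v w) hPmQm hdefPm hdefQm hadjLm hxmem hιmx hxιm
      (by rw [hxrk]; omega) (by omega) (by omega)
      fun U' 𝔩' ι' P' Q' hbr𝔩' hirr𝔩' hι' hι'ι' hP' hQ' hfinP' hfinQ' hP'Q' hdefP' hdefQ' hadj𝔩' => ?_)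
    rw [hxrk] at hfinP' hfinQ'
    exact UnitaryThreeCoprime.eq_top hbr𝔩' hirr𝔩' hι' hι'ι' hP' hQ' hfinP' (by omega) (s := fun x y : U' => s ((x : Um) : W) y) (fun x y z => by simp only [Submodule.coe_add, hadd]) (fun x y => hsymm _ _) hP'Q' hdefP' hdefQ' hadj𝔩'
  have hkillm4 : ∀ X ∈ 𝔊, Θ * X = X → X * Θ = -X → X * ι = ι * X → Module.finrank ℂ (Um.map X) ≠ 4 := by
    intro X hX hΘX hXΘ hXc h4
    obtain ⟨hxmem, hιmx, hxιm, hxrk⟩ := UnitaryLeviSetup.restrict_mem hcm hLm hιmapply X hX hΘX hXΘ hXc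
    rw [h4] at hxrk
    refine hfullm_of (UnitaryDoubleLevi.eq_top_of_raise_of_core hbrLm hirrLm hιmmem hιmιm hPm hQm
      (s := fun v w : Um => s (v : W) w) (hsU Um) (fun v w => hsymm v w) hPmQm hdefPm hdefQm hadjLm hxmem hιmx hxιm
      (by rw [hxrk]; omega) (by omega) (by omega)
      fun U' 𝔩' ι' P' Q' hbr𝔩' hirr𝔩' hι' hι'ι' hP' hQ' hfinP' hfinQ' hP'Q' hdefP' hdefQ' hadj𝔩' => ?_)
    rw [hxrk] at hfinP' hfinQ'
    exact UnitaryFourOdd.eq_top hbr𝔩' hirr𝔩' hι' hι'ι' hP' hQ' hfinP' ⟨12, by omega⟩ (s := fun x y : U' => s ((x : Um) : W) y) (fun x y z => by simp only [Submodule.coe_add, hadd]) (fun x y => hsymm _ _) hP'Q' hdefP' hdefQ' hadj𝔩'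
  have hkillm5 : ∀ X ∈ 𝔊, Θ * X = X → X * Θ = -X → X * ι = ι * X → Module.finrank ℂ (Um.map X) ≠ 5 := by
    intro X hX hΘX hXΘ hXc h5
    obtain ⟨hxmem, hιmx, hxιm, hxrk⟩ := UnitaryLeviSetup.restrict_mem hcm hLm hιmapply X hX hΘX hXΘ hXc
    rw [h5] at hxrk
    refine hfullm_of (UnitaryDoubleLevi.eq_top_of_raise_of_core hbrLm hirrLm hιmmem hιmιm hPm hQm
      (s := fun v w : Um => s (v : W) w) (hsU Um) (fun v w => hsymm v w) hPmQm hdefPm hdefQm hadjLm hxmem hιmx hxιm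
      (by rw [hxrk]; omega) (by omega) (by omega)
      fun U' 𝔩' ι' P' Q' hbr𝔩' hirr𝔩' hι' hι'ι' hP' hQ' hfinP' hfinQ' hP'Q' hdefP' hdefQ' hadj𝔩' => ?_)
    rw [hxrk] at hfinP' hfinQ'
    exact UnitaryFive.eq_top_of_smul hbr𝔩' hirr𝔩' hι' hι'ι' hP' hQ' hfinP' (by omega) (s := fun x y : U' => s ((x : Um) : W) y) (fun x y z => by simp only [Submodule.coe_add, hadd]) (fun c x y => by simp only [Submodule.coe_smul, hsmul]) (fun x y => hsymm _ _) hP'Q' hdefP' hdefQ' hadj𝔩'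
  have hkillm6 : ∀ X ∈ 𝔊, Θ * X = X → X * Θ = -X → X * ι = ι * X → Module.finrank ℂ (Um.map X) ≠ 6 := by
    intro X hX hΘX hXΘ hXc h6
    obtain ⟨hxmem, hιmx, hxιm, hxrk⟩ := UnitaryLeviSetup.restrict_mem hcm hLm hιmapply X hX hΘX hXΘ hXc
    rw [h6] at hxrk
    refine hfullm_of (UnitaryDoubleLevi.eq_top_of_raise_of_core hbrLm hirrLm hιmmem hιmιm hPm hQm
      (s := fun v w : Um => s (v : W) w) (hsU Um) (fun v w => hsymm v w) hPmQm hdefPm hdefQm hadjLm hxmem hιmx hxιm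
      (by rw [hxrk]; omega) (by omega) (by omega)
      fun U' 𝔩' ι' P' Q' hbr𝔩' hirr𝔩' hι' hι'ι' hP' hQ' hfinP' hfinQ' hP'Q' hdefP' hdefQ' hadj𝔩' => ?_)
    rw [hxrk] at hfinP' hfinQ'
    exact UnitarySix.eq_top_of_smul hbr𝔩' hirr𝔩' hι' hι'ι' hP' hQ' hfinP' ⟨11, by omega⟩ (by omega) (s := fun x y : U' => s ((x : Um) : W) y) (fun x y z => by simp only [Submodule.coe_add, hadd]) (fun c x y => by simp only [Submodule.coe_smul, hsmul]) (fun x y => hsymm _ _) hP'Q' hdefP' hdefQ' hadj𝔩'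
  have hkillm7 : ∀ X ∈ 𝔊, Θ * X = X → X * Θ = -X → X * ι = ι * X → Module.finrank ℂ (Um.map X) ≠ 7 := by
    intro X hX hΘX hXΘ hXc h7
    obtain ⟨hxmem, hιmx, hxιm, hxrk⟩ := UnitaryLeviSetup.restrict_mem hcm hLm hιmapply X hX hΘX hXΘ hXc
    rw [h7] at hxrk
    refine hfullm_of (UnitaryDoubleLevi.eq_top_of_raise_of_core hbrLm hirrLm hιmmem hιmιm hPm hQm
      (s := fun v w : Um => s (v : W) w) (hsU Um) (fun v w => hsymm v w) hPmQm hdefPm hdefQm hadjLm hxmem hιmx hxιm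
      (by rw [hxrk]; omega) (by omega) (by omega)
      fun U' 𝔩' ι' P' Q' hbr𝔩' hirr𝔩' hι' hι'ι' hP' hQ' hfinP' hfinQ' hP'Q' hdefP' hdefQ' hadj𝔩' => ?_)
    rw [hxrk] at hfinP' hfinQ'
    exact UnitarySeven.eq_top_of_smul hbr𝔩' hirr𝔩' hι' hι'ι' hP' hQ' hfinP' (by omega) (s := fun x y : U' => s ((x : Um) : W) y) (fun x y z => by simp only [Submodule.coe_add, hadd]) (fun c x y => by simp only [Submodule.coe_smul, hsmul]) (fun x y => hsymm _ _) hP'Q' hdefP' hdefQ' hadj𝔩'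
  have hkillm8 : ∀ X ∈ 𝔊, Θ * X = X → X * Θ = -X → X * ι = ι * X → Module.finrank ℂ (Um.map X) ≠ 8 := by
    intro X hX hΘX hXΘ hXc h8
    obtain ⟨hxmem, hιmx, hxιm, hxrk⟩ := UnitaryLeviSetup.restrict_mem hcm hLm hιmapply X hX hΘX hXΘ hXc
    rw [h8] at hxrk
    refine hfullm_of (UnitaryDoubleLevi.eq_top_of_raise_of_core hbrLm hirrLm hιmmem hιmιm hPm hQm
      (s := fun v w : Um => s (v : W) w) (hsU Um) (fun v w => hsymm v w) hPmQm hdefPm hdefQm hadjLm hxmem hιmx hxιm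
      (by rw [hxrk]; omega) (by omega) (by omega)
      fun U' 𝔩' ι' P' Q' hbr𝔩' hirr𝔩' hι' hι'ι' hP' hQ' hfinP' hfinQ' hP'Q' hdefP' hdefQ' hadj𝔩' => ?_)
    rw [hxrk] at hfinP' hfinQ'
    exact UnitaryEightTwentyOne.eq_top_of_smul hbr𝔩' hirr𝔩' hι' hι'ι' hP' hQ' hfinP' (by omega) (s := fun x y : U' => s ((x : Um) : W) y) (fun x y z => by simp only [Submodule.coe_add, hadd]) (fun c x y => by simp only [Submodule.coe_smul, hsmul]) (fun x y => hsymm _ _) hP'Q' hdefP' hdefQ' hadj𝔩'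
  have hkillm9 : ∀ X ∈ 𝔊, Θ * X = X → X * Θ = -X → X * ι = ι * X → Module.finrank ℂ (Um.map X) ≠ 9 := by
    intro X hX hΘX hXΘ hXc h9
    obtain ⟨hxmem, hιmx, hxιm, hxrk⟩ := UnitaryLeviSetup.restrict_mem hcm hLm hιmapply X hX hΘX hXΘ hXc
    rw [h9] at hxrk
    refine hfullm_of (UnitaryDoubleLevi.eq_top_of_raise_of_core hbrLm hirrLm hιmmem hιmιm hPm hQm
      (s := fun v w : Um => s (v : W) w) (hsU Um) (fun v w => hsymm v w) hPmQm hdefPm hdefQm hadjLm hxmem hιmx hxιm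
      (by rw [hxrk]; omega) (by omega) (by omega)
      fun U' 𝔩' ι' P' Q' hbr𝔩' hirr𝔩' hι' hι'ι' hP' hQ' hfinP' hfinQ' hP'Q' hdefP' hdefQ' hadj𝔩' => ?_)
    rw [hxrk] at hfinP' hfinQ'
    exact UnitaryNineTwenty.eq_top_of_smul hbr𝔩' hirr𝔩' hι' hι'ι' hP' hQ' hfinP' (by omega) (s := fun x y : U' => s ((x : Um) : W) y) (fun x y z => by simp only [Submodule.coe_add, hadd]) (fun c x y => by simp only [Submodule.coe_smul, hsmul]) (fun x y => hsymm _ _) hP'Q' hdefP' hdefQ' hadj𝔩'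
  have hkillm10 : ∀ X ∈ 𝔊, Θ * X = X → X * Θ = -X → X * ι = ι * X → Module.finrank ℂ (Um.map X) ≠ 10 := by
    intro X hX hΘX hXΘ hXc h10
    obtain ⟨hxmem, hιmx, hxιm, hxrk⟩ := UnitaryLeviSetup.restrict_mem hcm hLm hιmapply X hX hΘX hXΘ hXc
    rw [h10] at hxrk
    refine hfullm_of (UnitaryDoubleLevi.eq_top_of_raise_of_core hbrLm hirrLm hιmmem hιmιm hPm hQm
      (s := fun v w : Um => s (v : W) w) (hsU Um) (fun v w => hsymm v w) hPmQm hdefPm hdefQm hadjLm hxmem hιmx hxιm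
      (by rw [hxrk]; omega) (by omega) (by omega)
      fun U' 𝔩' ι' P' Q' hbr𝔩' hirr𝔩' hι' hι'ι' hP' hQ' hfinP' hfinQ' hP'Q' hdefP' hdefQ' hadj𝔩' => ?_)
    rw [hxrk] at hfinP' hfinQ'
    exact UnitaryTenNineteen.eq_top_of_smul hbr𝔩' hirr𝔩' hι' hι'ι' hP' hQ' hfinP' (by omega) (s := fun x y : U' => s ((x : Um) : W) y) (fun x y z => by simp only [Submodule.coe_add, hadd]) (fun c x y => by simp only [Submodule.coe_smul, hsmul]) (fun x y => hsymm _ _) hP'Q' hdefP' hdefQ' hadj𝔩'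
  have hkillm11 : ∀ X ∈ 𝔊, Θ * X = X → X * Θ = -X → X * ι = ι * X → Module.finrank ℂ (Um.map X) ≠ 11 := by
    intro X hX hΘX hXΘ hXc h11
    obtain ⟨hxmem, hιmx, hxιm, hxrk⟩ := UnitaryLeviSetup.restrict_mem hcm hLm hιmapply X hX hΘX hXΘ hXc
    rw [h11] at hxrk
    refine hfullm_of (UnitaryDoubleLevi.eq_top_of_raise_of_core hbrLm hirrLm hιmmem hιmιm hPm hQm
      (s := fun v w : Um => s (v : W) w) (hsU Um) (fun v w => hsymm v w) hPmQm hdefPm hdefQm hadjLm hxmem hιmx hxιm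
      (by rw [hxrk]; omega) (by omega) (by omega)
      fun U' 𝔩' ι' P' Q' hbr𝔩' hirr𝔩' hι' hι'ι' hP' hQ' hfinP' hfinQ' hP'Q' hdefP' hdefQ' hadj𝔩' => ?_)
    rw [hxrk] at hfinP' hfinQ'
    exact UnitaryEleven.eq_top_of_smul hbr𝔩' hirr𝔩' hι' hι'ι' hP' hQ' hfinP' (by omega) (s := fun x y : U' => s ((x : Um) : W) y) (fun x y z => by simp only [Submodule.coe_add, hadd]) (fun c x y => by simp only [Submodule.coe_smul, hsmul]) (fun x y => hsymm _ _) hP'Q' hdefP' hdefQ' hadj𝔩'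
  have hkillm12 : ∀ X ∈ 𝔊, Θ * X = X → X * Θ = -X → X * ι = ι * X → Module.finrank ℂ (Um.map X) ≠ 12 := by
    intro X hX hΘX hXΘ hXc h12
    obtain ⟨hxmem, hιmx, hxιm, hxrk⟩ := UnitaryLeviSetup.restrict_mem hcm hLm hιmapply X hX hΘX hXΘ hXc
    rw [h12] at hxrk
    refine hfullm_of (UnitaryDoubleLevi.eq_top_of_raise_of_core hbrLm hirrLm hιmmem hιmιm hPm hQm
      (s := fun v w : Um => s (v : W) w) (hsU Um) (fun v w => hsymm v w) hPmQm hdefPm hdefQm hadjLm hxmem hιmx hxιm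
      (by rw [hxrk]; omega) (by omega) (by omega)
      fun U' 𝔩' ι' P' Q' hbr𝔩' hirr𝔩' hι' hι'ι' hP' hQ' hfinP' hfinQ' hP'Q' hdefP' hdefQ' hadj𝔩' => ?_)
    rw [hxrk] at hfinP' hfinQ'
    exact UnitarySeventeen.eq_top_of_smul hbr𝔩' hirr𝔩' hι' hι'ι' hP' hQ' (by omega) (by omega) (by omega) (s := fun x y : U' => s ((x : Um) : W) y) (fun x y z => by simp only [Submodule.coe_add, hadd]) (fun c x y => by simp only [Submodule.coe_smul, hsmul]) (fun x y => hsymm _ _) hP'Q' hdefP' hdefQ' hadj𝔩'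
  have hkillm13 : ∀ X ∈ 𝔊, Θ * X = X → X * Θ = -X → X * ι = ι * X → Module.finrank ℂ (Um.map X) ≠ 13 := by
    intro X hX hΘX hXΘ hXc h13
    obtain ⟨hxmem, hιmx, hxιm, hxrk⟩ := UnitaryLeviSetup.restrict_mem hcm hLm hιmapply X hX hΘX hXΘ hXc
    rw [h13] at hxrk
    refine hfullm_of (UnitaryDoubleLevi.eq_top_of_raise_of_core hbrLm hirrLm hιmmem hιmιm hPm hQm
      (s := fun v w : Um => s (v : W) w) (hsU Um) (fun v w => hsymm v w) hPmQm hdefPm hdefQm hadjLm hxmem hιmx hxιm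
      (by rw [hxrk]; omega) (by omega) (by omega)
      fun U' 𝔩' ι' P' Q' hbr𝔩' hirr𝔩' hι' hι'ι' hP' hQ' hfinP' hfinQ' hP'Q' hdefP' hdefQ' hadj𝔩' => ?_)
    rw [hxrk] at hfinP' hfinQ'
    exact UnitaryThirteen.eq_top_of_smul hbr𝔩' hirr𝔩' hι' hι'ι' hP' hQ' hfinP' (by omega) (s := fun x y : U' => s ((x : Um) : W) y) (fun x y z => by simp only [Submodule.coe_add, hadd]) (fun c x y => by simp only [Submodule.coe_smul, hsmul]) (fun x y => hsymm _ _) hP'Q' hdefP' hdefQ' hadj𝔩'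
  have hkillm14 : ∀ X ∈ 𝔊, Θ * X = X → X * Θ = -X → X * ι = ι * X → Module.finrank ℂ (Um.map X) ≠ 14 := by
    intro X hX hΘX hXΘ hXc h14
    obtain ⟨hxmem, hιmx, hxιm, hxrk⟩ := UnitaryLeviSetup.restrict_mem hcm hLm hιmapply X hX hΘX hXΘ hXc
    rw [h14] at hxrk
    refine hfullm_of (UnitaryDoubleLevi.eq_top_of_raise_of_core hbrLm hirrLm hιmmem hιmιm hPm hQm
      (s := fun v w : Um => s (v : W) w) (hsU Um) (fun v w => hsymm v w) hPmQm hdefPm hdefQm hadjLm hxmem hιmx hxιm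
      (by rw [hxrk]; omega) (by omega) (by omega)
      fun U' 𝔩' ι' P' Q' hbr𝔩' hirr𝔩' hι' hι'ι' hP' hQ' hfinP' hfinQ' hP'Q' hdefP' hdefQ' hadj𝔩' => ?_)
    rw [hxrk] at hfinP' hfinQ'
    exact UnitaryFourteenFifteen.eq_top_of_smul hbr𝔩' hirr𝔩' hι' hι'ι' hP' hQ' hfinP' (by omega) (s := fun x y : U' => s ((x : Um) : W) y) (fun x y z => by simp only [Submodule.coe_add, hadd]) (fun c x y => by simp only [Submodule.coe_smul, hsmul]) (fun x y => hsymm _ _) hP'Q' hdefP' hdefQ' hadj𝔩'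
  have hkillm15 : ∀ X ∈ 𝔊, Θ * X = X → X * Θ = -X → X * ι = ι * X → Module.finrank ℂ (Um.map X) ≠ 15 := by
    intro X hX hΘX hXΘ hXc h15
    obtain ⟨hxmem, hιmx, hxιm, hxrk⟩ := UnitaryLeviSetup.restrict_mem hcm hLm hιmapply X hX hΘX hXΘ hXc
    rw [h15] at hxrk
    refine hfullm_of (UnitaryDoubleLevi.eq_top_of_raise_of_core hbrLm hirrLm hιmmem hιmιm hPm hQm
      (s := fun v w : Um => s (v : W) w) (hsU Um) (fun v w => hsymm v w) hPmQm hdefPm hdefQm hadjLm hxmem hιmx hxιm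
      (by rw [hxrk]; omega) (by omega) (by omega)
      fun U' 𝔩' ι' P' Q' hbr𝔩' hirr𝔩' hι' hι'ι' hP' hQ' hfinP' hfinQ' hP'Q' hdefP' hdefQ' hadj𝔩' => ?_)
    rw [hxrk] at hfinP' hfinQ'
    exact UnitaryFourteenFifteen.eq_top_of_smul' hbr𝔩' hirr𝔩' hι' hι'ι' hP' hQ' hfinP' (by omega) (s := fun x y : U' => s ((x : Um) : W) y) (fun x y z => by simp only [Submodule.coe_add, hadd]) (fun c x y => by simp only [Submodule.coe_smul, hsmul]) (fun x y => hsymm _ _) hP'Q' hdefP' hdefQ' hadj𝔩'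
  have hkillm16 : ∀ X ∈ 𝔊, Θ * X = X → X * Θ = -X → X * ι = ι * X → Module.finrank ℂ (Um.map X) ≠ 16 := by
    intro X hX hΘX hXΘ hXc h16
    obtain ⟨hxmem, hιmx, hxιm, hxrk⟩ := UnitaryLeviSetup.restrict_mem hcm hLm hιmapply X hX hΘX hXΘ hXc
    rw [h16] at hxrk
    refine hfullm_of (UnitaryDoubleLevi.eq_top_of_raise_of_core hbrLm hirrLm hιmmem hιmιm hPm hQm
      (s := fun v w : Um => s (v : W) w) (hsU Um) (fun v w => hsymm v w) hPmQm hdefPm hdefQm hadjLm hxmem hιmx hxιm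
      (by rw [hxrk]; omega) (by omega) (by omega)
      fun U' 𝔩' ι' P' Q' hbr𝔩' hirr𝔩' hι' hι'ι' hP' hQ' hfinP' hfinQ' hP'Q' hdefP' hdefQ' hadj𝔩' => ?_)
    rw [hxrk] at hfinP' hfinQ'
    exact UnitaryThirteen.eq_top_of_smul' hbr𝔩' hirr𝔩' hι' hι'ι' hP' hQ' (by omega) (by omega) (s := fun x y : U' => s ((x : Um) : W) y) (fun x y z => by simp only [Submodule.coe_add, hadd]) (fun c x y => by simp only [Submodule.coe_smul, hsmul]) (fun x y => hsymm _ _) hP'Q' hdefP' hdefQ' hadj𝔩'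
  have hkillm17 : ∀ X ∈ 𝔊, Θ * X = X → X * Θ = -X → X * ι = ι * X → Module.finrank ℂ (Um.map X) ≠ 17 := by
    intro X hX hΘX hXΘ hXc h17
    obtain ⟨hxmem, hιmx, hxιm, hxrk⟩ := UnitaryLeviSetup.restrict_mem hcm hLm hιmapply X hX hΘX hXΘ hXc
    rw [h17] at hxrk
    refine hfullm_of (UnitaryDoubleLevi.eq_top_of_raise_of_core hbrLm hirrLm hιmmem hιmιm hPm hQm
      (s := fun v w : Um => s (v : W) w) (hsU Um) (fun v w => hsymm v w) hPmQm hdefPm hdefQm hadjLm hxmem hιmx hxιm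
      (by rw [hxrk]; omega) (by omega) (by omega)
      fun U' 𝔩' ι' P' Q' hbr𝔩' hirr𝔩' hι' hι'ι' hP' hQ' hfinP' hfinQ' hP'Q' hdefP' hdefQ' hadj𝔩' => ?_)
    rw [hxrk] at hfinP' hfinQ'
    exact UnitarySeventeen.eq_top_of_smul' hbr𝔩' hirr𝔩' hι' hι'ι' hP' hQ' hfinP' (by omega) (by omega) (s := fun x y : U' => s ((x : Um) : W) y) (fun x y z => by simp only [Submodule.coe_add, hadd]) (fun c x y => by simp only [Submodule.coe_smul, hsmul]) (fun x y => hsymm _ _) hP'Q' hdefP' hdefQ' hadj𝔩'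
  have hkillm18 : ∀ X ∈ 𝔊, Θ * X = X → X * Θ = -X → X * ι = ι * X → Module.finrank ℂ (Um.map X) ≠ 18 := by
    intro X hX hΘX hXΘ hXc h18
    obtain ⟨hxmem, hιmx, hxιm, hxrk⟩ := UnitaryLeviSetup.restrict_mem hcm hLm hιmapply X hX hΘX hXΘ hXc
    rw [h18] at hxrk
    refine hfullm_of (UnitaryDoubleLevi.eq_top_of_raise_of_core hbrLm hirrLm hιmmem hιmιm hPm hQm
      (s := fun v w : Um => s (v : W) w) (hsU Um) (fun v w => hsymm v w) hPmQm hdefPm hdefQm hadjLm hxmem hιmx hxιm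
      (by rw [hxrk]; omega) (by omega) (by omega)
      fun U' 𝔩' ι' P' Q' hbr𝔩' hirr𝔩' hι' hι'ι' hP' hQ' hfinP' hfinQ' hP'Q' hdefP' hdefQ' hadj𝔩' => ?_)
    rw [hxrk] at hfinP' hfinQ'
    exact UnitaryEleven.eq_top_of_smul' hbr𝔩' hirr𝔩' hι' hι'ι' hP' hQ' (by omega) (by omega) (s := fun x y : U' => s ((x : Um) : W) y) (fun x y z => by simp only [Submodule.coe_add, hadd]) (fun c x y => by simp only [Submodule.coe_smul, hsmul]) (fun x y => hsymm _ _) hP'Q' hdefP' hdefQ' hadj𝔩'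
  have hkillm19 : ∀ X ∈ 𝔊, Θ * X = X → X * Θ = -X → X * ι = ι * X → Module.finrank ℂ (Um.map X) ≠ 19 := by
    intro X hX hΘX hXΘ hXc h19
    obtain ⟨hxmem, hιmx, hxιm, hxrk⟩ := UnitaryLeviSetup.restrict_mem hcm hLm hιmapply X hX hΘX hXΘ hXc
    rw [h19] at hxrk
    refine hfullm_of (UnitaryDoubleLevi.eq_top_of_raise_of_core hbrLm hirrLm hιmmem hιmιm hPm hQm
      (s := fun v w : Um => s (v : W) w) (hsU Um) (fun v w => hsymm v w) hPmQm hdefPm hdefQm hadjLm hxmem hιmx hxιm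
      (by rw [hxrk]; omega) (by omega) (by omega)
      fun U' 𝔩' ι' P' Q' hbr𝔩' hirr𝔩' hι' hι'ι' hP' hQ' hfinP' hfinQ' hP'Q' hdefP' hdefQ' hadj𝔩' => ?_)
    rw [hxrk] at hfinP' hfinQ'
    exact UnitaryTenNineteen.eq_top_of_smul' hbr𝔩' hirr𝔩' hι' hι'ι' hP' hQ' hfinP' (by omega) (s := fun x y : U' => s ((x : Um) : W) y) (fun x y z => by simp only [Submodule.coe_add, hadd]) (fun c x y => by simp only [Submodule.coe_smul, hsmul]) (fun x y => hsymm _ _) hP'Q' hdefP' hdefQ' hadj𝔩'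
  have hfullp_of : Lp = ⊤ → False := by
    intro hLptop
    obtain ⟨T1, hιT1, hT1ι, hT1r⟩ := UnitaryRaisingSpace.exists_raise_finrank_range_eq hιpιp hPp hQp (k := 1)
      (by omega) (by omega)
    obtain ⟨X1, hX1, hΘX1, hX1Θ, hX1c, hX1Up⟩ := UnitaryLeviSetup.exists_lift hbr hΘ hΘΘ hcp hιΘ hLp hιpapply T1
      (by rw [hLptop]; exact Submodule.mem_top) hιT1 hT1ι
    rw [hT1r] at hX1Up
    obtain ⟨hs1, hi1, hi1', hj1, hj1'⟩ := hsplit X1 hΘX1 hX1Θ hX1c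
    have hrk1 := hS X1 hX1 hΘX1 hX1Θ
    have hd1 := hdich X1 hX1 hΘX1 hX1Θ hX1c
    rw [hs1] at hrk1
    rw [hX1Up] at hrk1 hd1
    have hk_hkillm18 := hkillm18 X1 hX1 hΘX1 hX1Θ hX1c
    omega
  have hprof : ∀ X ∈ 𝔊, Θ * X = X → X * Θ = -X → X * ι = ι * X →
      (Module.finrank ℂ (Up.map X) = 0 ∧ Module.finrank ℂ (Um.map X) = 0) := by
    intro X hX hΘX hXΘ hXc
    obtain ⟨hs, hi, hi', hj, hj'⟩ := hsplit X hΘX hXΘ hXc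
    have hkillm3' := hkillm3 X hX hΘX hXΘ hXc
    have hkillm4' := hkillm4 X hX hΘX hXΘ hXc
    have hkillm5' := hkillm5 X hX hΘX hXΘ hXc
    have hkillm6' := hkillm6 X hX hΘX hXΘ hXc
    have hkillm7' := hkillm7 X hX hΘX hXΘ hXc
    have hkillm8' := hkillm8 X hX hΘX hXΘ hXc
    have hkillm9' := hkillm9 X hX hΘX hXΘ hXc
    have hkillm10' := hkillm10 X hX hΘX hXΘ hXc
    have hkillm11' := hkillm11 X hX hΘX hXΘ hXc
    have hkillm12' := hkillm12 X hX hΘX hXΘ hXc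
    have hkillm13' := hkillm13 X hX hΘX hXΘ hXc
    have hkillm14' := hkillm14 X hX hΘX hXΘ hXc
    have hkillm15' := hkillm15 X hX hΘX hXΘ hXc
    have hkillm16' := hkillm16 X hX hΘX hXΘ hXc
    have hkillm17' := hkillm17 X hX hΘX hXΘ hXc
    have hkillm18' := hkillm18 X hX hΘX hXΘ hXc
    have hkillm19' := hkillm19 X hX hΘX hXΘ hXc
    have hrk := hS X hX hΘX hXΘ
    have hd := hdich X hX hΘX hXΘ hXc
    rw [hs] at hrk
    generalize Module.finrank ℂ ↥(Submodule.map X Um) = jj at *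
    have hjle : jj ≤ 19 := by omega
    interval_cases jj
    · exact ⟨by omega, rfl⟩
    · exfalso; omega
    · exfalso; omega
    · exact (hkillm3' rfl).elim
    · exact (hkillm4' rfl).elim
    · exact (hkillm5' rfl).elim
    · exact (hkillm6' rfl).elim
    · exact (hkillm7' rfl).elim
    · exact (hkillm8' rfl).elim
    · exact (hkillm9' rfl).elim
    · exact (hkillm10' rfl).elim
    · exact (hkillm11' rfl).elim
    · exact (hkillm12' rfl).elim
    · exact (hkillm13' rfl).elim
    · exact (hkillm14' rfl).elim
    · exact (hkillm15' rfl).elim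
    · exact (hkillm16' rfl).elim
    · exact (hkillm17' rfl).elim
    · exact (hkillm18' rfl).elim
    · exact (hkillm19' rfl).elim
  obtain ⟨⟨p, hp⟩, hp0⟩ := Module.finrank_pos_iff_exists_ne_zero.1 (show 0 < Module.finrank ℂ PU by omega)
  obtain ⟨⟨q, hq⟩, hq0⟩ := Module.finrank_pos_iff_exists_ne_zero.1 (show 0 < Module.finrank ℂ QU by omega)
  obtain ⟨X₀, hX₀, hΘX₀, hX₀Θ, hX₀c, c₀, hιc₀, -, hX₀c0⟩ :=
    UnitaryLeviFull.exists_raise_commute_apply_ne_zero hbr hirr hΘ hΘΘ hQ hιmem hιι hιΘ hUm hUp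
      ⟨p, fun h => hp0 (Subtype.ext h), ((hPU p).1 hp).1, ((hPU p).1 hp).2⟩
      ⟨q, fun h => hq0 (Subtype.ext h), ((hQU q).1 hq).1, ((hQU q).1 hq).2⟩
  have hX₀i : Module.finrank ℂ (Up.map X₀) ≠ 0 := fun h0 => by
    have hmem : X₀ c₀ ∈ Up.map X₀ := Submodule.mem_map_of_mem ((hUp c₀).2 hιc₀)
    rw [Submodule.finrank_eq_zero.1 h0, Submodule.mem_bot] at hmem
    exact hX₀c0 hmem
  have hp0 := hprof X₀ hX₀ hΘX₀ hX₀Θ hX₀c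
  omega


end HodgeStructure

end Literature.AlgebraicGeometry.Motives

end
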